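import Mathlib.RingTheory.SimpleRing.Principal
import Mathlib.RingTheory.RegularLocalRing.Defs
import Mathlib.Analysis.InnerProductSpace.NormDet
import Literature.NumberTheory.EllipticCurves.HeckeEisensteinWeightOneForm
import Literature.NumberTheory.ModularForms.BinaryThetaHigherWeightCoset
import Literature.NumberTheory.LFunctions.RayClassOrbitSums
import Literature.NumberTheory.ModularForms.BinaryThetaHigherWeightSpan
import Literature.NumberTheory.EllipticCurves.CMNewformGamma0OfGrossencharakterProofs
import HarnessLib

/-!
# Hecke's theta series of a Grössencharacter (Ribet 1977 §3 / Hecke 1927): coset ideals, Gram data, class counts, theta nulls and their multipliers, coset / class theta series at every weight, Nebentypus, and `Ribet1977_cmNewform_gamma0_of_isGrossencharakter` HOLDS (re-homed proofs)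

**Ribet 1977 / Hecke 1927: the CM newform on `Γ₀` attached to a Grössencharacter of an imaginary quadratic field — the named fact
`Literature.NumberTheory.EllipticCurves.ModularForms.Ribet1977_cmNewform_gamma0_of_isGrossencharakter` (`CMNewformGamma0OfGrossencharakter.lean`) HOLDS — EXACT name `…_holds`** ([Ribet1977Nebentypus] K. Ribet,
*Galois representations attached to eigenforms with Nebentypus*, LNM 601 (1977), §3 Thm. (3.4), Cor. (3.5); [Hecke1927]; [Miyake2006] Thm. 4.8.2; [Shimura1971ZetaCM]).
Contents: Hecke's theta series of a Grössencharacter at every weight — coset ideals and theta cosets, the Gram data and class counts of the binary form, the weighted class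
theta series, the Eisenstein part, q-expansions, the unit character at `2`, the Nebentypus computation (quadratic character times the trivial character on `Γ₀(N)`), the class /
class-series assembly at weight `2` and at higher weight, and the discharge (odd weights vacuous by the trivial-Nebentypus clause).
RE-HOMED into `Literature/` by the Hodge foundations lane (`lit-hodgefound`, seat p20, generation 40): verbatim DECLARATION-LEVEL ports (the 65 declarations needed, in dependency
order; each Part is a slice of one Summits module) of 20 theorem modules `Summits/BirchSwinnertonDyer/BirchSwinnertonDyer/Theorems/ResidualThetaTransportAtTwo{HeckeTheta*,RibetCMNewformGammaZeroSupplyProof}.lean`;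
the namespaces `….Theorems.HeckeTheta` / `….HeckeThetaPartner` are re-rooted at `Literature.NumberTheory.EllipticCurves.ModularForms.HeckeTheta(Partner)`; the `_holds` theorem carries the EXACT name.
Theorem-only: no definition, no new named fact (D-0026); imports Mathlib/Literature only; every declaration carries the citation of the printed statement it formalises or serves.
The Summits originals stay in place (transitional duplication).  WHAT THIS IS NOT: nothing here bears on BSD; it is Hecke's construction of CM forms in the tree's vocabulary.
-/

noncomputable section

/-!
## Part 1 — port of `Summits/BirchSwinnertonDyer/BirchSwinnertonDyer/Theorems/ResidualThetaTransportAtTwoHeckeThetaPartnerAdicAtTwoUnitCharacterPrelim.lean` (2 declarations kept)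

# The unit character `λ` of an imaginary quadratic field modulo a rational integer

Declarations of this Part (verbatim port; each keeps its own docstring and citation): `norm_embedding_sq_eq_abs_norm`, `norm_embedding_unit_eq_one`.

Reference keys (see `references.bib` and the declarations' citations): [Ribet1977Nebentypus].
-/

section Part1

open scoped _root_.NumberField ComplexConjugate
open _root_.NumberField _root_.IsDedekindDomain _root_.Module
open Literature.NumberTheory.GaloisRepresentations Literature.NumberTheory.LFunctions
  Literature.NumberTheory.QuadraticFields.Quadratic

namespace Literature.NumberTheory.EllipticCurves.ModularForms.HeckeThetaPartner

variable {k : Type} [Field k] [NumberField k]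

/-- **`‖σ x‖² = |N(x)|` in an imaginary quadratic field** (product formula: `k` has a single infinite
place, of multiplicity `2`). [cite: Ribet1977Nebentypus, §3 (supporting lemma)] -/
theorem norm_embedding_sq_eq_abs_norm (hk : finrank ℚ k = 2) [IsTotallyComplex k] (σ : k →+* ℂ)
    (x : k) : ‖σ x‖ ^ 2 = |(Algebra.norm ℚ x : ℚ)| := by
  classical
  have hr : InfinitePlace.nrRealPlaces k = 0 := (NumberField.nrRealPlaces_eq_zero_iff).mpr inferInstance
  have hc : InfinitePlace.nrComplexPlaces k = 1 := by
    have h := InfinitePlace.card_add_two_mul_card_eq_rank k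
    rw [hk, hr] at h
    omega
  have hcard : Fintype.card (InfinitePlace k) = 1 := by
    rw [InfinitePlace.card_eq_nrRealPlaces_add_nrComplexPlaces, hr, hc]
  set w₀ : InfinitePlace k := InfinitePlace.mk σ
  have hall : ∀ w : InfinitePlace k, w = w₀ := fun w => Fintype.card_le_one_iff.mp hcard.le w w₀
  have hprod := InfinitePlace.prod_eq_abs_norm x
  rw [Fintype.prod_eq_single w₀ (fun w hw => absurd (hall w) hw),
    InfinitePlace.mult_isComplex ⟨w₀, IsTotallyComplex.isComplex w₀⟩,
    show w₀ x = ‖σ x‖ from InfinitePlace.apply σ _] at hprod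
  rw [hprod]

/-- Units of an imaginary quadratic field have absolute value `1` under every embedding. [cite: Ribet1977Nebentypus, §3 (supporting lemma)] -/
theorem norm_embedding_unit_eq_one (hk : finrank ℚ k = 2) [IsTotallyComplex k] (σ : k →+* ℂ)
    (u : (𝓞 k)ˣ) : ‖σ ((u : 𝓞 k) : k)‖ = 1 := by
  have h := norm_embedding_sq_eq_abs_norm hk σ ((u : 𝓞 k) : k)
  rw [NumberField.Units.norm] at h
  have h0 : 0 ≤ ‖σ ((u : 𝓞 k) : k)‖ := norm_nonneg _
  have h1 : ‖σ ((u : 𝓞 k) : k)‖ ^ 2 = 1 := by exact_mod_cast h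
  nlinarith [h1, h0]

end Literature.NumberTheory.EllipticCurves.ModularForms.HeckeThetaPartner

end Part1

/-!
## Part 2 — port of `Summits/BirchSwinnertonDyer/BirchSwinnertonDyer/Theorems/ResidualThetaTransportAtTwoHeckeThetaPartnerAdicAtTwoMatchingAtTwoPrelim.lean` (1 declarations kept)

# Matching the cubic character with the embedding at the inert prime `2` — preliminaries

Declarations of this Part (verbatim port; each keeps its own docstring and citation): `false_of_ringHom_real`.

Reference keys (see `references.bib` and the declarations' citations): [Ribet1977Nebentypus].
-/

section Part2

open scoped _root_.NumberField
open _root_.NumberField _root_.IsDedekindDomain _root_.IsLocalRing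
open Literature.NumberTheory.GaloisRepresentations Literature.NumberTheory.LFunctions Literature.NumberTheory.Automorphic Literature.NumberTheory.EllipticCurves.ModularForms

namespace Literature.NumberTheory.EllipticCurves.ModularForms.HeckeThetaPartner

section Real

variable {k : Type} [Field k] [NumberField k]

omit [NumberField k] in
/-- A totally complex field has no real embedding. [cite: Ribet1977Nebentypus, §3 (supporting lemma)] -/
theorem false_of_ringHom_real [IsTotallyComplex k] (φ : k →+* ℝ) : False := by
  have hreal : ComplexEmbedding.IsReal ((algebraMap ℝ ℂ).comp φ) := by
    rw [ComplexEmbedding.isReal_iff]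
    ext x
    simp [ComplexEmbedding.conjugate_coe_eq]
  have h1 : (InfinitePlace.mk ((algebraMap ℝ ℂ).comp φ)).IsReal := ⟨_, hreal, rfl⟩
  exact InfinitePlace.not_isReal_iff_isComplex.mpr (IsTotallyComplex.isComplex _) h1

end Real

end Literature.NumberTheory.EllipticCurves.ModularForms.HeckeThetaPartner

end Part2

/-!
## Part 3 — port of `Summits/BirchSwinnertonDyer/BirchSwinnertonDyer/Theorems/ResidualThetaTransportAtTwoHeckeThetaPartnerAdicAtTwoThetaGram.lean` (8 declarations kept)

# The Gram matrix of an ideal lattice of an imaginary quadratic field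

Declarations of this Part (verbatim port; each keeps its own docstring and citation): `absNorm_dvd_natAbs_norm`, `normSq_embedding_eq`, `normSq_add_sub`, `exists_basis_fin_two`, `conjugate_ne`, `algHom_eq_or_eq_conjugate`, `det_embeddings_sq`, `exists_gram`.

Reference keys (see `references.bib` and the declarations' citations): [Ribet1977Nebentypus].
-/

section Part3

open scoped _root_.NumberField ComplexConjugate
open _root_.NumberField _root_.Module _root_.Matrix _root_.Complex

namespace Literature.NumberTheory.EllipticCurves.ModularForms.HeckeTheta

open Literature.NumberTheory.EllipticCurves.ModularForms.HeckeThetaPartner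

variable {K : Type} [Field K] [NumberField K]

/-! ### Norms of elements of an ideal -/

/-- `N𝔟 ∣ |N(x)|` for `x ∈ 𝔟` (`(x) ⊆ 𝔟`, multiplicativity of the ideal norm).
[cite: Ribet1977Nebentypus, §3 (supporting lemma)] -/
theorem absNorm_dvd_natAbs_norm {𝔟 : Ideal (𝓞 K)} {x : 𝓞 K} (hx : x ∈ 𝔟) :
    Ideal.absNorm 𝔟 ∣ (Algebra.norm ℤ x).natAbs := by
  rw [← Ideal.absNorm_span_singleton]
  exact Ideal.absNorm_dvd_absNorm_of_le ((Ideal.span_singleton_le_iff_mem _).mpr hx)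

/-- `‖σ x‖² = |N(x)|` for an integer `x` of an imaginary quadratic field (real numbers).
[cite: Ribet1977Nebentypus, §3 (supporting lemma)] -/
theorem normSq_embedding_eq (hK : finrank ℚ K = 2) [IsTotallyComplex K] (σ : K →+* ℂ) (x : 𝓞 K) :
    ‖σ (x : K)‖ ^ 2 = ((Algebra.norm ℤ x).natAbs : ℝ) := by
  rw [norm_embedding_sq_eq_abs_norm hK σ (x : K), ← Algebra.coe_norm_int, Nat.cast_natAbs, Int.cast_abs]
  push_cast
  rfl

/-- Polarization in `ℂ`: `‖u + w‖² - ‖u‖² - ‖w‖² = u·w̄ + ū·w` (as a complex number).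
[cite: Ribet1977Nebentypus, §3 (supporting lemma)] -/
private theorem normSq_add_sub (u w : ℂ) :
    ((‖u + w‖ ^ 2 - ‖u‖ ^ 2 - ‖w‖ ^ 2 : ℝ) : ℂ) = u * conj w + conj u * w := by
  have h : ‖u + w‖ ^ 2 - ‖u‖ ^ 2 - ‖w‖ ^ 2 = 2 * (u * conj w).re := by
    rw [Complex.sq_norm, Complex.sq_norm, Complex.sq_norm, Complex.normSq_add]; ring
  rw [h]
  have h2 : conj u * w = conj (u * conj w) := by rw [map_mul, Complex.conj_conj]
  rw [h2, Complex.add_conj]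

/-! ### A `ℤ`-basis of a nonzero ideal indexed by `Fin 2` -/

/-- A nonzero ideal of the ring of integers of a quadratic field has a `ℤ`-basis indexed by `Fin 2`
(Mathlib's `Ideal.selfBasis`, reindexed). [cite: Ribet1977Nebentypus, §3 (supporting lemma)] -/
theorem exists_basis_fin_two (hK : finrank ℚ K = 2) {𝔟 : Ideal (𝓞 K)} (h𝔟 : 𝔟 ≠ ⊥) :
    ∃ _b : Basis (Fin 2) ℤ 𝔟, True := by
  classical
  have hcard : Fintype.card (Free.ChooseBasisIndex ℤ (𝓞 K)) = 2 := by
    rw [← Module.finrank_eq_card_chooseBasisIndex, RingOfIntegers.rank, hK]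
  exact ⟨(Ideal.selfBasis (RingOfIntegers.basis K) 𝔟 h𝔟).reindex (Fintype.equivFinOfCardEq hcard),
    trivial⟩

/-! ### The discriminant identity `(σb₀ σ̄b₁ - σ̄b₀ σb₁)² = d_K N𝔟²` -/

omit [NumberField K] in
/-- For a totally complex field, `conj ∘ σ ≠ σ` for every complex embedding `σ`.
[cite: Ribet1977Nebentypus, §3 (supporting lemma)] -/
theorem conjugate_ne [IsTotallyComplex K] (σ : K →+* ℂ) : ComplexEmbedding.conjugate σ ≠ σ := by
  intro h
  exact false_of_ringHom_real (ComplexEmbedding.isReal_iff.mpr h).embedding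

/-- The two `ℚ`-algebra embeddings of an imaginary quadratic field into `ℂ` are `σ` and `σ̄`:
every `φ : K →ₐ[ℚ] ℂ` is one of them. [cite: Ribet1977Nebentypus, §3 (supporting lemma)] -/
theorem algHom_eq_or_eq_conjugate (hK : finrank ℚ K = 2) [IsTotallyComplex K] (σ : K →+* ℂ)
    (φ : K →ₐ[ℚ] ℂ) : (φ : K →+* ℂ) = σ ∨ (φ : K →+* ℂ) = ComplexEmbedding.conjugate σ := by
  classical
  by_contra h
  push Not at h
  -- three distinct ring embeddings in a set of cardinality `2`
  have hcard : Fintype.card (K →+* ℂ) = 2 := by rw [NumberField.Embeddings.card, hK]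
  have h3 : Fintype.card (Fin 3) ≤ Fintype.card (K →+* ℂ) := by
    refine Fintype.card_le_of_injective ![(φ : K →+* ℂ), σ, ComplexEmbedding.conjugate σ] ?_
    intro i j hij
    fin_cases i <;> fin_cases j <;> simp_all [conjugate_ne σ, (conjugate_ne σ).symm]
  simp [hcard] at h3

/-- **`(σb₀·σ̄b₁ - σ̄b₀·σb₁)² = d_K · N𝔟²`** for a `ℤ`-basis `b` of a nonzero ideal `𝔟` of an
imaginary quadratic field: the discriminant of the `ℚ`-basis `b` of `K` is `det(P)² d_K` with
`|det P| = N𝔟` (`Algebra.discr_of_matrix_vecMul`, `Ideal.natAbs_det_basis_change`), and equals the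
square of the determinant of the embeddings matrix (`Algebra.discr_eq_det_embeddingsMatrixReindex_pow_two`).
[cite: Ribet1977Nebentypus, §3 (supporting lemma)] -/
theorem det_embeddings_sq (hK : finrank ℚ K = 2) [IsTotallyComplex K] (σ : K →+* ℂ)
    {𝔟 : Ideal (𝓞 K)} (b : Basis (Fin 2) ℤ 𝔟) :
    (σ ((b 0 : 𝓞 K) : K) * conj (σ ((b 1 : 𝓞 K) : K)) - conj (σ ((b 0 : 𝓞 K) : K)) * σ ((b 1 : 𝓞 K) : K)) ^ 2 =
      ((discr K : ℤ) : ℂ) * ((Ideal.absNorm 𝔟 : ℕ) : ℂ) ^ 2 := by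
  classical
  -- the integral basis of `𝓞 K` indexed by `Fin 2`
  have hcard : Fintype.card (Free.ChooseBasisIndex ℤ (𝓞 K)) = 2 := by
    rw [← Module.finrank_eq_card_chooseBasisIndex, RingOfIntegers.rank, hK]
  set w : Basis (Fin 2) ℤ (𝓞 K) := (RingOfIntegers.basis K).reindex (Fintype.equivFinOfCardEq hcard)
    with hw
  -- the family `v = b` in `K` and the change-of-basis matrix `P`
  set v : Fin 2 → K := fun i => ((b i : 𝓞 K) : K) with hv
  set wK : Fin 2 → K := fun i => ((w i : 𝓞 K) : K) with hwK
  set P : Matrix (Fin 2) (Fin 2) ℤ := w.toMatrix (fun i => (b i : 𝓞 K)) with hP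
  have hPdet : (P.det).natAbs = Ideal.absNorm 𝔟 := by
    rw [hP, ← Basis.det_apply]
    exact Ideal.natAbs_det_basis_change w 𝔟 b
  -- `v = wK ᵥ* P` in `K`
  have hvw : v = wK ᵥ* P.map (algebraMap ℤ K) := by
    funext j
    have h := w.sum_toMatrix_smul_self (v := fun i => (b i : 𝓞 K)) j
    simp only [hv, hwK, Matrix.vecMul, dotProduct, Matrix.map_apply]
    rw [← h]
    push_cast
    simp only [zsmul_eq_mul]
    refine Finset.sum_congr rfl fun i _ => ?_
    rw [hP, mul_comm]
    simp
  -- discriminants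
  have hdw : Algebra.discr ℚ wK = (discr K : ℚ) := by
    have h1 : Algebra.discr ℤ w = discr K := NumberField.discr_eq_discr K w
    have h2 : Algebra.discr ℚ (w.localizationLocalization ℚ (nonZeroDivisors ℤ) K) =
        algebraMap ℤ ℚ (Algebra.discr ℤ w) :=
      Algebra.discr_localizationLocalization ℤ (nonZeroDivisors ℤ) K w
    have h3 : (w.localizationLocalization ℚ (nonZeroDivisors ℤ) K : Fin 2 → K) = wK := by
      funext i
      rw [Basis.localizationLocalization_apply, hwK]
    rw [← h3, h2, h1]
    simp
  have hdv : Algebra.discr ℚ v = (P.det : ℚ) ^ 2 * (discr K : ℚ) := by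
    rw [hvw]
    have hmap : P.map (algebraMap ℤ K) = (P.map (Int.cast : ℤ → ℚ)).map (algebraMap ℚ K) := by
      ext i j; simp
    rw [hmap, Algebra.discr_of_matrix_vecMul, ← hdw]
    congr 1
    rw [show (P.det : ℚ) = (Int.castRingHom ℚ) P.det from rfl, RingHom.map_det]
    rfl
  -- the embeddings matrix for `e = (σ, σ̄)` up to order
  have hcardA : Fintype.card (Fin 2) = finrank ℚ K := by rw [hK]; rfl
  obtain ⟨e⟩ : Nonempty (Fin 2 ≃ (K →ₐ[ℚ] ℂ)) := by
    refine Fintype.card_eq.mp ?_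
    rw [AlgHom.card ℚ K ℂ, hK]; rfl
  have hE := Algebra.discr_eq_det_embeddingsMatrixReindex_pow_two ℚ ℂ v e
  rw [hdv, map_mul, map_pow] at hE
  -- `det² ` of the embeddings matrix, computed through `{e 0, e 1} = {σ, σ̄}`
  have hdet : (Algebra.embeddingsMatrixReindex ℚ ℂ v e).det ^ 2 =
      (σ (v 0) * conj (σ (v 1)) - conj (σ (v 0)) * σ (v 1)) ^ 2 := by
    rw [Matrix.det_fin_two]
    simp only [Algebra.embeddingsMatrixReindex, Matrix.reindex_apply, Matrix.submatrix_apply,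
      Equiv.refl_symm, Equiv.refl_apply, Equiv.symm_symm, Algebra.embeddingsMatrix_apply]
    have hne : e 0 ≠ e 1 := fun h => by simpa using e.injective h
    rcases algHom_eq_or_eq_conjugate hK σ (e 0) with h0 | h0 <;>
      rcases algHom_eq_or_eq_conjugate hK σ (e 1) with h1 | h1
    · exact absurd (AlgHom.coe_ringHom_injective (h0.trans h1.symm)) hne
    · have e0 : ∀ x, e 0 x = σ x := fun x => by rw [← h0]; rfl
      have e1 : ∀ x, e 1 x = conj (σ x) := fun x => by
        rw [show conj (σ x) = ComplexEmbedding.conjugate σ x from rfl, ← h1]; rfl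
      simp only [e0, e1]
    · have e0 : ∀ x, e 0 x = conj (σ x) := fun x => by
        rw [show conj (σ x) = ComplexEmbedding.conjugate σ x from rfl, ← h0]; rfl
      have e1 : ∀ x, e 1 x = σ x := fun x => by rw [← h1]; rfl
      simp only [e0, e1]; ring
    · exact absurd (AlgHom.coe_ringHom_injective (h0.trans h1.symm)) hne
  rw [hdet] at hE
  rw [← hE]
  have hPd : ((P.det : ℚ) : ℂ) ^ 2 = ((Ideal.absNorm 𝔟 : ℕ) : ℂ) ^ 2 := by
    rw [← hPdet]
    have : ((P.det.natAbs : ℕ) : ℂ) ^ 2 = ((P.det : ℤ) : ℂ) ^ 2 := by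
      rw [← Int.cast_natCast, ← Int.cast_pow, Int.natAbs_sq, Int.cast_pow]
    rw [this]; norm_cast
  simp only [eq_ratCast, Rat.cast_intCast] at hPd ⊢
  rw [hPd]; ring

/-! ### The Gram matrix -/

/-- **The Gram matrix of an ideal lattice.**  For an imaginary quadratic field `K` (`[K:ℚ] = 2`,
totally complex), a complex embedding `σ` and a nonzero ideal `𝔟`, there are a `ℤ`-basis `b` of `𝔟`
and `B ∈ M₂(ℤ)` — the Gram matrix of `Q_𝔟(x) = N(x)/N𝔟` — with
`B_{ij} = (σbᵢ \overline{σbⱼ} + \overline{σbᵢ} σbⱼ)/N𝔟`, `B` symmetric with even diagonal,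
`det B = |d_K|`, and `B` positive definite.  (Hecke 1926 §2; Cox Thm. 7.7: the norm form of an ideal
class is a primitive positive definite form of discriminant `d_K`.)
[cite: Ribet1977Nebentypus, §3 (supporting lemma)] -/
theorem exists_gram (hK : finrank ℚ K = 2) [IsTotallyComplex K] (σ : K →+* ℂ)
    {𝔟 : Ideal (𝓞 K)} (h𝔟 : 𝔟 ≠ ⊥) :
    ∃ (b : Basis (Fin 2) ℤ 𝔟) (B : Matrix (Fin 2) (Fin 2) ℤ),
      (∀ i j, ((B i j : ℤ) : ℂ) * ((Ideal.absNorm 𝔟 : ℕ) : ℂ) =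
        σ ((b i : 𝓞 K) : K) * conj (σ ((b j : 𝓞 K) : K)) + conj (σ ((b i : 𝓞 K) : K)) * σ ((b j : 𝓞 K) : K)) ∧
      B.IsSymm ∧ Even (B 0 0) ∧ Even (B 1 1) ∧ B.det = ((discr K).natAbs : ℤ) ∧
      (B.map (Int.cast : ℤ → ℝ)).PosDef := by
  classical
  obtain ⟨b, -⟩ := exists_basis_fin_two hK h𝔟
  have hN0 : Ideal.absNorm 𝔟 ≠ 0 := by
    rw [Ne, Ideal.absNorm_eq_zero_iff]; exact h𝔟
  have hNpos : (0 : ℝ) < (Ideal.absNorm 𝔟 : ℕ) := by exact_mod_cast Nat.pos_of_ne_zero hN0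
  -- the integral quadratic form `q(x) = |N x| / N𝔟` on `𝔟`
  set q : 𝔟 → ℕ := fun x => (Algebra.norm ℤ (x : 𝓞 K)).natAbs / Ideal.absNorm 𝔟 with hq
  have hq_mul : ∀ x : 𝔟, (q x : ℝ) * (Ideal.absNorm 𝔟 : ℕ) = ‖σ ((x : 𝓞 K) : K)‖ ^ 2 := by
    intro x
    rw [normSq_embedding_eq hK σ, hq]
    have hdvd := absNorm_dvd_natAbs_norm x.2
    exact_mod_cast Nat.div_mul_cancel hdvd
  set u : Fin 2 → ℂ := fun i => σ ((b i : 𝓞 K) : K) with hu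
  set B : Matrix (Fin 2) (Fin 2) ℤ := fun i j => (q (b i + b j) : ℤ) - q (b i) - q (b j) with hB
  -- the entry formula
  have hentry : ∀ i j, ((B i j : ℤ) : ℂ) * ((Ideal.absNorm 𝔟 : ℕ) : ℂ) = u i * conj (u j) + conj (u i) * u j := by
    intro i j
    have h1 := hq_mul (b i + b j)
    have h2 := hq_mul (b i)
    have h3 := hq_mul (b j)
    have hadd : σ (((b i + b j : 𝔟) : 𝓞 K) : K) = u i + u j := by
      simp [hu, Submodule.coe_add, map_add]
    rw [hadd] at h1
    rw [← normSq_add_sub (u i) (u j), ← h1, ← h2, ← h3]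
    simp only [hB]
    push_cast
    ring
  -- entries over `ℝ`: `B_{ij} N𝔟 = 2 Re(uᵢ ūⱼ)`
  have hentryR : ∀ i j, ((B i j : ℤ) : ℝ) * (Ideal.absNorm 𝔟 : ℕ) = 2 * (u i * conj (u j)).re := by
    intro i j
    have h := hentry i j
    have h2 : conj (u i) * u j = conj (u i * conj (u j)) := by rw [map_mul, Complex.conj_conj]
    rw [h2, Complex.add_conj] at h
    exact_mod_cast h
  have hsymm : B.IsSymm := by
    ext i j; simp only [Matrix.transpose_apply, hB]; rw [add_comm (b j) (b i)]; ring
  have hdiag : ∀ i, B i i = 2 * q (b i) := by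
    intro i
    have h : ((B i i : ℤ) : ℝ) * (Ideal.absNorm 𝔟 : ℕ) = ((2 * q (b i) : ℤ) : ℝ) * (Ideal.absNorm 𝔟 : ℕ) := by
      rw [hentryR]
      push_cast
      rw [mul_assoc, hq_mul (b i), hu]
      simp only
      rw [Complex.mul_conj, ← Complex.sq_norm]
      norm_cast
    have h' : ((B i i : ℤ) : ℝ) = ((2 * q (b i) : ℤ) : ℝ) :=
      mul_right_cancel₀ hNpos.ne' h
    exact_mod_cast h'
  -- the determinant
  have hIm : (u 0 * conj (u 1) - conj (u 0) * u 1) ^ 2 =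
      ((discr K : ℤ) : ℂ) * ((Ideal.absNorm 𝔟 : ℕ) : ℂ) ^ 2 := det_embeddings_sq hK σ b
  have hdetC : ((B.det : ℤ) : ℂ) * ((Ideal.absNorm 𝔟 : ℕ) : ℂ) ^ 2 =
      -((discr K : ℤ) : ℂ) * ((Ideal.absNorm 𝔟 : ℕ) : ℂ) ^ 2 := by
    rw [Matrix.det_fin_two]
    push_cast
    have e00 := hentry 0 0
    have e01 := hentry 0 1
    have e10 := hentry 1 0
    have e11 := hentry 1 1
    linear_combination ((B 1 1 : ℤ) : ℂ) * ((Ideal.absNorm 𝔟 : ℕ) : ℂ) * e00 +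
      (u 0 * conj (u 0) + conj (u 0) * u 0) * e11 - ((B 1 0 : ℤ) : ℂ) * ((Ideal.absNorm 𝔟 : ℕ) : ℂ) * e01 -
      (u 0 * conj (u 1) + conj (u 0) * u 1) * e10 - hIm
  -- `d_K < 0`: `(u₀ū₁ - ū₀u₁)² = d_K N𝔟²` is the square of a purely imaginary number
  have hz : u 0 * conj (u 1) - conj (u 0) * u 1 = ((2 * (u 0 * conj (u 1)).im : ℝ) : ℂ) * I := by
    rw [show conj (u 0) * u 1 = conj (u 0 * conj (u 1)) by rw [map_mul, Complex.conj_conj],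
      Complex.sub_conj]
  have hdK : discr K < 0 := by
    have hne : discr K ≠ 0 := NumberField.discr_ne_zero K
    have hre : ((discr K : ℤ) : ℝ) * ((Ideal.absNorm 𝔟 : ℕ) : ℝ) ^ 2 = -(2 * (u 0 * conj (u 1)).im) ^ 2 := by
      have h := hIm
      rw [hz, mul_pow, Complex.I_sq] at h
      have h' := congrArg Complex.re h
      simp only [Complex.mul_re, Complex.neg_re, Complex.one_re, Complex.ofReal_re, Complex.ofReal_im,
        Complex.neg_im, Complex.one_im, sub_zero, zero_mul, ← Complex.ofReal_pow, ← Complex.ofReal_intCast,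
        ← Complex.ofReal_natCast, ← Complex.ofReal_mul] at h'
      linarith [h']
    have hle : ((discr K : ℤ) : ℝ) * ((Ideal.absNorm 𝔟 : ℕ) : ℝ) ^ 2 ≤ 0 := by
      rw [hre]; nlinarith [sq_nonneg (2 * (u 0 * conj (u 1)).im)]
    have hN2 : (0 : ℝ) < ((Ideal.absNorm 𝔟 : ℕ) : ℝ) ^ 2 := by positivity
    have hd0 : ((discr K : ℤ) : ℝ) ≤ 0 := by
      by_contra hcon
      push Not at hcon
      have := mul_pos hcon hN2
      linarith
    have : (discr K : ℤ) ≤ 0 := by exact_mod_cast hd0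
    omega
  have hdet : B.det = ((discr K).natAbs : ℤ) := by
    have h2 : ((Ideal.absNorm 𝔟 : ℕ) : ℂ) ^ 2 ≠ 0 := pow_ne_zero 2 (by exact_mod_cast hN0)
    have h : ((B.det : ℤ) : ℂ) = -((discr K : ℤ) : ℂ) := mul_right_cancel₀ h2 (by rw [hdetC])
    have h' : B.det = -discr K := by exact_mod_cast h
    rw [h', Int.natCast_natAbs, abs_of_neg hdK]
  -- positive definiteness over `ℝ`
  have hpos : (B.map (Int.cast : ℤ → ℝ)).PosDef := by
    rw [Matrix.posDef_iff_dotProduct_mulVec]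
    refine ⟨?_, fun x hx => ?_⟩
    · -- symmetric real matrix
      have : (B.map (Int.cast : ℤ → ℝ)).IsSymm := hsymm.map _
      exact this
    · -- `ᵗx B x · N𝔟 = 2 |x₀ u₀ + x₁ u₁|²`
      set S : ℂ := (x 0 : ℂ) * u 0 + (x 1 : ℂ) * u 1 with hS
      have hconjS : conj S = (x 0 : ℂ) * conj (u 0) + (x 1 : ℂ) * conj (u 1) := by
        rw [hS, map_add, map_mul, map_mul, Complex.conj_ofReal, Complex.conj_ofReal]
      have hC : (((star x ⬝ᵥ (B.map (Int.cast : ℤ → ℝ) *ᵥ x)) * (Ideal.absNorm 𝔟 : ℕ) : ℝ) : ℂ) =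
          2 * (S * conj S) := by
        have e00 := hentry 0 0
        have e01 := hentry 0 1
        have e10 := hentry 1 0
        have e11 := hentry 1 1
        simp only [star_trivial, dotProduct, Matrix.mulVec, Fin.sum_univ_two, Matrix.map_apply]
        push_cast
        rw [hconjS, hS]
        linear_combination (↑(x 0) : ℂ) ^ 2 * e00 + (↑(x 0) : ℂ) * (↑(x 1) : ℂ) * e01 +
          (↑(x 1) : ℂ) * (↑(x 0) : ℂ) * e10 + (↑(x 1) : ℂ) ^ 2 * e11
      have hform : (star x ⬝ᵥ (B.map (Int.cast : ℤ → ℝ) *ᵥ x)) * (Ideal.absNorm 𝔟 : ℕ) = 2 * ‖S‖ ^ 2 := by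
        have h2 : (2 : ℂ) * (S * conj S) = ((2 * ‖S‖ ^ 2 : ℝ) : ℂ) := by
          rw [Complex.mul_conj, Complex.normSq_eq_norm_sq]; push_cast; ring
        rw [h2] at hC
        exact_mod_cast hC
      have hnn : 0 ≤ star x ⬝ᵥ (B.map (Int.cast : ℤ → ℝ) *ᵥ x) := by
        by_contra hneg
        push Not at hneg
        have h1 : (star x ⬝ᵥ (B.map (Int.cast : ℤ → ℝ) *ᵥ x)) * (Ideal.absNorm 𝔟 : ℕ) < 0 :=
          mul_neg_of_neg_of_pos hneg hNpos
        rw [hform] at h1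
        nlinarith [sq_nonneg ‖S‖]
      rcases hnn.lt_or_eq with hlt | heq
      · exact hlt
      · exfalso
        -- `x₀ u₀ + x₁ u₁ = 0` with `x ≠ 0` forces `u₀ū₁` real, contradicting `d_K ≠ 0`
        have h0 : ‖S‖ ^ 2 = 0 := by
          have := hform; rw [← heq, zero_mul] at this; linarith
        have hsum : (x 0 : ℂ) * u 0 + (x 1 : ℂ) * u 1 = 0 := by
          rw [sq_eq_zero_iff, norm_eq_zero] at h0; exact h0
        have him0 : (u 0 * conj (u 1)).im = 0 := by
          -- multiply `x₀ u₀ = -x₁ u₁` by `ū₁`: `x₀ u₀ū₁ = -x₁ |u₁|²` is real; if `x₀ = 0` then `x₁ u₁ = 0`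
          by_cases hx0 : x 0 = 0
          · have hx1 : x 1 ≠ 0 := by
              intro h1; apply hx; funext i; fin_cases i <;> simp [hx0, h1]
            have hu1 : u 1 = 0 := by
              rw [hx0] at hsum; simp only [Complex.ofReal_zero, zero_mul, zero_add, mul_eq_zero,
                Complex.ofReal_eq_zero] at hsum
              exact hsum.resolve_left hx1
            simp [hu1]
          · have h1 : (x 0 : ℂ) * (u 0 * conj (u 1)) = -((x 1 : ℂ) * (u 1 * conj (u 1))) := by
              linear_combination conj (u 1) * hsum
            have h2 := congrArg Complex.im h1
            rw [Complex.im_ofReal_mul, Complex.neg_im, Complex.im_ofReal_mul, Complex.mul_conj,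
              Complex.ofReal_im, mul_zero, neg_zero] at h2
            exact (mul_eq_zero.mp h2).resolve_left hx0
        have hzero : ((discr K : ℤ) : ℂ) * ((Ideal.absNorm 𝔟 : ℕ) : ℂ) ^ 2 = 0 := by
          rw [← hIm, hz, him0]; simp
        have hne : discr K ≠ 0 := NumberField.discr_ne_zero K
        rcases mul_eq_zero.mp hzero with h | h
        · exact hne (by exact_mod_cast h)
        · exact hN0 (by exact_mod_cast (pow_eq_zero_iff two_ne_zero).mp h)
  exact ⟨b, B, hentry, hsymm, ⟨q (b 0), by rw [hdiag]; ring⟩, ⟨q (b 1), by rw [hdiag]; ring⟩, hdet, hpos⟩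

end Literature.NumberTheory.EllipticCurves.ModularForms.HeckeTheta

end Part3

/-!
## Part 4 — port of `Summits/BirchSwinnertonDyer/BirchSwinnertonDyer/Theorems/ResidualThetaTransportAtTwoHeckeThetaPartnerAdicAtTwoThetaQExpansion.lean` (6 declarations kept)

# The `q`-expansion of the theta null of an ideal lattice

Declarations of this Part (verbatim port; each keeps its own docstring and citation): `dotProduct_mulVec_eq_two_mul`, `dotProduct_mulVec_eq_two_mul_div`, `riemannThetaCharTerm_smul_eq_pow`, `finite_norm_eq`, `natCard_norm_eq_zero`, `hasSum_thetaNull_qExpansion`.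

Reference keys (see `references.bib` and the declarations' citations): [Ribet1977Nebentypus].
-/

section Part4

open scoped _root_.NumberField ComplexConjugate _root_.Real _root_.Topology
open _root_.NumberField _root_.Module _root_.Matrix _root_.Complex _root_.Filter

namespace Literature.NumberTheory.EllipticCurves.ModularForms.HeckeTheta

open Literature.Analysis.SpecialFunctions
open Literature.NumberTheory.ModularForms.BinaryTheta
open Literature.NumberTheory.Automorphic (siegelUpperHalfSpace mem_siegelUpperHalfSpace_iff)

variable {K : Type} [Field K] [NumberField K]

/-- **`ᵗm B m · N𝔟 = 2 |N(x_m)|`** for `x_m = Σ mᵢ bᵢ ∈ 𝔟`, from the entry formula of the Gram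
matrix (`Σ mᵢmⱼ(uᵢūⱼ + ūᵢuⱼ) = 2|Σ mᵢuᵢ|² = 2‖σ x_m‖² = 2|N(x_m)|`).
[cite: Ribet1977Nebentypus, §3 (supporting lemma)] -/
theorem dotProduct_mulVec_eq_two_mul (hK : finrank ℚ K = 2) [IsTotallyComplex K] (σ : K →+* ℂ)
    {𝔟 : Ideal (𝓞 K)} (b : Basis (Fin 2) ℤ 𝔟) {B : Matrix (Fin 2) (Fin 2) ℤ}
    (hB : ∀ i j, ((B i j : ℤ) : ℂ) * ((Ideal.absNorm 𝔟 : ℕ) : ℂ) =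
      σ ((b i : 𝓞 K) : K) * conj (σ ((b j : 𝓞 K) : K)) + conj (σ ((b i : 𝓞 K) : K)) * σ ((b j : 𝓞 K) : K))
    (m : Fin 2 → ℤ) :
    (m ⬝ᵥ (B *ᵥ m)) * (Ideal.absNorm 𝔟 : ℤ) =
      2 * |Algebra.norm ℤ ((b.equivFun.symm m : 𝔟) : 𝓞 K)| := by
  set x : 𝓞 K := ((b.equivFun.symm m : 𝔟) : 𝓞 K) with hx
  have hxsum : (x : K) = ∑ i, (m i : K) * ((b i : 𝓞 K) : K) := by
    rw [hx, Basis.equivFun_symm_apply]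
    push_cast
    simp [zsmul_eq_mul]
  set u : Fin 2 → ℂ := fun i => σ ((b i : 𝓞 K) : K) with hu
  have hσx : σ (x : K) = ∑ i, (m i : ℂ) * u i := by
    rw [hxsum, map_sum]
    simp [hu]
  have hnorm : (((Algebra.norm ℤ x).natAbs : ℕ) : ℂ) = σ (x : K) * conj (σ (x : K)) := by
    have h1 := normSq_embedding_eq hK σ x
    rw [Complex.mul_conj, Complex.normSq_eq_norm_sq, h1]
    exact (Complex.ofReal_natCast _).symm
  have key : ((m ⬝ᵥ (B *ᵥ m) : ℤ) : ℂ) * ((Ideal.absNorm 𝔟 : ℕ) : ℂ) =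
      2 * (σ (x : K) * conj (σ (x : K))) := by
    rw [hσx, map_sum]
    simp only [dotProduct, Matrix.mulVec, Fin.sum_univ_two, map_mul, map_intCast]
    push_cast
    have e00 := hB 0 0
    have e01 := hB 0 1
    have e10 := hB 1 0
    have e11 := hB 1 1
    simp only [hu] at e00 e01 e10 e11 ⊢
    linear_combination (↑(m 0) : ℂ) ^ 2 * e00 + (↑(m 0) : ℂ) * (↑(m 1) : ℂ) * e01 +
      (↑(m 1) : ℂ) * (↑(m 0) : ℂ) * e10 + (↑(m 1) : ℂ) ^ 2 * e11
  rw [← hnorm] at key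
  rw [← Int.natCast_natAbs]
  have key2 : (((m ⬝ᵥ (B *ᵥ m)) * (Ideal.absNorm 𝔟 : ℤ) : ℤ) : ℂ) =
      ((2 * ((Algebra.norm ℤ x).natAbs : ℤ) : ℤ) : ℂ) := by
    simp only [Int.cast_mul, Int.cast_ofNat, Int.cast_natCast]; exact key
  exact Int.cast_injective key2

/-- The value `N((x_m))/N𝔟 ∈ ℕ` with `ᵗm B m = 2 · (N((x_m))/N𝔟)`.
[cite: Ribet1977Nebentypus, §3 (supporting lemma)] -/
theorem dotProduct_mulVec_eq_two_mul_div (hK : finrank ℚ K = 2) [IsTotallyComplex K] (σ : K →+* ℂ)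
    {𝔟 : Ideal (𝓞 K)} (h𝔟 : 𝔟 ≠ ⊥) (b : Basis (Fin 2) ℤ 𝔟) {B : Matrix (Fin 2) (Fin 2) ℤ}
    (hB : ∀ i j, ((B i j : ℤ) : ℂ) * ((Ideal.absNorm 𝔟 : ℕ) : ℂ) =
      σ ((b i : 𝓞 K) : K) * conj (σ ((b j : 𝓞 K) : K)) + conj (σ ((b i : 𝓞 K) : K)) * σ ((b j : 𝓞 K) : K))
    (m : Fin 2 → ℤ) :
    m ⬝ᵥ (B *ᵥ m) =
      2 * ((Ideal.absNorm (Ideal.span {((b.equivFun.symm m : 𝔟) : 𝓞 K)}) / Ideal.absNorm 𝔟 : ℕ) : ℤ) := by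
  have hN0 : Ideal.absNorm 𝔟 ≠ 0 := by rw [Ne, Ideal.absNorm_eq_zero_iff]; exact h𝔟
  have h := dotProduct_mulVec_eq_two_mul hK σ b hB m
  rw [← Int.natCast_natAbs] at h
  rw [Ideal.absNorm_span_singleton]
  have hdvd := absNorm_dvd_natAbs_norm ((b.equivFun.symm m : 𝔟)).2
  obtain ⟨k, hk⟩ := hdvd
  rw [hk, Nat.mul_div_cancel_left _ (Nat.pos_of_ne_zero hN0)]
  rw [hk] at h
  push_cast at h
  have hN0' : (Ideal.absNorm 𝔟 : ℤ) ≠ 0 := by exact_mod_cast hN0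
  have : (m ⬝ᵥ (B *ᵥ m)) * (Ideal.absNorm 𝔟 : ℤ) = (2 * (k : ℤ)) * (Ideal.absNorm 𝔟 : ℤ) := by
    rw [h]; ring
  exact mul_right_cancel₀ hN0' this

/-- The general term at `v = 0`, characteristic `0`: `e(πi τ ᵗmBm) = q^{N((x_m))/N𝔟}`,
`q = e(τ)`. [cite: Ribet1977Nebentypus, §3 (supporting lemma)] -/
theorem riemannThetaCharTerm_smul_eq_pow (hK : finrank ℚ K = 2) [IsTotallyComplex K] (σ : K →+* ℂ)
    {𝔟 : Ideal (𝓞 K)} (h𝔟 : 𝔟 ≠ ⊥) (b : Basis (Fin 2) ℤ 𝔟) {B : Matrix (Fin 2) (Fin 2) ℤ}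
    (hB : ∀ i j, ((B i j : ℤ) : ℂ) * ((Ideal.absNorm 𝔟 : ℕ) : ℂ) =
      σ ((b i : 𝓞 K) : K) * conj (σ ((b j : 𝓞 K) : K)) + conj (σ ((b i : 𝓞 K) : K)) * σ ((b j : 𝓞 K) : K))
    (τ : ℂ) (m : Fin 2 → ℤ) :
    riemannThetaCharTerm 0 0 (τ • B.map ((↑) : ℤ → ℂ)) 0 m =
      cexp (2 * π * I * τ) ^
        (Ideal.absNorm (Ideal.span {((b.equivFun.symm m : 𝔟) : 𝓞 K)}) / Ideal.absNorm 𝔟) := by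
  set k : ℕ := Ideal.absNorm (Ideal.span {((b.equivFun.symm m : 𝔟) : 𝓞 K)}) / Ideal.absNorm 𝔟 with hk
  have hq := dotProduct_mulVec_eq_two_mul_div hK σ h𝔟 b hB m
  rw [← hk] at hq
  rw [riemannThetaCharTerm, ← Complex.exp_nat_mul]
  congr 1
  simp only [add_zero, dotProduct_zero, mul_zero]
  -- `ᵗm (τB) m = τ ᵗmBm`
  have hquad : ((fun i => (m i : ℂ)) ⬝ᵥ ((τ • B.map ((↑) : ℤ → ℂ)) *ᵥ fun i => (m i : ℂ))) =
      τ * ((m ⬝ᵥ (B *ᵥ m) : ℤ) : ℂ) := by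
    simp only [dotProduct, Matrix.mulVec, Fin.sum_univ_two, Matrix.smul_apply, Matrix.map_apply,
      smul_eq_mul]
    push_cast
    ring
  rw [hquad, hq]
  push_cast
  ring

/-- **`{x ∈ 𝔟 : N((x)) = n·N𝔟}` is finite** (imaginary quadratic: `‖φ x‖² = N((x))` for both
embeddings `φ`, and integral points of bounded absolute value are finite,
`NumberField.Embeddings.finite_of_norm_le`). [cite: Ribet1977Nebentypus, §3 (supporting lemma)] -/
theorem finite_norm_eq (hK : finrank ℚ K = 2) [IsTotallyComplex K] (𝔟 : Ideal (𝓞 K)) (n : ℕ) :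
    Finite {x : 𝓞 K // x ∈ 𝔟 ∧ Ideal.absNorm (Ideal.span {x}) = n * Ideal.absNorm 𝔟} := by
  have hfin := NumberField.Embeddings.finite_of_norm_le K ℂ (Real.sqrt (n * Ideal.absNorm 𝔟))
  haveI := hfin.to_subtype
  refine Finite.of_injective (fun x => (⟨((x.1 : 𝓞 K) : K), ?_⟩ : {x : K // x ∈
      {x : K | IsIntegral ℤ x ∧ ∀ φ : K →+* ℂ, ‖φ x‖ ≤ Real.sqrt (n * Ideal.absNorm 𝔟)}})) ?_
  · refine ⟨x.1.isIntegral_coe, fun φ => ?_⟩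
    have h := normSq_embedding_eq hK φ x.1
    rw [← Ideal.absNorm_span_singleton, x.2.2] at h
    rw [← Real.sqrt_sq (norm_nonneg _), h]
    push_cast
    exact le_rfl
  · intro x y hxy
    apply Subtype.ext
    exact NumberField.RingOfIntegers.coe_injective (by simpa using congrArg Subtype.val hxy)

/-- `r_𝔟(0) = 1`: only `x = 0` has norm `0`. [cite: Ribet1977Nebentypus, §3 (supporting lemma)] -/
theorem natCard_norm_eq_zero (𝔟 : Ideal (𝓞 K)) :
    Nat.card {x : 𝓞 K // x ∈ 𝔟 ∧ Ideal.absNorm (Ideal.span {x}) = 0 * Ideal.absNorm 𝔟} = 1 := by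
  rw [Nat.card_eq_one_iff_exists]
  refine ⟨⟨0, 𝔟.zero_mem, by simp⟩, fun y => Subtype.ext ?_⟩
  obtain ⟨x, hx, h⟩ := y
  rw [zero_mul, Ideal.absNorm_eq_zero_iff, Ideal.span_singleton_eq_bot] at h
  exact h

/-- **The `q`-expansion of the theta null of an ideal lattice**: for Gram data `(b, B)` of `𝔟 ≠ 0`
and `Im τ > 0`, `θ_B(τ) = ϑ[0;0](0, τ·B) = Σ_{n ≥ 0} r_𝔟(n) qⁿ` with
`r_𝔟(n) = #{x ∈ 𝔟 : N((x)) = n·N𝔟}` (Hecke 1926 §2: `θ_𝔟(τ) = Σ_{x ∈ 𝔟} q^{N(x)/N𝔟}`).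
[cite: Ribet1977Nebentypus, §3 (supporting lemma)] -/
theorem hasSum_thetaNull_qExpansion (hK : finrank ℚ K = 2) [IsTotallyComplex K] (σ : K →+* ℂ)
    {𝔟 : Ideal (𝓞 K)} (h𝔟 : 𝔟 ≠ ⊥) (b : Basis (Fin 2) ℤ 𝔟) {B : Matrix (Fin 2) (Fin 2) ℤ}
    (hB : ∀ i j, ((B i j : ℤ) : ℂ) * ((Ideal.absNorm 𝔟 : ℕ) : ℂ) =
      σ ((b i : 𝓞 K) : K) * conj (σ ((b j : 𝓞 K) : K)) + conj (σ ((b i : 𝓞 K) : K)) * σ ((b j : 𝓞 K) : K))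
    (hsymm : B.IsSymm) (hpos : (B.map (Int.cast : ℤ → ℝ)).PosDef) {τ : ℂ} (hτ : 0 < τ.im) :
    HasSum (fun n : ℕ => (Nat.card {x : 𝓞 K // x ∈ 𝔟 ∧ Ideal.absNorm (Ideal.span {x}) = n * Ideal.absNorm 𝔟} : ℂ) *
        cexp (2 * π * I * τ) ^ n)
      (riemannThetaChar 0 0 (τ • B.map ((↑) : ℤ → ℂ)) 0) := by
  classical
  have hZ := smul_mem_siegelUpperHalfSpace hsymm hpos hτ
  obtain ⟨c, hc, hY⟩ := exists_pos_mul_sum_sq_le_of_posDef_im _ hZ.2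
  have hZs : ∀ i j, (τ • B.map ((↑) : ℤ → ℂ)) i j = (τ • B.map ((↑) : ℤ → ℂ)) j i :=
    fun i j => (hZ.1.apply i j).symm
  have hsum := hasSum_riemannThetaChar _ hZs hc hY 0 0 0
  -- the norm index `k(m) = N((x_m))/N𝔟` and its fibres
  set kf : (Fin 2 → ℤ) → ℕ := fun m =>
    Ideal.absNorm (Ideal.span {((b.equivFun.symm m : 𝔟) : 𝓞 K)}) / Ideal.absNorm 𝔟 with hkf
  have hN0 : Ideal.absNorm 𝔟 ≠ 0 := by rw [Ne, Ideal.absNorm_eq_zero_iff]; exact h𝔟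
  have hkf_iff : ∀ m n, kf m = n ↔
      Ideal.absNorm (Ideal.span {((b.equivFun.symm m : 𝔟) : 𝓞 K)}) = n * Ideal.absNorm 𝔟 := by
    intro m n
    obtain ⟨k, hk⟩ := (show Ideal.absNorm 𝔟 ∣ Ideal.absNorm (Ideal.span {((b.equivFun.symm m : 𝔟) : 𝓞 K)})
      from by rw [Ideal.absNorm_span_singleton]; exact absNorm_dvd_natAbs_norm (b.equivFun.symm m).2)
    rw [hkf]; simp only
    rw [hk, Nat.mul_div_cancel_left _ (Nat.pos_of_ne_zero hN0), mul_comm]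
    exact ⟨fun h => by rw [h], fun h => mul_right_cancel₀ hN0 h⟩
  -- fibres inject into `{x ∈ 𝔟 : N((x)) = n N𝔟}` (in fact bijectively)
  set g : ∀ n, {m : Fin 2 → ℤ // kf m = n} →
      {x : 𝓞 K // x ∈ 𝔟 ∧ Ideal.absNorm (Ideal.span {x}) = n * Ideal.absNorm 𝔟} :=
    fun n m => ⟨((b.equivFun.symm m.1 : 𝔟) : 𝓞 K), (b.equivFun.symm m.1).2, (hkf_iff m.1 n).mp m.2⟩ with hg
  have hg_bij : ∀ n, Function.Bijective (g n) := by
    intro n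
    constructor
    · intro m m' h
      have h' : ((b.equivFun.symm m.1 : 𝔟) : 𝓞 K) = ((b.equivFun.symm m'.1 : 𝔟) : 𝓞 K) :=
        congrArg (fun z => (z.1 : 𝓞 K)) h
      exact Subtype.ext (b.equivFun.symm.injective (Subtype.ext h'))
    · rintro ⟨x, hx, hxn⟩
      refine ⟨⟨b.equivFun ⟨x, hx⟩, ?_⟩, ?_⟩
      · rw [hkf_iff, LinearEquiv.symm_apply_apply]; exact hxn
      · apply Subtype.ext
        simp only [hg]
        exact congrArg Subtype.val (b.equivFun.symm_apply_apply ⟨x, hx⟩)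
  have hfib : ∀ n, Nat.card {m : Fin 2 → ℤ // kf m = n} =
      Nat.card {x : 𝓞 K // x ∈ 𝔟 ∧ Ideal.absNorm (Ideal.span {x}) = n * Ideal.absNorm 𝔟} :=
    fun n => Nat.card_congr (Equiv.ofBijective (g n) (hg_bij n))
  haveI hfin : ∀ n, Finite {m : Fin 2 → ℤ // kf m = n} := fun n =>
    haveI := finite_norm_eq hK 𝔟 n
    Finite.of_injective (g n) (hg_bij n).1
  -- regroup the lattice sum along the fibres of `kf`
  have h1 : HasSum ((riemannThetaCharTerm 0 0 (τ • B.map ((↑) : ℤ → ℂ)) 0) ∘ (Equiv.sigmaFiberEquiv kf))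
      (riemannThetaChar 0 0 (τ • B.map ((↑) : ℤ → ℂ)) 0) :=
    (Equiv.hasSum_iff (Equiv.sigmaFiberEquiv kf)).mpr hsum
  refine h1.sigma fun n => ?_
  letI : Fintype {m : Fin 2 → ℤ // kf m = n} := Fintype.ofFinite _
  have hterm : ∀ c : {m : Fin 2 → ℤ // kf m = n},
      ((riemannThetaCharTerm 0 0 (τ • B.map ((↑) : ℤ → ℂ)) 0) ∘ (Equiv.sigmaFiberEquiv kf)) ⟨n, c⟩ =
        cexp (2 * π * I * τ) ^ n := by
    intro c
    simp only [Function.comp_apply, Equiv.sigmaFiberEquiv_apply]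
    rw [riemannThetaCharTerm_smul_eq_pow hK σ h𝔟 b hB τ c.1]
    congr 1
    exact c.2
  have h2 := hasSum_fintype (fun c : {m : Fin 2 → ℤ // kf m = n} =>
    ((riemannThetaCharTerm 0 0 (τ • B.map ((↑) : ℤ → ℂ)) 0) ∘ (Equiv.sigmaFiberEquiv kf)) ⟨n, c⟩)
  simp only [hterm, Finset.sum_const, Finset.card_univ, nsmul_eq_mul] at h2
  rw [← Nat.card_eq_fintype_card, hfib n] at h2
  simpa only [hterm] using h2

end Literature.NumberTheory.EllipticCurves.ModularForms.HeckeTheta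

end Part4

/-!
## Part 5 — port of `Summits/BirchSwinnertonDyer/BirchSwinnertonDyer/Theorems/ResidualThetaTransportAtTwoHeckeThetaPartnerAdicAtTwoThetaClassCount.lean` (4 declarations kept)

# Counting lattice points of given norm over ideal-class representatives

Declarations of this Part (verbatim port; each keeps its own docstring and citation): `finite_units`, `natCard_generators_eq`, `exists_unique_eq_mul`, `sum_natCard_norm_eq`.

Reference keys (see `references.bib` and the declarations' citations): [Ribet1977Nebentypus].
-/

section Part5

open scoped _root_.NumberField nonZeroDivisors
open _root_.NumberField _root_.Module _root_.Ideal

namespace Literature.NumberTheory.EllipticCurves.ModularForms.HeckeTheta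

open Literature.NumberTheory.EllipticCurves.ModularForms.HeckeThetaPartner
open Literature.NumberTheory.LFunctions (idealNormCount)

variable {K : Type} [Field K] [NumberField K]

/-! ### Units -/

/-- The unit group of an imaginary quadratic field is finite: every unit has absolute value `1`
under the complex embedding (tree `norm_embedding_unit_eq_one`), hence is torsion
(`NumberField.Units.mem_torsion`). [cite: Ribet1977Nebentypus, §3 (supporting lemma)] -/
theorem finite_units (hK : finrank ℚ K = 2) [IsTotallyComplex K] : Finite (𝓞 K)ˣ := by
  have hall : ∀ u : (𝓞 K)ˣ, u ∈ NumberField.Units.torsion K := by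
    intro u
    rw [NumberField.Units.mem_torsion]
    intro w
    rw [← w.norm_embedding_eq]
    exact HeckeThetaPartner.norm_embedding_unit_eq_one hK w.embedding u
  have hf : Function.Injective (fun u : (𝓞 K)ˣ => (⟨u, hall u⟩ : NumberField.Units.torsion K)) :=
    fun u v h => by simpa using congrArg Subtype.val h
  exact Finite.of_injective _ hf

omit [NumberField K] in
/-- **A nonzero principal ideal `(x₀)` has exactly `#𝓞_K^×` generators**: `(x) = (x₀) ⟺ x = u x₀`
with `u` a unit (`Ideal.span_singleton_eq_span_singleton`), and `u ↦ u x₀` is injective.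
[cite: Ribet1977Nebentypus, §3 (supporting lemma)] -/
theorem natCard_generators_eq {x₀ : 𝓞 K} (hx₀ : x₀ ≠ 0) :
    Nat.card {x : 𝓞 K // Ideal.span {x} = Ideal.span {x₀}} = Nat.card (𝓞 K)ˣ := by
  refine (Nat.card_congr (Equiv.ofBijective
    (fun u : (𝓞 K)ˣ => (⟨x₀ * u, ?_⟩ : {x : 𝓞 K // Ideal.span {x} = Ideal.span {x₀}})) ⟨?_, ?_⟩)).symm
  · rw [Ideal.span_singleton_eq_span_singleton]
    exact ⟨u⁻¹, by simp⟩
  · intro u v h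
    have h' : x₀ * u = x₀ * v := congrArg Subtype.val h
    exact Units.ext (mul_left_cancel₀ hx₀ h')
  · rintro ⟨x, hx⟩
    obtain ⟨u, hu⟩ := (Ideal.span_singleton_eq_span_singleton.mp hx).symm
    exact ⟨u, Subtype.ext hu⟩

/-! ### The count -/

/-- `x ∈ 𝔞` iff `𝔞 ∣ (x)`, in which case `(x) = 𝔞 𝔟` for a unique `𝔟`.
[cite: Ribet1977Nebentypus, §3 (supporting lemma)] -/
private theorem exists_unique_eq_mul {𝔞 : Ideal (𝓞 K)} (h𝔞 : 𝔞 ≠ ⊥) {x : 𝓞 K} (hx : x ∈ 𝔞) :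
    ∃! 𝔟 : Ideal (𝓞 K), Ideal.span {x} = 𝔞 * 𝔟 := by
  obtain ⟨𝔟, h𝔟⟩ : 𝔞 ∣ Ideal.span {x} := Ideal.dvd_iff_le.mpr ((Ideal.span_singleton_le_iff_mem _).mpr hx)
  exact ⟨𝔟, h𝔟, fun 𝔟' h𝔟' => mul_left_cancel₀ h𝔞 (h𝔟'.symm.trans h𝔟)⟩

/-- **The class-representative count.**  Let `𝔞_c` (`c ∈ Cl(K)`) be nonzero integral ideals with
`[𝔞_c] = c`.  For `n ≥ 1`, `Σ_c #{x ∈ 𝔞_c : N((x)) = n·N𝔞_c} = #𝓞_K^× · #{𝔟 : N𝔟 = n}`: the map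
`(c, x) ↦ 𝔟` with `(x) = 𝔞_c 𝔟` hits every `𝔟` of norm `n` (for `c = [𝔟]⁻¹` the ideal `𝔞_c𝔟` is
principal), `c` is forced (`[𝔞_c] = [𝔟]⁻¹`), and the fibre over `𝔟` is the set of generators of
`𝔞_c 𝔟`. (Cox Thm. 7.7, (7.16); Zagier §8.) [cite: Ribet1977Nebentypus, §3 (supporting lemma)] -/
theorem sum_natCard_norm_eq (hK : finrank ℚ K = 2) [IsTotallyComplex K]
    (𝔞 : ClassGroup (𝓞 K) → (Ideal (𝓞 K))⁰) (h𝔞 : ∀ c, ClassGroup.mk0 (𝔞 c) = c)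
    {n : ℕ} (hn : n ≠ 0) :
    ∑ c : ClassGroup (𝓞 K),
        Nat.card {x : 𝓞 K // x ∈ (𝔞 c : Ideal (𝓞 K)) ∧
          Ideal.absNorm (Ideal.span {x}) = n * Ideal.absNorm (𝔞 c : Ideal (𝓞 K))} =
      Nat.card (𝓞 K)ˣ * idealNormCount K n := by
  classical
  haveI : Finite (𝓞 K)ˣ := finite_units hK
  have h𝔞0 : ∀ c, (𝔞 c : Ideal (𝓞 K)) ≠ ⊥ := fun c => nonZeroDivisors.coe_ne_zero (𝔞 c)
  have h𝔞N : ∀ c, Ideal.absNorm (𝔞 c : Ideal (𝓞 K)) ≠ 0 := fun c => by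
    rw [Ne, Ideal.absNorm_eq_zero_iff]; exact h𝔞0 c
  -- the domain as a subtype of a product, and the target
  set D := {p : ClassGroup (𝓞 K) × 𝓞 K // p.2 ∈ (𝔞 p.1 : Ideal (𝓞 K)) ∧
    Ideal.absNorm (Ideal.span {p.2}) = n * Ideal.absNorm (𝔞 p.1 : Ideal (𝓞 K))} with hD
  set T := {J : Ideal (𝓞 K) // Ideal.absNorm J = n} with hT
  haveI : Finite T := (Ideal.finite_setOf_absNorm_eq (S := 𝓞 K) n).to_subtype
  letI : Fintype T := Fintype.ofFinite T
  -- the quotient map `(c, x) ↦ 𝔟`, `(x) = 𝔞_c 𝔟`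
  have hquot : ∀ p : D, ∃! J : Ideal (𝓞 K), Ideal.span {p.1.2} = (𝔞 p.1.1 : Ideal (𝓞 K)) * J :=
    fun p => exists_unique_eq_mul (h𝔞0 p.1.1) p.2.1
  have hquotN : ∀ p : D, ∀ J : Ideal (𝓞 K), Ideal.span {p.1.2} = (𝔞 p.1.1 : Ideal (𝓞 K)) * J →
      Ideal.absNorm J = n := by
    intro p J hJ
    have h := p.2.2
    rw [hJ, map_mul, mul_comm] at h
    exact mul_right_cancel₀ (h𝔞N p.1.1) h
  set f : D → T := fun p => ⟨(hquot p).choose, hquotN p _ (hquot p).choose_spec.1⟩ with hf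
  have hf_spec : ∀ p : D, Ideal.span {p.1.2} = (𝔞 p.1.1 : Ideal (𝓞 K)) * (f p : Ideal (𝓞 K)) :=
    fun p => (hquot p).choose_spec.1
  have hf_eq : ∀ (p : D) (J : Ideal (𝓞 K)), Ideal.span {p.1.2} = (𝔞 p.1.1 : Ideal (𝓞 K)) * J →
      (f p : Ideal (𝓞 K)) = J := fun p J hJ => ((hquot p).unique (hf_spec p) hJ)
  -- the class is forced: `[𝔞_c] = [𝔟]⁻¹`
  have hJ0 : ∀ J : T, (J : Ideal (𝓞 K)) ∈ (Ideal (𝓞 K))⁰ := fun J =>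
    mem_nonZeroDivisors_of_ne_zero (by
      intro h; have := J.2; rw [h, Ideal.zero_eq_bot, Ideal.absNorm_bot] at this; exact hn this.symm)
  set cl : T → ClassGroup (𝓞 K) := fun J => (ClassGroup.mk0 ⟨(J : Ideal (𝓞 K)), hJ0 J⟩)⁻¹ with hcl
  have hclass : ∀ p : D, p.1.1 = cl (f p) := by
    intro p
    rw [hcl]
    simp only
    rw [← h𝔞 p.1.1, ClassGroup.mk0_eq_mk0_inv_iff]
    refine ⟨p.1.2, ?_, (hf_spec p).symm⟩
    intro h0
    have := p.2.2
    rw [h0, Ideal.span_singleton_zero] at this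
    simp only [Ideal.absNorm_bot] at this
    exact hn (by
      have h2 := mul_ne_zero hn (h𝔞N p.1.1)
      exact absurd this.symm h2 |> False.elim)
  -- the principal ideal `𝔞_{cl J} · J` and the fibres
  have hprinc : ∀ J : T, ∃ x : 𝓞 K, x ≠ 0 ∧
      (𝔞 (cl J) : Ideal (𝓞 K)) * (J : Ideal (𝓞 K)) = Ideal.span {x} := by
    intro J
    have h := (ClassGroup.mk0_eq_mk0_inv_iff (I := 𝔞 (cl J)) (J := ⟨(J : Ideal (𝓞 K)), hJ0 J⟩)).mp
      (by rw [h𝔞])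
    obtain ⟨x, hx, h'⟩ := h
    exact ⟨x, hx, h'⟩
  have hfibre : ∀ J : T, Nat.card {p : D // f p = J} = Nat.card (𝓞 K)ˣ := by
    intro J
    obtain ⟨x₀, hx₀, hx₀J⟩ := hprinc J
    rw [← natCard_generators_eq hx₀]
    -- the map `q ↦ x`
    have hg : ∀ q : {p : D // f p = J}, Ideal.span {q.1.1.2} = Ideal.span {x₀} := by
      intro q
      have h1 := hf_spec q.1
      have h2 : ((f q.1 : T) : Ideal (𝓞 K)) = (J : Ideal (𝓞 K)) := congrArg Subtype.val q.2
      have h3 : q.1.1.1 = cl J := by rw [hclass q.1]; exact congrArg cl q.2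
      rw [h2, h3, hx₀J] at h1
      exact h1
    refine Nat.card_congr (Equiv.ofBijective
      (fun q : {p : D // f p = J} => (⟨q.1.1.2, hg q⟩ : {x : 𝓞 K // Ideal.span {x} = Ideal.span {x₀}}))
      ⟨?_, ?_⟩)
    · -- injective: the class is forced
      intro q q' hqq'
      have hx : q.1.1.2 = q'.1.1.2 := congrArg Subtype.val hqq'
      have hc : q.1.1.1 = q'.1.1.1 := by
        rw [hclass q.1, hclass q'.1]
        exact congrArg cl (q.2.trans q'.2.symm)
      apply Subtype.ext; apply Subtype.ext
      exact Prod.ext hc hx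
    · -- surjective
      rintro ⟨y, hy⟩
      have hyJ : Ideal.span {y} = (𝔞 (cl J) : Ideal (𝓞 K)) * (J : Ideal (𝓞 K)) := hy.trans hx₀J.symm
      have hymem : y ∈ (𝔞 (cl J) : Ideal (𝓞 K)) :=
        (Ideal.span_singleton_le_iff_mem _).mp (by rw [hyJ]; exact Ideal.mul_le_right)
      have hyN : Ideal.absNorm (Ideal.span {y}) = n * Ideal.absNorm (𝔞 (cl J) : Ideal (𝓞 K)) := by
        rw [hyJ, map_mul, J.2, mul_comm]
      let p : D := ⟨(cl J, y), hymem, hyN⟩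
      have hfp : f p = J := Subtype.ext (hf_eq p _ hyJ)
      exact ⟨⟨p, hfp⟩, rfl⟩
  have hw0 : Nat.card (𝓞 K)ˣ ≠ 0 := Nat.card_pos.ne'
  haveI hfibfin : ∀ J : T, Finite {p : D // f p = J} := fun J =>
    Nat.finite_of_card_ne_zero (by rw [hfibre J]; exact hw0)
  haveI : Finite D := by
    rw [(Equiv.sigmaFiberEquiv f).symm.finite_iff]; infer_instance
  haveI : ∀ c : ClassGroup (𝓞 K), Finite {x : 𝓞 K // x ∈ (𝔞 c : Ideal (𝓞 K)) ∧
      Ideal.absNorm (Ideal.span {x}) = n * Ideal.absNorm (𝔞 c : Ideal (𝓞 K))} := fun c =>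
    Finite.of_injective (fun x => (⟨(c, x.1), x.2⟩ : D)) fun x x' h => by
      apply Subtype.ext
      have := congrArg (fun p : D => p.1.2) h
      exact this
  -- count: `#D = Σ_J #fibre = #T · w`
  have hDcard : Nat.card D = Nat.card (𝓞 K)ˣ * idealNormCount K n := by
    rw [Nat.card_congr (Equiv.sigmaFiberEquiv f).symm, Nat.card_sigma]
    simp only [hfibre, Finset.sum_const, smul_eq_mul, Finset.card_univ]
    rw [idealNormCount, ← Nat.card_eq_fintype_card, mul_comm]
  -- and `#D = Σ_c #X_c`
  rw [← hDcard, hD, Nat.card_congr (Equiv.subtypeProdEquivSigmaSubtype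
    (fun c (x : 𝓞 K) => x ∈ (𝔞 c : Ideal (𝓞 K)) ∧
      Ideal.absNorm (Ideal.span {x}) = n * Ideal.absNorm (𝔞 c : Ideal (𝓞 K)))), Nat.card_sigma]

end Literature.NumberTheory.EllipticCurves.ModularForms.HeckeTheta

end Part5

/-!
## Part 6 — port of `Summits/BirchSwinnertonDyer/BirchSwinnertonDyer/Theorems/ResidualThetaTransportAtTwoHeckeThetaPartnerAdicAtTwoThetaEisenstein.lean` (3 declarations kept)

# Pinning theta multipliers through an Eisenstein series: the abstract argument

Declarations of this Part (verbatim port; each keeps its own docstring and citation): `eq_of_sum_eq_card_mul`, `cexp_two_pi_I_vadd`, `units_eq_of_thetaSum_eisenstein`.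

Reference keys (see `references.bib` and the declarations' citations): [Ribet1977Nebentypus].
-/

section Part6

open scoped _root_.Real _root_.MatrixGroups _root_.Topology _root_.UpperHalfPlane
open _root_.Complex _root_.Filter _root_.ModularForm

namespace Literature.NumberTheory.EllipticCurves.ModularForms.HeckeTheta

/-! ### Unit complex numbers summing to `h · χ` -/

/-- If `h` complex numbers of modulus `1` sum to `h · χ` with `|χ| = 1`, they all equal `χ`.
[cite: Ribet1977Nebentypus, §3 (supporting lemma)] -/
theorem eq_of_sum_eq_card_mul {ι : Type} [Fintype ι] {Λ : ι → ℂ} {χ : ℂ}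
    (hΛ : ∀ i, ‖Λ i‖ = 1) (hχ : ‖χ‖ = 1) (hsum : ∑ i, Λ i = Fintype.card ι * χ) (i : ι) :
    Λ i = χ := by
  have hχ0 : χ ≠ 0 := fun h => by rw [h, norm_zero] at hχ; exact zero_ne_one hχ
  -- `μ_i = Λ_i χ̄ / |χ|² = Λ_i / χ` has modulus one and real part `≤ 1`, and `Σ μ_i = h`
  set μ : ι → ℂ := fun j => Λ j / χ with hμ
  have hμ1 : ∀ j, ‖μ j‖ = 1 := fun j => by rw [hμ]; simp [hΛ j, hχ]
  have hμsum : ∑ j, μ j = Fintype.card ι := by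
    simp only [hμ, div_eq_mul_inv, ← Finset.sum_mul, hsum]
    field_simp
  have hre_le : ∀ j, (μ j).re ≤ 1 := fun j => (Complex.re_le_norm _).trans (hμ1 j).le
  have hre_sum : ∑ j, (μ j).re = Fintype.card ι := by
    have := congrArg Complex.re hμsum
    rw [Complex.re_sum] at this
    simpa using this
  -- all real parts equal `1`
  have hre1 : ∀ j, (μ j).re = 1 := by
    by_contra hcon
    push Not at hcon
    obtain ⟨j₀, hj₀⟩ := hcon
    have hlt : (μ j₀).re < 1 := lt_of_le_of_ne (hre_le j₀) hj₀
    have : ∑ j, (μ j).re < ∑ _j : ι, (1 : ℝ) :=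
      Finset.sum_lt_sum (fun j _ => hre_le j) ⟨j₀, Finset.mem_univ _, hlt⟩
    rw [hre_sum] at this
    simp at this
  have hμeq : μ i = 1 := by
    have h1 := hμ1 i
    have h2 := hre1 i
    have him : (μ i).im = 0 := by
      have : (μ i).re * (μ i).re + (μ i).im * (μ i).im = 1 := by
        rw [← Complex.normSq_apply, Complex.normSq_eq_norm_sq, h1, one_pow]
      rw [h2] at this
      nlinarith
    exact Complex.ext (by simp [h2]) (by simp [him])
  have : Λ i / χ = 1 := hμeq
  rwa [div_eq_one_iff_eq hχ0] at this

/-! ### The abstract Eisenstein pinning -/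

/-- `e(τ + 1) = e(τ)`: `q` is `1`-periodic. [cite: Ribet1977Nebentypus, §3 (supporting lemma)] -/
private theorem cexp_two_pi_I_vadd (τ : ℍ) :
    cexp (2 * π * Complex.I * (((1 : ℝ) +ᵥ τ : ℍ) : ℂ)) = cexp (2 * π * Complex.I * (τ : ℂ)) := by
  rw [UpperHalfPlane.coe_vadd, Complex.ofReal_one, mul_add, mul_one, Complex.exp_add,
    Complex.exp_two_pi_mul_I, one_mul]

/-- **Eisenstein pinning of theta multipliers.**  See the module docstring.  Hypotheses: `q`-series
`θ_i`, `E` on `ℍ` (as `HasSum` in `q = e(τ)`), `r_i(0) = 1`, the limits `θ_i → 1` as `Im τ → ∞`,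
`e(0) ≠ 0`, `w ≠ 0`, the coefficient identity `w·e(n) = c₁·Σ_i r_i(n)` for `n ≥ 1`, the laws under
`γ₀ = (1 0; D 1)` (`D ≥ 1`) with factor `Dτ+1` (times units `Λ⁰_i` for the `θ_i`, exactly for `E`),
and under `γ` with factors `Λ_i (cτ+d)`, `χ (cτ+d)`, `|Λ_i| = |χ| = 1`.  Conclusion: `Λ_i = χ`.
[cite: Ribet1977Nebentypus, §3 (supporting lemma)] -/
theorem units_eq_of_thetaSum_eisenstein {ι : Type} [Fintype ι] [Nonempty ι]
    {θ : ι → ℍ → ℂ} {r : ι → ℕ → ℂ}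
    (hθ : ∀ i (τ : ℍ), HasSum (fun n : ℕ => r i n * cexp (2 * π * Complex.I * (τ : ℂ)) ^ n) (θ i τ))
    (hr0 : ∀ i, r i 0 = 1)
    (hlim : ∀ i, ∀ ε > 0, ∃ Y : ℝ, ∀ τ : ℍ, Y ≤ τ.im → ‖θ i τ - 1‖ < ε)
    {E : ℍ → ℂ} {e : ℕ → ℂ}
    (hE : ∀ τ : ℍ, HasSum (fun n : ℕ => e n * cexp (2 * π * Complex.I * (τ : ℂ)) ^ n) (E τ)) (he0 : e 0 ≠ 0)
    {w c₁ : ℂ} (hw : w ≠ 0) (hcoef : ∀ n : ℕ, n ≠ 0 → w * e n = c₁ * ∑ i, r i n)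
    {γ₀ : SL(2, ℤ)} {D : ℕ} (hD : 0 < D) (hγ₀a : (γ₀ 0 0 : ℤ) = 1) (hγ₀b : (γ₀ 0 1 : ℤ) = 0)
    (hγ₀c : (γ₀ 1 0 : ℤ) = D) (hγ₀d : (γ₀ 1 1 : ℤ) = 1)
    {Λ₀ : ι → ℂ} (hθ₀ : ∀ i (τ : ℍ), θ i (γ₀ • τ) = Λ₀ i * ((D : ℂ) * τ + 1) * θ i τ)
    (hE₀ : ∀ τ : ℍ, E (γ₀ • τ) = ((D : ℂ) * τ + 1) * E τ)
    {γ : SL(2, ℤ)} {Λ : ι → ℂ} {χ : ℂ} (hΛ1 : ∀ i, ‖Λ i‖ = 1) (hχ1 : ‖χ‖ = 1)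
    (hθγ : ∀ i (τ : ℍ), θ i (γ • τ) = Λ i * (((γ 1 0 : ℤ) : ℂ) * τ + ((γ 1 1 : ℤ) : ℂ)) * θ i τ)
    (hEγ : ∀ τ : ℍ, E (γ • τ) = χ * (((γ 1 0 : ℤ) : ℂ) * τ + ((γ 1 1 : ℤ) : ℂ)) * E τ) :
    ∀ i, Λ i = χ := by
  classical
  have _ := hγ₀a; have _ := hγ₀b; have _ := hγ₀c; have _ := hγ₀d
  set h : ℕ := Fintype.card ι with hh
  set K₀ : ℂ := w * e 0 - c₁ * h with hK₀
  -- Step 1: `w E - c₁ Σ θ_i ≡ K₀`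
  have hF : ∀ τ : ℍ, w * E τ - c₁ * ∑ i, θ i τ = K₀ := by
    intro τ
    set q : ℂ := cexp (2 * π * Complex.I * (τ : ℂ)) with hq
    have h1 : HasSum (fun n : ℕ => (w * e n - c₁ * ∑ i, r i n) * q ^ n) (w * E τ - c₁ * ∑ i, θ i τ) := by
      have hEw := (hE τ).mul_left w
      have hΘ : HasSum (fun n : ℕ => (∑ i, r i n) * q ^ n) (∑ i, θ i τ) := by
        have := hasSum_sum (f := fun i (n : ℕ) => r i n * q ^ n) (a := fun i => θ i τ)
          (s := Finset.univ) (fun i _ => hθ i τ)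
        refine this.congr_fun fun n => ?_
        rw [Finset.sum_mul]
      have h := hEw.sub (hΘ.mul_left c₁)
      refine h.congr_fun fun n => ?_
      ring
    have h2 : (fun n : ℕ => (w * e n - c₁ * ∑ i, r i n) * q ^ n) = fun n => if n = 0 then K₀ else 0 := by
      funext n
      by_cases hn : n = 0
      · subst hn
        simp [hK₀, hr0, hh]
      · rw [if_neg hn, hcoef n hn, sub_self, zero_mul]
    rw [h2] at h1
    have h3 : HasSum (fun n : ℕ => if n = 0 then K₀ else 0) K₀ := hasSum_ite_eq 0 K₀
    exact h1.unique h3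
  -- `1`-periodicity of the `θ_i`
  have hper : ∀ i (τ : ℍ), θ i ((1 : ℝ) +ᵥ τ) = θ i τ := by
    intro i τ
    have h1 := hθ i ((1 : ℝ) +ᵥ τ)
    rw [cexp_two_pi_I_vadd] at h1
    exact h1.unique (hθ i τ)
  -- Step 2: `K₀ = 0`
  have hD0 : (D : ℂ) ≠ 0 := by exact_mod_cast hD.ne'
  have hK₀0 : K₀ = 0 := by
    -- `G(τ) = Σ (1 - Λ⁰_i) θ_i(τ)` satisfies `K₀ = (Dτ+1)(K₀ + c₁ G(τ))` and is `1`-periodic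
    have key : ∀ τ : ℍ, K₀ = ((D : ℂ) * τ + 1) * (K₀ + c₁ * ∑ i, (1 - Λ₀ i) * θ i τ) := by
      intro τ
      have h1 := hF (γ₀ • τ)
      rw [hE₀ τ] at h1
      simp only [hθ₀] at h1
      have h2 := hF τ
      have e3 : ∑ i, Λ₀ i * ((D : ℂ) * τ + 1) * θ i τ = ((D : ℂ) * τ + 1) * ∑ i, Λ₀ i * θ i τ := by
        rw [Finset.mul_sum]; exact Finset.sum_congr rfl fun i _ => by ring
      have e4 : ∑ i, (1 - Λ₀ i) * θ i τ = ∑ i, θ i τ - ∑ i, Λ₀ i * θ i τ := by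
        rw [← Finset.sum_sub_distrib]; exact Finset.sum_congr rfl fun i _ => by ring
      rw [e4]
      linear_combination -h1 + ((D : ℂ) * τ + 1) * h2 - c₁ * e3
    obtain ⟨τ⟩ := (inferInstance : Nonempty ℍ)
    have k1 := key τ
    have k2 := key ((1 : ℝ) +ᵥ τ)
    simp only [hper] at k2
    rw [UpperHalfPlane.coe_vadd, Complex.ofReal_one] at k2
    -- subtract: `D · (K₀ + c₁ G τ) = 0`
    set G := K₀ + c₁ * ∑ i, (1 - Λ₀ i) * θ i τ with hG
    have hGz : G = 0 := by
      have : (D : ℂ) * G = 0 := by linear_combination k1 - k2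
      exact (mul_eq_zero.mp this).resolve_left hD0
    rw [hGz, mul_zero] at k1
    exact k1
  -- hence `c₁ ≠ 0`
  have hc₁ : c₁ ≠ 0 := by
    intro hc
    have : w * e 0 = 0 := by
      have := hK₀0; rw [hK₀, hc, zero_mul, sub_zero] at this; exact this
    exact (mul_ne_zero hw he0) this
  -- Step 3: `Σ (Λ_i - χ) θ_i ≡ 0`
  have hvan : ∀ τ : ℍ, ∑ i, (Λ i - χ) * θ i τ = 0 := by
    intro τ
    have h1 := hF (γ • τ)
    have h2 := hF τ
    rw [hK₀0] at h1 h2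
    rw [hEγ τ] at h1
    simp only [hθγ] at h1
    have hden : (((γ 1 0 : ℤ) : ℂ) * τ + ((γ 1 1 : ℤ) : ℂ)) ≠ 0 := by
      have := UpperHalfPlane.denom_ne_zero γ τ
      simpa [UpperHalfPlane.denom] using this
    have hwE : w * E τ = c₁ * ∑ i, θ i τ := by linear_combination h2
    have : c₁ * (((γ 1 0 : ℤ) : ℂ) * τ + ((γ 1 1 : ℤ) : ℂ)) * ∑ i, (Λ i - χ) * θ i τ = 0 := by
      have e1 : ∑ i, (Λ i - χ) * θ i τ = ∑ i, Λ i * θ i τ - χ * ∑ i, θ i τ := by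
        rw [Finset.mul_sum, ← Finset.sum_sub_distrib]; exact Finset.sum_congr rfl fun i _ => by ring
      have e2 : ∑ i, Λ i * (((γ 1 0 : ℤ) : ℂ) * τ + ((γ 1 1 : ℤ) : ℂ)) * θ i τ =
          (((γ 1 0 : ℤ) : ℂ) * τ + ((γ 1 1 : ℤ) : ℂ)) * ∑ i, Λ i * θ i τ := by
        rw [Finset.mul_sum]; exact Finset.sum_congr rfl fun i _ => by ring
      rw [e2] at h1
      rw [e1]
      linear_combination -h1 + χ * (((γ 1 0 : ℤ) : ℂ) * τ + ((γ 1 1 : ℤ) : ℂ)) * hwE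
    exact (mul_eq_zero.mp this).resolve_left (mul_ne_zero hc₁ hden)
  -- Step 4: let `Im τ → ∞`: `Σ (Λ_i - χ) = 0`
  have hsum : ∑ i, (Λ i - χ) = 0 := by
    by_contra hne
    set S : ℂ := ∑ i, (Λ i - χ) with hS
    have hSpos : 0 < ‖S‖ := norm_pos_iff.mpr hne
    -- choose `Y` with `‖θ_i τ - 1‖ < ‖S‖/(2 h + 1)·…` for all `i`
    set ε : ℝ := ‖S‖ / (2 * (∑ i : ι, ‖Λ i - χ‖) + 1) with hε
    have hεpos : 0 < ε := by
      rw [hε]; apply div_pos hSpos; positivity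
    choose Y hY using fun i => hlim i ε hεpos
    set Ymax : ℝ := (Finset.univ.sup' Finset.univ_nonempty Y) ⊔ 1 with hYmax
    have hYpos : 0 < Ymax := lt_of_lt_of_le one_pos (le_sup_right)
    set τ : ℍ := ⟨Complex.I * (Ymax : ℂ), by simpa using hYpos⟩ with hτ
    have hτim : τ.im = Ymax := by
      show (Complex.I * (Ymax : ℂ)).im = Ymax; simp
    have hclose : ∀ i, ‖θ i τ - 1‖ < ε := fun i => hY i τ (by
      rw [hτim, hYmax]
      exact le_trans (Finset.le_sup' Y (Finset.mem_univ i)) le_sup_left)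
    have h0 := hvan τ
    -- `S = Σ (Λ_i - χ)(1 - θ_i τ)` in norm `≤ Σ ‖Λ_i - χ‖ ε < ‖S‖`
    have hS' : S = ∑ i, (Λ i - χ) * (1 - θ i τ) := by
      have : ∑ i, (Λ i - χ) * (1 - θ i τ) = ∑ i, (Λ i - χ) - ∑ i, (Λ i - χ) * θ i τ := by
        rw [← Finset.sum_sub_distrib]; exact Finset.sum_congr rfl fun i _ => by ring
      rw [this, h0, sub_zero]
    have hle : ‖S‖ ≤ (∑ i, ‖Λ i - χ‖) * ε := by
      rw [hS']
      refine (norm_sum_le _ _).trans ?_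
      rw [Finset.sum_mul]
      refine Finset.sum_le_sum fun i _ => ?_
      rw [norm_mul]
      refine mul_le_mul_of_nonneg_left ?_ (norm_nonneg _)
      rw [norm_sub_rev]; exact (hclose i).le
    have hlt : (∑ i, ‖Λ i - χ‖) * ε < ‖S‖ := by
      rw [hε]
      have hA : 0 ≤ ∑ i : ι, ‖Λ i - χ‖ := Finset.sum_nonneg fun i _ => norm_nonneg _
      rw [mul_div_assoc']
      rw [div_lt_iff₀ (by positivity)]
      nlinarith
    linarith
  -- Step 5: unit vectors
  have hsum' : ∑ i, Λ i = Fintype.card ι * χ := by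
    have : ∑ i, (Λ i - χ) = ∑ i, Λ i - Fintype.card ι * χ := by
      rw [Finset.sum_sub_distrib, Finset.sum_const, Finset.card_univ, nsmul_eq_mul]
    rw [this] at hsum
    linear_combination hsum
  exact eq_of_sum_eq_card_mul hΛ1 hχ1 hsum'

end Literature.NumberTheory.EllipticCurves.ModularForms.HeckeTheta

end Part6

/-!
## Part 7 — port of `Summits/BirchSwinnertonDyer/BirchSwinnertonDyer/Theorems/ResidualThetaTransportAtTwoHeckeThetaPartnerAdicAtTwoThetaCharacter.lean` (6 declarations kept)

# The multiplier of the theta null of an ideal lattice is the Kronecker character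

Declarations of this Part (verbatim port; each keeps its own docstring and citation): `qSeries_norm_sub_one_lt`, `idealNormCount_eq_sum_divisors`, `coe_sl_smul`, `exists_unit_thetaNull_smul`, `heckeOne_smul`, `binaryTheta_unit_eq_kronecker`.

Reference keys (see `references.bib` and the declarations' citations): [Ribet1977Nebentypus].
-/

section Part7

open scoped _root_.NumberField ComplexConjugate _root_.Real _root_.Topology _root_.MatrixGroups _root_.UpperHalfPlane nonZeroDivisors
open _root_.NumberField _root_.Module _root_.Matrix _root_.Complex _root_.Filter _root_.CongruenceSubgroup _root_.ModularForm

namespace Literature.NumberTheory.EllipticCurves.ModularForms.HeckeTheta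

open Literature.Analysis.SpecialFunctions
open Literature.NumberTheory.ModularForms.BinaryTheta
open Literature.NumberTheory.Automorphic (siegelUpperHalfSpace mem_siegelUpperHalfSpace_iff)
open Literature.NumberTheory.LFunctions (idealNormCount)
open Literature.NumberTheory.EllipticCurves.ModularForms (heckeOne heckeOneCoeff heckeOne_eq_qSeries
  summable_heckeOneCoeff_mul_pow heckeOne_slash_of_mem_gamma0)

variable {K : Type} [Field K] [NumberField K]

/-! ### `q`-series with natural coefficients tend to their constant term -/

/-- A `q`-series `f(τ) = Σ_n a(n) qⁿ` (`q = e(τ)`) with natural coefficients and `a(0) = 1` satisfies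
`‖f(τ) - 1‖ < ε` for `Im τ` large, uniformly in `Re τ`: `‖f(τ) - 1‖ ≤ C e^{-2π Im τ}` for `Im τ ≥ 1`
with `C = Σ_{n≥1} a(n) e^{-2π(n-1)}`. [cite: Ribet1977Nebentypus, §3 (supporting lemma)] -/
theorem qSeries_norm_sub_one_lt {f : ℍ → ℂ} {a : ℕ → ℕ} (ha0 : a 0 = 1)
    (hf : ∀ τ : ℍ, HasSum (fun n : ℕ => (a n : ℂ) * cexp (2 * π * Complex.I * (τ : ℂ)) ^ n) (f τ)) :
    ∀ ε > 0, ∃ Y : ℝ, ∀ τ : ℍ, Y ≤ τ.im → ‖f τ - 1‖ < ε := by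
  intro ε hε
  have hqnorm : ∀ τ : ℍ, ‖cexp (2 * π * Complex.I * (τ : ℂ))‖ = Real.exp (-2 * π * τ.im) := by
    intro τ
    rw [Complex.norm_exp]
    congr 1
    simp [Complex.mul_re, UpperHalfPlane.coe_im, UpperHalfPlane.coe_re]
  set q₁ : ℝ := Real.exp (-2 * π) with hq₁
  -- summability at `τ = i`
  have hS1 := hf UpperHalfPlane.I
  have hsumm1 : Summable fun n : ℕ => (a n : ℝ) * q₁ ^ n := by
    refine hS1.summable.norm.congr fun n => ?_
    rw [norm_mul, norm_pow, hqnorm, Complex.norm_natCast, UpperHalfPlane.I_im, mul_one]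
  set C : ℝ := ∑' n : ℕ, (a (n + 1) : ℝ) * q₁ ^ n with hC
  have hq₁pos : 0 < q₁ := Real.exp_pos _
  have hCsum : Summable fun n : ℕ => (a (n + 1) : ℝ) * q₁ ^ n := by
    have h := (summable_nat_add_iff 1).mpr hsumm1
    refine (h.mul_left q₁⁻¹).congr fun n => ?_
    simp only [pow_succ]
    field_simp
  have hC0 : 0 ≤ C := tsum_nonneg fun n => by positivity
  obtain ⟨Y, hY⟩ : ∃ Y : ℝ, ∀ y ≥ Y, C * Real.exp (-2 * π * y) < ε ∧ 1 ≤ y := by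
    have ht : Tendsto (fun y : ℝ => C * Real.exp (-2 * π * y)) atTop (𝓝 0) := by
      have : Tendsto (fun y : ℝ => Real.exp (-2 * π * y)) atTop (𝓝 0) :=
        Real.tendsto_exp_atBot.comp (tendsto_id.const_mul_atTop_of_neg
          (show (-2 * π : ℝ) < 0 by nlinarith [Real.pi_pos]))
      simpa using this.const_mul C
    obtain ⟨Y, hY⟩ := ((ht.eventually (gt_mem_nhds hε)).and (eventually_ge_atTop (1 : ℝ))).exists_forall_of_atTop
    exact ⟨Y, fun y hy => hY y hy⟩
  refine ⟨Y, fun τ hτ => ?_⟩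
  obtain ⟨hlt, hy1⟩ := hY τ.im hτ
  set q : ℂ := cexp (2 * π * Complex.I * (τ : ℂ)) with hqdef
  have hqle : ‖q‖ ≤ q₁ := by
    rw [hqdef, hqnorm, hq₁]
    exact Real.exp_le_exp.mpr (by nlinarith [Real.pi_pos])
  have hS2 : HasSum (fun n : ℕ => (a n : ℂ) * q ^ n) (f τ) := hf τ
  have hS' := (hasSum_nat_add_iff' 1).mpr hS2
  simp only [Finset.range_one, Finset.sum_singleton, pow_zero, mul_one, ha0, Nat.cast_one] at hS'
  have hle : ∀ n : ℕ, ‖(a (n + 1) : ℂ) * q ^ (n + 1)‖ ≤ ((a (n + 1) : ℝ) * q₁ ^ n) * Real.exp (-2 * π * τ.im) := by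
    intro n
    rw [norm_mul, norm_pow, pow_succ, ← mul_assoc, Complex.norm_natCast]
    have hqn : ‖q‖ ^ n ≤ q₁ ^ n := pow_le_pow_left₀ (norm_nonneg _) hqle n
    rw [hqdef, hqnorm] at hqn ⊢
    have : (a (n + 1) : ℝ) * Real.exp (-2 * π * τ.im) ^ n ≤ (a (n + 1) : ℝ) * q₁ ^ n :=
      mul_le_mul_of_nonneg_left hqn (Nat.cast_nonneg _)
    nlinarith [Real.exp_pos (-2 * π * τ.im), Nat.cast_nonneg (α := ℝ) (a (n + 1))]
  have hsum2 : Summable fun n : ℕ => ((a (n + 1) : ℝ) * q₁ ^ n) * Real.exp (-2 * π * τ.im) :=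
    hCsum.mul_right _
  have hbound : ‖f τ - 1‖ ≤ C * Real.exp (-2 * π * τ.im) := by
    rw [← hS'.tsum_eq]
    calc ‖∑' n : ℕ, (a (n + 1) : ℂ) * q ^ (n + 1)‖
        ≤ ∑' n : ℕ, ‖(a (n + 1) : ℂ) * q ^ (n + 1)‖ := norm_tsum_le_tsum_norm
            (Summable.of_nonneg_of_le (fun n => norm_nonneg _) hle hsum2)
      _ ≤ ∑' n : ℕ, ((a (n + 1) : ℝ) * q₁ ^ n) * Real.exp (-2 * π * τ.im) :=
            Summable.tsum_le_tsum hle (Summable.of_nonneg_of_le (fun n => norm_nonneg _) hle hsum2) hsum2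
      _ = C * Real.exp (-2 * π * τ.im) := by rw [tsum_mul_right]
  exact hbound.trans_lt hlt

/-! ### `a_K(n) = Σ_{m ∣ n} κ(m)` from `ζ_K = ζ · L(κ)` -/

/-- **Coefficient comparison**: if `ζ_K(s) = ζ(s) L(s, κ)` for `Re s > 1` with bounded `κ`, then
`#{𝔞 ⊆ 𝓞_K : N𝔞 = n} = Σ_{m ∣ n} κ(m)` for every `n ≥ 1` (`L`-series injectivity,
`LSeries.eq_of_LSeries_eventually_eq`; Dirichlet convolution `1 ⋆ κ`).
[cite: Ribet1977Nebentypus, §3 (supporting lemma)] -/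
theorem idealNormCount_eq_sum_divisors {κ : ℕ → ℂ} (hκ : ∀ n, ‖κ n‖ ≤ 1)
    (hζ : ∀ s : ℂ, 1 < s.re → NumberField.dedekindZeta K s = riemannZeta s * LSeries κ s)
    {n : ℕ} (hn : n ≠ 0) : (idealNormCount K n : ℂ) = ∑ m ∈ n.divisors, κ m := by
  set f : ℕ → ℂ := fun n => (idealNormCount K n : ℂ) with hfdef
  set g : ℕ → ℂ := LSeries.convolution 1 κ with hgdef
  -- abscissas of absolute convergence
  have hκa : LSeries.abscissaOfAbsConv κ ≤ 1 :=
    LSeries.abscissaOfAbsConv_le_of_le_const ⟨1, fun n _ => hκ n⟩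
  have h1a : LSeries.abscissaOfAbsConv (1 : ℕ → ℂ) ≤ 1 :=
    LSeries.abscissaOfAbsConv_le_of_le_const ⟨1, fun n _ => by simp⟩
  have hf2 : LSeriesSummable f 2 := by
    have := Literature.NumberTheory.LFunctions.LSeriesSummable_dedekindZeta (K := K) (s := 2) (by norm_num)
    exact this
  have hfa : LSeries.abscissaOfAbsConv f < ⊤ :=
    lt_of_le_of_lt hf2.abscissaOfAbsConv_le (by simp)
  have h2re : (1 : EReal) < ((2 : ℂ).re : EReal) := by
    have : (2 : ℂ).re = 2 := by simp
    rw [this]; exact_mod_cast one_lt_two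
  have hκ2 : LSeriesSummable κ 2 := LSeriesSummable_of_abscissaOfAbsConv_lt_re
    (lt_of_le_of_lt hκa h2re)
  have h12 : LSeriesSummable (1 : ℕ → ℂ) 2 := LSeriesSummable_of_abscissaOfAbsConv_lt_re
    (lt_of_le_of_lt h1a h2re)
  have hg2 : LSeriesSummable g 2 := h12.convolution hκ2
  have hga : LSeries.abscissaOfAbsConv g < ⊤ :=
    lt_of_le_of_lt hg2.abscissaOfAbsConv_le (by simp)
  -- `L(f, x) = L(g, x)` for real `x > 1`
  have hev : (fun x : ℝ => LSeries f x) =ᶠ[atTop] fun x => LSeries g x := by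
    filter_upwards [eventually_gt_atTop (1 : ℝ)] with x hx
    have hx' : 1 < (x : ℂ).re := by simpa using hx
    have h := hζ x hx'
    rw [Literature.NumberTheory.LFunctions.dedekindZeta_eq_LSeries] at h
    rw [hfdef, h, hgdef, ← LSeries_one_eq_riemannZeta hx',
      LSeries_convolution (lt_of_le_of_lt h1a (by exact_mod_cast hx)) (lt_of_le_of_lt hκa (by exact_mod_cast hx))]
  have h := LSeries.eq_of_LSeries_eventually_eq hfa hga hev hn
  change f n = _
  rw [h, hgdef, LSeries.convolution_def]
  simp only
  rw [Nat.sum_divisorsAntidiagonal' (fun k m => (1 : ℕ → ℂ) k * κ m)]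
  exact Finset.sum_congr rfl fun m _ => by simp

/-! ### Theta nulls and Hecke's Eisenstein series on `ℍ` -/

/-- `γ • τ = (aτ + b)/(cτ + d)` on `ℍ`, with the entries of `γ ∈ SL₂(ℤ)` cast from `ℤ` to `ℂ`.
[cite: Ribet1977Nebentypus, §3 (supporting lemma)] -/
theorem coe_sl_smul (γ : SL(2, ℤ)) (τ : ℍ) :
    ((γ • τ : ℍ) : ℂ) = (((γ 0 0 : ℤ) : ℂ) * (τ : ℂ) + ((γ 0 1 : ℤ) : ℂ)) /
      (((γ 1 0 : ℤ) : ℂ) * (τ : ℂ) + ((γ 1 1 : ℤ) : ℂ)) := by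
  rw [UpperHalfPlane.coe_specialLinearGroup_apply]
  simp

/-- **The weight-one law of an even binary theta null on `ℍ`** (`BinaryThetaNull`, restated on the
upper half-plane): for `B` even, symmetric, positive definite and `γ = (a b; c d) ∈ SL₂(ℤ)` with
`det B ∣ c` there is a unit `Λ` with `θ_B(γτ) = Λ (cτ + d) θ_B(τ)`, `θ_B(τ) = ϑ[0;0](0, τB)`.
[cite: Ribet1977Nebentypus, §3 (supporting lemma)] -/
theorem exists_unit_thetaNull_smul {B : Matrix (Fin 2) (Fin 2) ℤ} (hsymm : B.IsSymm)
    (h00 : Even (B 0 0)) (h11 : Even (B 1 1)) (hpos : (B.map (Int.cast : ℤ → ℝ)).PosDef)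
    {γ : SL(2, ℤ)} (hγ : B.det ∣ (γ 1 0 : ℤ)) :
    ∃ Λ : ℂ, ‖Λ‖ = 1 ∧ ∀ τ : ℍ,
      riemannThetaChar 0 0 (((γ • τ : ℍ) : ℂ) • B.map ((↑) : ℤ → ℂ)) 0 =
        Λ * (((γ 1 0 : ℤ) : ℂ) * (τ : ℂ) + ((γ 1 1 : ℤ) : ℂ)) *
          riemannThetaChar 0 0 ((τ : ℂ) • B.map ((↑) : ℤ → ℂ)) 0 := by
  obtain ⟨Λ, hΛ1, -, hΛ⟩ := exists_unit_riemannThetaChar_zero_transform hsymm h00 h11 hpos hγ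
  refine ⟨Λ, hΛ1, fun τ => ?_⟩
  rw [coe_sl_smul]
  exact riemannThetaChar_zero_smul_transform hΛ τ.im_pos

/-- **Hecke's weight-one Eisenstein series `G̃_κ(·,0)` on `Γ₀(D)`, pointwise**:
`G̃(γτ) = κ̄(d) (cτ + d) G̃(τ)` for `γ = (a b; c d)`, `D ∣ c` (`heckeOne_slash_of_mem_gamma0`).
[cite: Ribet1977Nebentypus, §3 (supporting lemma)] -/
theorem heckeOne_smul {D : ℕ} [NeZero D] (κ : DirichletCharacter ℂ D) (hodd : κ.Odd) {γ : SL(2, ℤ)}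
    (hγ : (D : ℤ) ∣ (γ 1 0 : ℤ)) (τ : ℍ) :
    heckeOne κ (γ • τ) = κ⁻¹ ((γ 1 1 : ℤ) : ZMod D) *
      (((γ 1 0 : ℤ) : ℂ) * (τ : ℂ) + ((γ 1 1 : ℤ) : ℂ)) * heckeOne κ τ := by
  have hmem : γ ∈ Gamma0 D := Gamma0_mem.mpr ((ZMod.intCast_zmod_eq_zero_iff_dvd _ D).mpr hγ)
  have h := congrFun (heckeOne_slash_of_mem_gamma0 κ hodd hmem) τ
  rw [ModularForm.SL_slash_apply, Pi.smul_apply, smul_eq_mul, ModularGroup.denom_apply]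
    at h
  have hX : (((γ 1 0 : ℤ) : ℂ) * (τ : ℂ) + ((γ 1 1 : ℤ) : ℂ)) ≠ 0 := by
    have := UpperHalfPlane.denom_ne_zero γ τ
    rwa [ModularGroup.denom_apply] at this
  calc heckeOne κ (γ • τ)
      = heckeOne κ (γ • τ) * (((γ 1 0 : ℤ) : ℂ) * (τ : ℂ) + ((γ 1 1 : ℤ) : ℂ)) ^ (-(1 : ℤ)) *
          (((γ 1 0 : ℤ) : ℂ) * (τ : ℂ) + ((γ 1 1 : ℤ) : ℂ)) := by
        rw [_root_.zpow_neg_one, inv_mul_cancel_right₀ hX]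
    _ = _ := by rw [h]; ring

/-! ### The multiplier is the Kronecker character -/

/-- **The multiplier of an ideal-lattice theta null on `Γ₀(D)` is the Kronecker character**
(Hecke 1926 §2; Schoeneberg 1939).  Let `K` be imaginary quadratic, `|d_K| ∣ D`, `κ` a primitive odd
Dirichlet character mod `D` with `κ² = 1` and `ζ_K(s) = ζ(s) L(s, κ)` for `Re s > 1`; let `𝔟 ≠ 0`
have Gram data `(b, B)` (`exists_gram`: `B_{ij} N𝔟 = Tr(σ(bᵢ) σ̄(bⱼ))`, symmetric, positive
definite); let `γ = (a b; c d) ∈ SL₂(ℤ)` with `D ∣ c` and `Λ ∈ ℂ` with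
`θ_B(γτ) = Λ (cτ + d) θ_B(τ)` on `ℍ`.  Then `Λ = κ(d)`.
Proof: apply `units_eq_of_thetaSum_eisenstein` to the theta nulls `θ_c` of Gram matrices of a system
`𝔞_c` of ideal-class representatives with `𝔞_{[𝔟]} = 𝔟` (`q`-expansions `hasSum_thetaNull_qExpansion`,
constant term `1`, limits `qSeries_norm_sub_one_lt`, laws `exists_unit_thetaNull_smul` for `γ` and
`γ₀ = (1 0; D 1)`) and `E = G̃_κ(·,0)` (`heckeOne_eq_qSeries`, `heckeOne_smul`; `e(0) = 2L(1,κ) ≠ 0`);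
the coefficient identity `w e(n) = c₁ Σ_c r_c(n)` (`c₁ = -4πiτ(κ)/D`, `w = #𝓞_K^×`) is
`sum_natCard_norm_eq` + `idealNormCount_eq_sum_divisors` + `κ̄ = κ`.  Finally `θ_B = θ_{[𝔟]}`
(same `q`-series) and `θ_B ≢ 0` give `Λ = Λ_{[𝔟]} = κ̄(d) = κ(d)`.
[cite: Ribet1977Nebentypus, §3 (supporting lemma)] -/
theorem binaryTheta_unit_eq_kronecker (hK : finrank ℚ K = 2) [IsTotallyComplex K] (σ : K →+* ℂ)
    {D : ℕ} [NeZero D] (hdvd : ((discr K).natAbs : ℤ) ∣ (D : ℤ)) {κ : DirichletCharacter ℂ D}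
    (hprim : κ.IsPrimitive) (hodd : κ.Odd) (hquad : κ ^ 2 = 1)
    (hζ : ∀ s : ℂ, 1 < s.re → NumberField.dedekindZeta K s = riemannZeta s * LSeries (fun n => κ n) s)
    {𝔟 : Ideal (𝓞 K)} (h𝔟 : 𝔟 ≠ ⊥) (b : Basis (Fin 2) ℤ 𝔟) {B : Matrix (Fin 2) (Fin 2) ℤ}
    (hB : ∀ i j, ((B i j : ℤ) : ℂ) * ((Ideal.absNorm 𝔟 : ℕ) : ℂ) =
      σ ((b i : 𝓞 K) : K) * conj (σ ((b j : 𝓞 K) : K)) + conj (σ ((b i : 𝓞 K) : K)) * σ ((b j : 𝓞 K) : K))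
    (hsymm : B.IsSymm) (hpos : (B.map (Int.cast : ℤ → ℝ)).PosDef)
    {γ : SL(2, ℤ)} (hγ : (D : ℤ) ∣ (γ 1 0 : ℤ)) {Λ : ℂ}
    (hΛ : ∀ τ : ℍ, riemannThetaChar 0 0 (((γ • τ : ℍ) : ℂ) • B.map ((↑) : ℤ → ℂ)) 0 =
      Λ * (((γ 1 0 : ℤ) : ℂ) * (τ : ℂ) + ((γ 1 1 : ℤ) : ℂ)) *
        riemannThetaChar 0 0 ((τ : ℂ) • B.map ((↑) : ℤ → ℂ)) 0) :
    Λ = κ ((γ 1 1 : ℤ) : ZMod D) := by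
  classical
  have hquad' : κ⁻¹ = κ := by rw [eq_comm, ← mul_eq_one_iff_eq_inv, ← pow_two, hquad]
  have hDpos : 0 < D := Nat.pos_of_ne_zero (NeZero.ne D)
  haveI : Finite (𝓞 K)ˣ := finite_units hK
  -- ideal-class representatives with `𝔞 c₀ = 𝔟`
  have h𝔟0 : 𝔟 ∈ (Ideal (𝓞 K))⁰ := mem_nonZeroDivisors_of_ne_zero h𝔟
  set c₀ : ClassGroup (𝓞 K) := ClassGroup.mk0 ⟨𝔟, h𝔟0⟩ with hc₀
  obtain ⟨𝔞, h𝔞, h𝔞𝔟⟩ : ∃ 𝔞 : ClassGroup (𝓞 K) → (Ideal (𝓞 K))⁰,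
      (∀ c, ClassGroup.mk0 (𝔞 c) = c) ∧ (𝔞 c₀ : Ideal (𝓞 K)) = 𝔟 := by
    refine ⟨Function.update (fun c => (ClassGroup.mk0_surjective c).choose) c₀ ⟨𝔟, h𝔟0⟩,
      fun c => ?_, by simp⟩
    rcases eq_or_ne c c₀ with rfl | hne
    · simp [hc₀]
    · rw [Function.update_of_ne hne]
      exact (ClassGroup.mk0_surjective c).choose_spec
  have h𝔞0 : ∀ c, (𝔞 c : Ideal (𝓞 K)) ≠ ⊥ := fun c => nonZeroDivisors.coe_ne_zero (𝔞 c)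
  -- Gram data of every class
  choose bc Bc hBc hsymmc h00c h11c hdetc hposc using fun c => exists_gram hK σ (h𝔞0 c)
  -- the auxiliary element `γ₀ = (1 0; D 1)`
  set γ₀ : SL(2, ℤ) := ⟨!![1, 0; (D : ℤ), 1], by simp [Matrix.det_fin_two_of]⟩ with hγ₀
  have hγ₀a : (γ₀ 0 0 : ℤ) = 1 := rfl
  have hγ₀b : (γ₀ 0 1 : ℤ) = 0 := rfl
  have hγ₀c : (γ₀ 1 0 : ℤ) = D := rfl
  have hγ₀d : (γ₀ 1 1 : ℤ) = 1 := rfl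
  have hdetγ : ∀ c, (Bc c).det ∣ (γ 1 0 : ℤ) := fun c => by rw [hdetc]; exact hdvd.trans hγ
  have hdetγ₀ : ∀ c, (Bc c).det ∣ (γ₀ 1 0 : ℤ) := fun c => by rw [hdetc, hγ₀c]; exact hdvd
  choose Λc hΛc1 hΛc using fun c => exists_unit_thetaNull_smul (hsymmc c) (h00c c) (h11c c) (hposc c) (hdetγ c)
  choose Λ0 _hΛ01 hΛ0 using fun c =>
    exists_unit_thetaNull_smul (hsymmc c) (h00c c) (h11c c) (hposc c) (hdetγ₀ c)
  -- the theta nulls, their `q`-expansions and limits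
  set θ : ClassGroup (𝓞 K) → ℍ → ℂ := fun c τ =>
    riemannThetaChar 0 0 ((τ : ℂ) • (Bc c).map ((↑) : ℤ → ℂ)) 0 with hθdef
  set a : ClassGroup (𝓞 K) → ℕ → ℕ := fun c n =>
    Nat.card {x : 𝓞 K // x ∈ (𝔞 c : Ideal (𝓞 K)) ∧
      Ideal.absNorm (Ideal.span {x}) = n * Ideal.absNorm (𝔞 c : Ideal (𝓞 K))} with hadef
  set r : ClassGroup (𝓞 K) → ℕ → ℂ := fun c n => (a c n : ℂ) with hrdef
  have hθ : ∀ c (τ : ℍ), HasSum (fun n : ℕ => r c n * cexp (2 * π * Complex.I * (τ : ℂ)) ^ n) (θ c τ) :=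
    fun c τ => hasSum_thetaNull_qExpansion hK σ (h𝔞0 c) (bc c) (hBc c) (hsymmc c) (hposc c) τ.im_pos
  have ha0 : ∀ c, a c 0 = 1 := fun c => natCard_norm_eq_zero _
  have hr0 : ∀ c, r c 0 = 1 := fun c => by simp only [hrdef, ha0, Nat.cast_one]
  have hlim : ∀ c, ∀ ε > 0, ∃ Y : ℝ, ∀ τ : ℍ, Y ≤ τ.im → ‖θ c τ - 1‖ < ε :=
    fun c => qSeries_norm_sub_one_lt (ha0 c) (hθ c)
  -- Hecke's Eisenstein series
  set E : ℍ → ℂ := fun τ => heckeOne κ τ with hEdef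
  set e : ℕ → ℂ := heckeOneCoeff κ with hedef
  have hE : ∀ τ : ℍ, HasSum (fun n : ℕ => e n * cexp (2 * π * Complex.I * (τ : ℂ)) ^ n) (E τ) := by
    intro τ
    show HasSum _ (heckeOne κ τ)
    rw [heckeOne_eq_qSeries κ hprim hodd τ]
    exact (summable_heckeOneCoeff_mul_pow κ τ).hasSum
  have hκ1 : κ ≠ 1 := Literature.NumberTheory.EllipticCurves.ModularForms.ne_one_of_odd κ hodd
  have he0 : e 0 ≠ 0 := by
    show heckeOneCoeff κ 0 ≠ 0
    rw [heckeOneCoeff, if_pos rfl]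
    exact mul_ne_zero two_ne_zero (DirichletCharacter.LFunction_apply_one_ne_zero hκ1)
  -- the coefficient identity `w e(n) = c₁ Σ_c r_c(n)`
  have hw : ((Nat.card (𝓞 K)ˣ : ℕ) : ℂ) ≠ 0 := by exact_mod_cast Nat.card_pos.ne'
  have hcoef : ∀ n : ℕ, n ≠ 0 → ((Nat.card (𝓞 K)ˣ : ℕ) : ℂ) * e n =
      -(4 * π * Complex.I * gaussSum κ (ZMod.stdAddChar (N := D)) / D) * ∑ c, r c n := by
    intro n hn
    have h1 : e n = -(4 * π * Complex.I * gaussSum κ (ZMod.stdAddChar (N := D)) / D) *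
        ∑ m ∈ n.divisors, κ m := by
      show heckeOneCoeff κ n = _
      rw [heckeOneCoeff, if_neg hn, hquad']
    have h2 : ∑ c, r c n = ((Nat.card (𝓞 K)ˣ : ℕ) : ℂ) * ∑ m ∈ n.divisors, κ m := by
      simp only [hrdef, hadef]
      rw [← Nat.cast_sum, sum_natCard_norm_eq hK 𝔞 h𝔞 hn, Nat.cast_mul,
        idealNormCount_eq_sum_divisors (κ := fun n => κ n) (fun m => κ.norm_le_one _) hζ hn]
    rw [h1, h2]; ring
  -- laws under `γ₀` and `γ`
  have hθ₀ : ∀ c (τ : ℍ), θ c (γ₀ • τ) = Λ0 c * ((D : ℂ) * τ + 1) * θ c τ := by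
    intro c τ
    have h := hΛ0 c τ
    rw [hγ₀c, hγ₀d] at h
    simpa only [Int.cast_natCast, Int.cast_one] using h
  have hE₀ : ∀ τ : ℍ, E (γ₀ • τ) = ((D : ℂ) * τ + 1) * E τ := by
    intro τ
    have h := heckeOne_smul κ hodd (γ := γ₀) (by rw [hγ₀c]) τ
    rw [hγ₀c, hγ₀d] at h
    simpa only [Int.cast_natCast, Int.cast_one, map_one, one_mul] using h
  -- `d` is a unit mod `D`, so `‖κ(d)‖ = 1`
  have hu : IsUnit ((γ 1 1 : ℤ) : ZMod D) := by
    have hdet := Matrix.SpecialLinearGroup.det_coe γ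
    rw [Matrix.det_fin_two] at hdet
    have hc : ((γ 1 0 : ℤ) : ZMod D) = 0 := (ZMod.intCast_zmod_eq_zero_iff_dvd _ D).mpr hγ
    have had : ((γ 0 0 : ℤ) : ZMod D) * ((γ 1 1 : ℤ) : ZMod D) = 1 := by
      have := congrArg (fun x : ℤ => (x : ZMod D)) hdet
      simp only [Int.cast_sub, Int.cast_mul, Int.cast_one, hc, mul_zero, sub_zero] at this
      exact this
    exact IsUnit.of_mul_eq_one _ (by rw [mul_comm]; exact had)
  have hχ1 : ‖κ ((γ 1 1 : ℤ) : ZMod D)‖ = 1 := by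
    obtain ⟨u, hu'⟩ := hu
    rw [← hu']
    exact κ.unit_norm_eq_one u
  have hEγ : ∀ τ : ℍ, E (γ • τ) = κ ((γ 1 1 : ℤ) : ZMod D) *
      (((γ 1 0 : ℤ) : ℂ) * τ + ((γ 1 1 : ℤ) : ℂ)) * E τ := by
    intro τ
    have h := heckeOne_smul κ hodd hγ τ
    rwa [hquad'] at h
  -- all class multipliers equal `κ(d)`
  have key := units_eq_of_thetaSum_eisenstein hθ hr0 hlim hE he0 hw hcoef hDpos hγ₀a hγ₀b hγ₀c hγ₀d
    hθ₀ hE₀ hΛc1 hχ1 hΛc hEγ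
  -- `θ_B = θ_{c₀}`
  have heq : ∀ τ : ℍ, riemannThetaChar 0 0 ((τ : ℂ) • B.map ((↑) : ℤ → ℂ)) 0 = θ c₀ τ := by
    intro τ
    have h1 := hasSum_thetaNull_qExpansion hK σ h𝔟 b hB hsymm hpos τ.im_pos
    have h2 := hθ c₀ τ
    simp only [hrdef, hadef] at h2
    rw [h𝔞𝔟] at h2
    exact h1.unique h2
  -- a point where `θ_{c₀}` does not vanish
  obtain ⟨Y, hY⟩ := hlim c₀ 1 one_pos
  set τ₁ : ℍ := UpperHalfPlane.mk ((max Y 1 : ℝ) * Complex.I) (by simp) with hτ₁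
  have hτ₁im : Y ≤ τ₁.im := by
    rw [hτ₁]; simp
  have hne : θ c₀ τ₁ ≠ 0 := by
    intro h0
    have := hY τ₁ hτ₁im
    rw [h0, zero_sub, norm_neg, norm_one] at this
    exact lt_irrefl _ this
  have hX : (((γ 1 0 : ℤ) : ℂ) * (τ₁ : ℂ) + ((γ 1 1 : ℤ) : ℂ)) ≠ 0 := by
    have := UpperHalfPlane.denom_ne_zero γ τ₁
    rwa [ModularGroup.denom_apply] at this
  have h1 := hΛ τ₁
  rw [heq, heq] at h1
  have h2 : θ c₀ (γ • τ₁) =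
      Λc c₀ * (((γ 1 0 : ℤ) : ℂ) * (τ₁ : ℂ) + ((γ 1 1 : ℤ) : ℂ)) * θ c₀ τ₁ := hΛc c₀ τ₁
  rw [h2] at h1
  have : Λ = Λc c₀ := (mul_right_cancel₀ hX (mul_right_cancel₀ hne h1)).symm
  rw [this, key c₀]

end Literature.NumberTheory.EllipticCurves.ModularForms.HeckeTheta

end Part7

/-!
## Part 8 — port of `Summits/BirchSwinnertonDyer/BirchSwinnertonDyer/Theorems/ResidualThetaTransportAtTwoHeckeThetaPartnerAdicAtTwoThetaCoset.lean` (1 declarations kept)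

# Coset theta series of weight two: the law on `Γ₀(D·M)`

Declarations of this Part (verbatim port; each keeps its own docstring and citation): `exists_levelLift`.

Reference keys (see `references.bib` and the declarations' citations): [Ribet1977Nebentypus].
-/

section Part8

open scoped _root_.Real _root_.MatrixGroups _root_.UpperHalfPlane
open _root_.Matrix _root_.Complex _root_.Filter

namespace Literature.NumberTheory.EllipticCurves.ModularForms.HeckeTheta

open Literature.Analysis.SpecialFunctions
open Literature.NumberTheory.ModularForms.BinaryTheta
open Literature.NumberTheory.Automorphic (siegelUpperHalfSpace mem_siegelUpperHalfSpace_iff)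
open Literature.NumberTheory.ModularForms.SiegelUpperHalfSpace (denom)

/-- For `M ∣ c`, `γ' = (a, bM; c/M, d)` is again in `SL₂(ℤ)`. [cite: Ribet1977Nebentypus, §3 (supporting lemma)] -/
theorem exists_levelLift (M : ℕ) (γ : SL(2, ℤ)) (hγ : (M : ℤ) ∣ (γ 1 0 : ℤ)) :
    ∃ γ' : SL(2, ℤ), (γ' 0 0 : ℤ) = γ 0 0 ∧ (γ' 0 1 : ℤ) = (γ 0 1 : ℤ) * M ∧
      (γ' 1 0 : ℤ) * M = γ 1 0 ∧ (γ' 1 1 : ℤ) = γ 1 1 := by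
  obtain ⟨c', hc'⟩ := hγ
  have hdet := Matrix.SpecialLinearGroup.det_coe γ
  rw [Matrix.det_fin_two, hc'] at hdet
  refine ⟨⟨!![(γ 0 0 : ℤ), (γ 0 1 : ℤ) * M; c', (γ 1 1 : ℤ)], ?_⟩, rfl, rfl, ?_, rfl⟩
  · rw [Matrix.det_fin_two_of]; linear_combination hdet
  · show c' * (M : ℤ) = γ 1 0
    rw [hc', mul_comm]

variable {B : Matrix (Fin 2) (Fin 2) ℤ} {γ γ' : SL(2, ℤ)} {M : ℕ}

end Literature.NumberTheory.EllipticCurves.ModularForms.HeckeTheta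

end Part8

/-!
## Part 9 — port of `Summits/BirchSwinnertonDyer/BirchSwinnertonDyer/Theorems/ResidualThetaTransportAtTwoHeckeThetaPartnerAdicAtTwoThetaCosetIdeal.lean` (9 declarations kept)

# Coset theta series of an ideal class: coordinates, `q`-series

Declarations of this Part (verbatim port; each keeps its own docstring and citation): `embedding_equivFun_symm`, `coe_equivFun_symm_natCast_mul_add`, `exists_coords`, `absNorm_span_natCast_mul`, `absNorm_span_mul_div`, `dotProduct_coset_eq_embedding`, `riemannThetaCharTerm_coset_eq_pow`, `dotProduct_mulVec_coords`, `riemannThetaChar_coset_eq_of_sub_mem`.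

Reference keys (see `references.bib` and the declarations' citations): [Ribet1977Nebentypus].
-/

section Part9

open scoped _root_.NumberField ComplexConjugate _root_.Real _root_.MatrixGroups _root_.UpperHalfPlane
open _root_.NumberField _root_.Module _root_.Matrix _root_.Complex _root_.Filter

namespace Literature.NumberTheory.EllipticCurves.ModularForms.HeckeTheta

open Literature.Analysis.SpecialFunctions
open Literature.NumberTheory.ModularForms.BinaryTheta
open Literature.NumberTheory.Automorphic (siegelUpperHalfSpace mem_siegelUpperHalfSpace_iff)

variable {K : Type} [Field K] [NumberField K]

/-- `σ(Σ vᵢ bᵢ) = Σ vᵢ σ(bᵢ)`. [cite: Ribet1977Nebentypus, §3 (supporting lemma)] -/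
theorem embedding_equivFun_symm (σ : K →+* ℂ) {𝔟 : Ideal (𝓞 K)} (b : Basis (Fin 2) ℤ 𝔟)
    (v : Fin 2 → ℤ) :
    σ (((b.equivFun.symm v : 𝔟) : 𝓞 K) : K) = ∑ i, (v i : ℂ) * σ ((b i : 𝓞 K) : K) := by
  have hxsum : (((b.equivFun.symm v : 𝔟) : 𝓞 K) : K) = ∑ i, (v i : K) * ((b i : 𝓞 K) : K) := by
    rw [Basis.equivFun_symm_apply]
    push_cast
    simp [zsmul_eq_mul]
  rw [hxsum, map_sum]
  simp

omit [NumberField K] in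
/-- `x_{Mm + k} = M x_m + x_k` in `𝓞 K`. [cite: Ribet1977Nebentypus, §3 (supporting lemma)] -/
theorem coe_equivFun_symm_natCast_mul_add {𝔟 : Ideal (𝓞 K)} (b : Basis (Fin 2) ℤ 𝔟) (M : ℕ)
    (m k : Fin 2 → ℤ) :
    ((b.equivFun.symm (fun i => (M : ℤ) * m i + k i) : 𝔟) : 𝓞 K) =
      (M : 𝓞 K) * ((b.equivFun.symm m : 𝔟) : 𝓞 K) + ((b.equivFun.symm k : 𝔟) : 𝓞 K) := by
  have h : (fun i => (M : ℤ) * m i + k i) = (M : ℤ) • m + k := by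
    funext i; simp
  rw [h, map_add, LinearEquiv.map_smul, Submodule.coe_add, Submodule.coe_smul_of_tower, zsmul_eq_mul]
  push_cast
  ring

/-- **Coordinates of `M x₀`**: for `x₀ ∈ 𝔞` and `𝔟 = 𝔞𝔪`, `M x₀ ∈ 𝔟` (`M = N𝔪 ∈ 𝔪`), so
`M x₀ = Σ kᵢ bᵢ` for some `k ∈ ℤ²`. [cite: Ribet1977Nebentypus, §3 (supporting lemma)] -/
theorem exists_coords {𝔞 𝔪 𝔟 : Ideal (𝓞 K)} (h𝔟 : 𝔟 = 𝔞 * 𝔪) (b : Basis (Fin 2) ℤ 𝔟)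
    {x₀ : 𝓞 K} (hx₀ : x₀ ∈ 𝔞) :
    ∃ k : Fin 2 → ℤ, ((b.equivFun.symm k : 𝔟) : 𝓞 K) = (Ideal.absNorm 𝔪 : 𝓞 K) * x₀ := by
  have hmem : (Ideal.absNorm 𝔪 : 𝓞 K) * x₀ ∈ 𝔟 := by
    rw [h𝔟, mul_comm]
    exact Ideal.mul_mem_mul (Ideal.absNorm_mem 𝔪) hx₀
  refine ⟨b.equivFun ⟨_, hmem⟩, ?_⟩
  rw [LinearEquiv.symm_apply_apply]

/-- `N((M x)) = M² N((x))` in a quadratic field. [cite: Ribet1977Nebentypus, §3 (supporting lemma)] -/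
theorem absNorm_span_natCast_mul (hK : finrank ℚ K = 2) (M : ℕ) (x : 𝓞 K) :
    Ideal.absNorm (Ideal.span {(M : 𝓞 K) * x}) = M ^ 2 * Ideal.absNorm (Ideal.span {x}) := by
  rw [← Ideal.span_singleton_mul_span_singleton, map_mul, Ideal.absNorm_span_singleton,
    show (M : 𝓞 K) = algebraMap ℤ (𝓞 K) (M : ℤ) by simp, Algebra.norm_algebraMap,
    RingOfIntegers.rank, hK]
  simp [Int.natAbs_pow]

/-- For `x ∈ 𝔞`: `N𝔞 ∣ N((x))`, and `N((Mx))/N(𝔞𝔪) = M · N((x))/N𝔞` (`M = N𝔪`).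
[cite: Ribet1977Nebentypus, §3 (supporting lemma)] -/
theorem absNorm_span_mul_div (hK : finrank ℚ K = 2) {𝔞 𝔪 𝔟 : Ideal (𝓞 K)} (h𝔟 : 𝔟 = 𝔞 * 𝔪)
    (h𝔞 : 𝔞 ≠ ⊥) (h𝔪 : 𝔪 ≠ ⊥) {x : 𝓞 K} (hx : x ∈ 𝔞) :
    Ideal.absNorm 𝔞 ∣ Ideal.absNorm (Ideal.span {x}) ∧
      Ideal.absNorm (Ideal.span {(Ideal.absNorm 𝔪 : 𝓞 K) * x}) / Ideal.absNorm 𝔟 =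
        Ideal.absNorm 𝔪 * (Ideal.absNorm (Ideal.span {x}) / Ideal.absNorm 𝔞) := by
  have hdvd : Ideal.absNorm 𝔞 ∣ Ideal.absNorm (Ideal.span {x}) :=
    Ideal.absNorm_dvd_absNorm_of_le ((Ideal.span_singleton_le_iff_mem _).mpr hx)
  refine ⟨hdvd, ?_⟩
  obtain ⟨n, hn⟩ := hdvd
  have hA : Ideal.absNorm 𝔞 ≠ 0 := by rw [Ne, Ideal.absNorm_eq_zero_iff]; exact h𝔞
  have hM : Ideal.absNorm 𝔪 ≠ 0 := by rw [Ne, Ideal.absNorm_eq_zero_iff]; exact h𝔪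
  rw [absNorm_span_natCast_mul hK, hn, h𝔟, map_mul, Nat.mul_div_cancel_left _ (Nat.pos_of_ne_zero hA),
    show Ideal.absNorm 𝔪 ^ 2 * (Ideal.absNorm 𝔞 * n) = (Ideal.absNorm 𝔞 * Ideal.absNorm 𝔪) * (Ideal.absNorm 𝔪 * n) by ring,
    Nat.mul_div_cancel_left _ (Nat.pos_of_ne_zero (mul_ne_zero hA hM))]

/-- **`ᵗ(m + k/M) u = σ(x₀ + x_m)`** for `u = (σ bᵢ)ᵢ` and `Σ kᵢbᵢ = M x₀`.
[cite: Ribet1977Nebentypus, §3 (supporting lemma)] -/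
theorem dotProduct_coset_eq_embedding (σ : K →+* ℂ) {𝔟 : Ideal (𝓞 K)} (b : Basis (Fin 2) ℤ 𝔟)
    {M : ℕ} (hM : M ≠ 0) {x₀ : 𝓞 K} {k : Fin 2 → ℤ}
    (hk : ((b.equivFun.symm k : 𝔟) : 𝓞 K) = (M : 𝓞 K) * x₀) (m : Fin 2 → ℤ) :
    (((fun i => (m i : ℂ)) + fun i => (k i : ℂ) / M) ⬝ᵥ fun i => σ ((b i : 𝓞 K) : K)) =
      σ ((x₀ : K) + (((b.equivFun.symm m : 𝔟) : 𝓞 K) : K)) := by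
  have hM' : (M : ℂ) ≠ 0 := by exact_mod_cast hM
  have h1 := embedding_equivFun_symm σ b m
  have h2 := embedding_equivFun_symm σ b k
  rw [hk] at h2
  push_cast at h2
  rw [map_mul, map_natCast] at h2
  rw [map_add, h1]
  simp only [dotProduct, Pi.add_apply, Fin.sum_univ_two] at h2 ⊢
  field_simp
  linear_combination (-1) * h2

/-- **The general term of the coset theta**: for `x₀ ∈ 𝔞`, `Σ kᵢbᵢ = M x₀`, `m ∈ ℤ²` and
`x = x₀ + x_m`: `e(πi ᵗ(m + k/M) (Mτ B) (m + k/M)) = q^{N((x))/N𝔞}`, `q = e(τ)`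
(`ᵗ(Mm+k) B (Mm+k) · N𝔟 = 2N((Mx)) = 2M² N((x))`, `N𝔟 = M N𝔞`). [cite: Ribet1977Nebentypus, §3 (supporting lemma)] -/
theorem riemannThetaCharTerm_coset_eq_pow (hK : finrank ℚ K = 2) [IsTotallyComplex K] (σ : K →+* ℂ)
    {𝔞 𝔪 𝔟 : Ideal (𝓞 K)} (h𝔟 : 𝔟 = 𝔞 * 𝔪) (h𝔞 : 𝔞 ≠ ⊥) (h𝔪 : 𝔪 ≠ ⊥) (b : Basis (Fin 2) ℤ 𝔟)
    {B : Matrix (Fin 2) (Fin 2) ℤ}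
    (hB : ∀ i j, ((B i j : ℤ) : ℂ) * ((Ideal.absNorm 𝔟 : ℕ) : ℂ) =
      σ ((b i : 𝓞 K) : K) * conj (σ ((b j : 𝓞 K) : K)) + conj (σ ((b i : 𝓞 K) : K)) * σ ((b j : 𝓞 K) : K))
    {x₀ : 𝓞 K} (hx₀ : x₀ ∈ 𝔞) {k : Fin 2 → ℤ}
    (hk : ((b.equivFun.symm k : 𝔟) : 𝓞 K) = (Ideal.absNorm 𝔪 : 𝓞 K) * x₀) (τ : ℂ) (m : Fin 2 → ℤ) :
    riemannThetaCharTerm (fun i => (k i : ℂ) / (Ideal.absNorm 𝔪 : ℕ)) 0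
        ((((Ideal.absNorm 𝔪 : ℕ) : ℂ) * τ) • B.map ((↑) : ℤ → ℂ)) 0 m =
      cexp (2 * π * I * τ) ^
        (Ideal.absNorm (Ideal.span {x₀ + ((b.equivFun.symm m : 𝔟) : 𝓞 K)}) / Ideal.absNorm 𝔞) := by
  set M : ℕ := Ideal.absNorm 𝔪 with hMdef
  have hM : M ≠ 0 := by rw [hMdef, Ne, Ideal.absNorm_eq_zero_iff]; exact h𝔪
  have hM' : (M : ℂ) ≠ 0 := by exact_mod_cast hM
  have h𝔟0 : 𝔟 ≠ ⊥ := by rw [h𝔟]; exact mul_ne_zero h𝔞 h𝔪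
  set x : 𝓞 K := x₀ + ((b.equivFun.symm m : 𝔟) : 𝓞 K) with hxdef
  have hx : x ∈ 𝔞 := by
    refine 𝔞.add_mem hx₀ ?_
    have : ((b.equivFun.symm m : 𝔟) : 𝓞 K) ∈ 𝔟 := (b.equivFun.symm m).2
    exact Ideal.mul_le_right (h𝔟.le this)
  -- the integer vector `v = Mm + k` with `x_v = M x`
  set v : Fin 2 → ℤ := fun i => (M : ℤ) * m i + k i with hvdef
  have hv : ((b.equivFun.symm v : 𝔟) : 𝓞 K) = (M : 𝓞 K) * x := by
    rw [hvdef, coe_equivFun_symm_natCast_mul_add, hk, hxdef]; ring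
  have hquad := dotProduct_mulVec_eq_two_mul_div hK σ h𝔟0 b hB v
  rw [hv, (absNorm_span_mul_div hK h𝔟 h𝔞 h𝔪 hx).2] at hquad
  set n : ℕ := Ideal.absNorm (Ideal.span {x}) / Ideal.absNorm 𝔞 with hndef
  -- the characteristic vector is `v/M`
  have hvec : ((fun i => (m i : ℂ)) + fun i => (k i : ℂ) / (M : ℕ)) = fun i => (M : ℂ)⁻¹ * (v i : ℂ) := by
    funext i
    simp only [Pi.add_apply, hvdef]
    push_cast
    field_simp
  rw [riemannThetaCharTerm, ← Complex.exp_nat_mul, hvec]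
  congr 1
  simp only [add_zero, dotProduct_zero, mul_zero]
  have hq : ((fun i => (M : ℂ)⁻¹ * (v i : ℂ)) ⬝ᵥ
      (((((M : ℕ) : ℂ) * τ) • B.map ((↑) : ℤ → ℂ)) *ᵥ fun i => (M : ℂ)⁻¹ * (v i : ℂ))) =
      (M : ℂ)⁻¹ * τ * ((v ⬝ᵥ (B *ᵥ v) : ℤ) : ℂ) := by
    simp only [dotProduct, Matrix.mulVec, Fin.sum_univ_two, Matrix.smul_apply, Matrix.map_apply,
      smul_eq_mul]
    push_cast
    field_simp
  rw [hq, hquad]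
  push_cast
  field_simp
  ring

/-- **`ᵗkBk = 2M · N((x₀))/N𝔞`** for the coordinates `k` of `M x₀`, `x₀ ∈ 𝔞`.
[cite: Ribet1977Nebentypus, §3 (supporting lemma)] -/
theorem dotProduct_mulVec_coords (hK : finrank ℚ K = 2) [IsTotallyComplex K] (σ : K →+* ℂ)
    {𝔞 𝔪 𝔟 : Ideal (𝓞 K)} (h𝔟 : 𝔟 = 𝔞 * 𝔪) (h𝔞 : 𝔞 ≠ ⊥) (h𝔪 : 𝔪 ≠ ⊥) (b : Basis (Fin 2) ℤ 𝔟)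
    {B : Matrix (Fin 2) (Fin 2) ℤ}
    (hB : ∀ i j, ((B i j : ℤ) : ℂ) * ((Ideal.absNorm 𝔟 : ℕ) : ℂ) =
      σ ((b i : 𝓞 K) : K) * conj (σ ((b j : 𝓞 K) : K)) + conj (σ ((b i : 𝓞 K) : K)) * σ ((b j : 𝓞 K) : K))
    {x₀ : 𝓞 K} (hx₀ : x₀ ∈ 𝔞) {k : Fin 2 → ℤ}
    (hk : ((b.equivFun.symm k : 𝔟) : 𝓞 K) = (Ideal.absNorm 𝔪 : 𝓞 K) * x₀) :
    k ⬝ᵥ (B *ᵥ k) =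
      2 * (Ideal.absNorm 𝔪 : ℤ) * ((Ideal.absNorm (Ideal.span {x₀}) / Ideal.absNorm 𝔞 : ℕ) : ℤ) := by
  have h𝔟0 : 𝔟 ≠ ⊥ := by rw [h𝔟]; exact mul_ne_zero h𝔞 h𝔪
  have hquad := dotProduct_mulVec_eq_two_mul_div hK σ h𝔟0 b hB k
  rw [hk, (absNorm_span_mul_div hK h𝔟 h𝔞 h𝔪 hx₀).2] at hquad
  rw [hquad]
  push_cast
  ring

omit [NumberField K] in
/-- **`Θ(τ; x₀ + 𝔟)` depends only on the coset**: if `x₀' - x₀ ∈ 𝔟` then the characteristics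
`k'/M` and `k/M` differ by an integer vector, and `ϑ[k'/M; 0] = ϑ[k/M; 0]`.
[cite: Ribet1977Nebentypus, §3 (supporting lemma)] -/
theorem riemannThetaChar_coset_eq_of_sub_mem {𝔟 : Ideal (𝓞 K)} (b : Basis (Fin 2) ℤ 𝔟) {M : ℕ}
    (hM : M ≠ 0) {x₀ x₀' : 𝓞 K} {k k' : Fin 2 → ℤ}
    (hk : ((b.equivFun.symm k : 𝔟) : 𝓞 K) = (M : 𝓞 K) * x₀)
    (hk' : ((b.equivFun.symm k' : 𝔟) : 𝓞 K) = (M : 𝓞 K) * x₀') (hy : x₀' - x₀ ∈ 𝔟)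
    (Ω : Matrix (Fin 2) (Fin 2) ℂ) (z : Fin 2 → ℂ) :
    riemannThetaChar (fun i => (k' i : ℂ) / M) 0 Ω z = riemannThetaChar (fun i => (k i : ℂ) / M) 0 Ω z := by
  have hM' : (M : ℂ) ≠ 0 := by exact_mod_cast hM
  set w : Fin 2 → ℤ := b.equivFun ⟨x₀' - x₀, hy⟩ with hw
  have hkw : k' = fun i => (M : ℤ) * w i + k i := by
    apply b.equivFun.symm.injective
    apply Subtype.ext
    rw [coe_equivFun_symm_natCast_mul_add, hk, hk', hw, LinearEquiv.symm_apply_apply]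
    push_cast
    ring
  have hchar : (fun i => (k' i : ℂ) / M) = (fun i => (k i : ℂ) / M) + fun i => (w i : ℂ) := by
    funext i
    simp only [hkw, Pi.add_apply]
    push_cast
    field_simp
    ring
  rw [hchar, riemannThetaChar_charShift_fst]

end Literature.NumberTheory.EllipticCurves.ModularForms.HeckeTheta

end Part9

/-!
## Part 10 — port of `Summits/BirchSwinnertonDyer/BirchSwinnertonDyer/Theorems/ResidualThetaTransportAtTwoHeckeThetaPartnerAdicAtTwoHeckeThetaClass.lean` (1 declarations kept)

# The Hecke theta series of one ideal class: the law with character `κ(d)χ(d)`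

Declarations of this Part (verbatim port; each keeps its own docstring and citation): `coe_equivFun_symm_intCast_mul`.

Reference keys (see `references.bib` and the declarations' citations): [Ribet1977Nebentypus].
-/

section Part10

open scoped _root_.NumberField ComplexConjugate _root_.Real _root_.MatrixGroups _root_.UpperHalfPlane
open _root_.NumberField _root_.Module _root_.Matrix _root_.Complex _root_.Filter _root_.IsDedekindDomain

namespace Literature.NumberTheory.EllipticCurves.ModularForms.HeckeTheta

open Literature.Analysis.SpecialFunctions
open Literature.NumberTheory.ModularForms.BinaryTheta
open Literature.NumberTheory.Automorphic (siegelUpperHalfSpace mem_siegelUpperHalfSpace_iff)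
open Literature.NumberTheory.LFunctions (idealPow rayClassCoeff)
open Literature.NumberTheory.EllipticCurves.ModularForms (rayClassCoeff_mul_of_ne_bot)

variable {K : Type} [Field K] [NumberField K]

omit [NumberField K] in
/-- Coordinates scale: if `Σ kᵢbᵢ = M x` then `Σ (d kᵢ) bᵢ = M (d x)`.
[cite: Ribet1977Nebentypus, §3 (supporting lemma)] -/
theorem coe_equivFun_symm_intCast_mul {𝔟 : Ideal (𝓞 K)} (b : Basis (Fin 2) ℤ 𝔟) {M : ℕ} {x : 𝓞 K}
    {k : Fin 2 → ℤ} (hk : ((b.equivFun.symm k : 𝔟) : 𝓞 K) = (M : 𝓞 K) * x) (d : ℤ) :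
    ((b.equivFun.symm (fun i => d * k i) : 𝔟) : 𝓞 K) = (M : 𝓞 K) * ((d : 𝓞 K) * x) := by
  have h : (fun i => d * k i) = d • k := by funext i; simp
  rw [h, LinearEquiv.map_smul, Submodule.coe_smul_of_tower, zsmul_eq_mul, hk]
  ring

end Literature.NumberTheory.EllipticCurves.ModularForms.HeckeTheta

end Part10

/-!
## Part 11 — port of `Summits/BirchSwinnertonDyer/BirchSwinnertonDyer/Theorems/ResidualThetaTransportAtTwoHeckeThetaPartnerAdicAtTwoHeckeThetaClassSeries.lean` (1 declarations kept)

# The class theta series: membership in the theta span and its `q`-series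

Declarations of this Part (verbatim port; each keeps its own docstring and citation): `hasSum_sigma_of_fintype`.

Reference keys (see `references.bib` and the declarations' citations): [Ribet1977Nebentypus].
-/

section Part11

open scoped _root_.NumberField ComplexConjugate _root_.Real _root_.MatrixGroups _root_.UpperHalfPlane
open _root_.NumberField _root_.Module _root_.Matrix _root_.Complex _root_.Filter _root_.IsDedekindDomain

namespace Literature.NumberTheory.EllipticCurves.ModularForms.HeckeTheta

open Literature.Analysis.SpecialFunctions
open Literature.NumberTheory.ModularForms.BinaryTheta
open Literature.NumberTheory.Automorphic (siegelUpperHalfSpace mem_siegelUpperHalfSpace_iff)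
open Literature.NumberTheory.LFunctions (idealPow rayClassCoeff)

variable {K : Type} [Field K] [NumberField K]

/-- A family of series indexed by a finite type sums on the `Σ`-type.
[cite: Ribet1977Nebentypus, §3 (supporting lemma)] -/
theorem hasSum_sigma_of_fintype {β : Type} [Fintype β] {γ : β → Type} {f : (Σ b, γ b) → ℂ}
    {a : β → ℂ} (h : ∀ b, HasSum (fun c => f ⟨b, c⟩) (a b)) : HasSum f (∑ b, a b) := by
  classical
  have h1 : ∀ b, HasSum ((Set.range (Sigma.mk b)).indicator f) (a b) := by
    intro b
    rw [← hasSum_subtype_iff_indicator]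
    show HasSum (fun x : Set.range (Sigma.mk b) => f x.1) (a b)
    rw [(sigma_mk_injective).hasSum_range_iff]
    exact h b
  have h2 := hasSum_sum (s := Finset.univ) fun b _ => h1 b
  refine h2.congr_fun fun p => ?_
  obtain ⟨b₀, c⟩ := p
  rw [Finset.sum_eq_single b₀]
  · rw [Set.indicator_of_mem (Set.mem_range.mpr ⟨c, rfl⟩)]
  · intro b _ hb
    rw [Set.indicator_of_notMem]
    rintro ⟨c', hc'⟩
    exact hb (congrArg Sigma.fst hc')
  · intro h; exact absurd (Finset.mem_univ _) h

end Literature.NumberTheory.EllipticCurves.ModularForms.HeckeTheta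

end Part11

/-!
## Part 12 — port of `Summits/BirchSwinnertonDyer/BirchSwinnertonDyer/Theorems/ResidualThetaTransportAtTwoHeckeThetaPartnerAdicAtTwoHeckeThetaNebentypus.lean` (1 declarations kept)

# The Hecke theta series has trivial Nebentypus: `κ(d) χ(d) = 1`

Declarations of this Part (verbatim port; each keeps its own docstring and citation): `isCoprime_span_natCast`.

Reference keys (see `references.bib` and the declarations' citations): [Ribet1977Nebentypus].
-/

section Part12

open scoped _root_.NumberField ComplexConjugate _root_.Real
open _root_.NumberField _root_.Module _root_.Complex _root_.IsDedekindDomain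

namespace Literature.NumberTheory.EllipticCurves.ModularForms.HeckeTheta

open Literature.NumberTheory.LFunctions (idealPow rayClassCoeff)

variable {K : Type} [Field K] [NumberField K]

/-- `(n) + 𝔪 = 1` for a natural number `n` prime to `M = N𝔪`. [cite: Ribet1977Nebentypus, §3 (supporting lemma)] -/
theorem isCoprime_span_natCast {𝔪 : Ideal (𝓞 K)} {n : ℕ} (hn : n.Coprime (Ideal.absNorm 𝔪)) :
    IsCoprime (Ideal.span {(n : 𝓞 K)}) 𝔪 := by
  rw [Ideal.isCoprime_iff_exists]
  have h := Nat.Coprime.isCoprime hn   -- IsCoprime (n : ℤ) (M : ℤ)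
  obtain ⟨u, v, huv⟩ := h
  refine ⟨(u : 𝓞 K) * n, Ideal.mul_mem_left _ _ (Ideal.mem_span_singleton_self _),
    (v : 𝓞 K) * (Ideal.absNorm 𝔪 : 𝓞 K), Ideal.mul_mem_left _ _ (Ideal.absNorm_mem 𝔪), ?_⟩
  have := congrArg (fun z : ℤ => (z : 𝓞 K)) huv
  push_cast at this
  exact this

end Literature.NumberTheory.EllipticCurves.ModularForms.HeckeTheta

end Part12

/-!
## Part 13 — port of `Summits/BirchSwinnertonDyer/BirchSwinnertonDyer/Theorems/ResidualThetaTransportAtTwoHeckeThetaPartnerAdicAtTwoThetaClassWeighted.lean` (2 declarations kept)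

# The weighted class-representative count

Declarations of this Part (verbatim port; each keeps its own docstring and citation): `exists_unique_ideal_eq_mul`, `sum_weighted_norm_eq`.

Reference keys (see `references.bib` and the declarations' citations): [Ribet1977Nebentypus].
-/

section Part13

open scoped _root_.NumberField nonZeroDivisors
open _root_.NumberField _root_.Module _root_.IsDedekindDomain

namespace Literature.NumberTheory.EllipticCurves.ModularForms.HeckeTheta

open Literature.NumberTheory.LFunctions (idealNormCount)

variable {K : Type} [Field K] [NumberField K]

/-- `x ∈ 𝔞 ≠ 0` gives `(x) = 𝔞 𝔟` for a unique `𝔟`. [cite: Ribet1977Nebentypus, §3 (supporting lemma)] -/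
theorem exists_unique_ideal_eq_mul {𝔞 : Ideal (𝓞 K)} (h𝔞 : 𝔞 ≠ ⊥) {x : 𝓞 K} (hx : x ∈ 𝔞) :
    ∃! 𝔟 : Ideal (𝓞 K), Ideal.span {x} = 𝔞 * 𝔟 := by
  obtain ⟨𝔟, h𝔟⟩ : 𝔞 ∣ Ideal.span {x} := Ideal.dvd_iff_le.mpr ((Ideal.span_singleton_le_iff_mem _).mpr hx)
  exact ⟨𝔟, h𝔟, fun 𝔟' h𝔟' => mul_left_cancel₀ h𝔞 (h𝔟'.symm.trans h𝔟)⟩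

/-- **The weighted class-representative count.**  `Σ_c Σ_{x ∈ 𝔞_c, N((x)) = n N𝔞_c} h(c,x) =
#𝓞_K^× · Σ_{N𝔟 = n} g(𝔟)` whenever `h(c, x) = g(𝔟)` for `(x) = 𝔞_c 𝔟` (`n ≥ 1`).
[cite: Ribet1977Nebentypus, §3 (supporting lemma)] -/
theorem sum_weighted_norm_eq (hK : finrank ℚ K = 2) [IsTotallyComplex K]
    (𝔞 : ClassGroup (𝓞 K) → (Ideal (𝓞 K))⁰) (h𝔞 : ∀ c, ClassGroup.mk0 (𝔞 c) = c)
    {n : ℕ} (hn : n ≠ 0) (g : Ideal (𝓞 K) → ℂ) (h : ClassGroup (𝓞 K) → 𝓞 K → ℂ)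
    (hh : ∀ c (x : 𝓞 K) (J : Ideal (𝓞 K)), x ∈ (𝔞 c : Ideal (𝓞 K)) →
      Ideal.span {x} = (𝔞 c : Ideal (𝓞 K)) * J → h c x = g J) :
    ∑ c : ClassGroup (𝓞 K), ∑ᶠ x : {x : 𝓞 K // x ∈ (𝔞 c : Ideal (𝓞 K)) ∧
        Ideal.absNorm (Ideal.span {x}) = n * Ideal.absNorm (𝔞 c : Ideal (𝓞 K))}, h c x.1 =
      Nat.card (𝓞 K)ˣ * ∑ᶠ J : {J : Ideal (𝓞 K) // Ideal.absNorm J = n}, g J.1 := by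
  classical
  haveI : Finite (𝓞 K)ˣ := finite_units hK
  have h𝔞0 : ∀ c, (𝔞 c : Ideal (𝓞 K)) ≠ ⊥ := fun c => nonZeroDivisors.coe_ne_zero (𝔞 c)
  have h𝔞N : ∀ c, Ideal.absNorm (𝔞 c : Ideal (𝓞 K)) ≠ 0 := fun c => by
    rw [Ne, Ideal.absNorm_eq_zero_iff]; exact h𝔞0 c
  set D := {p : ClassGroup (𝓞 K) × 𝓞 K // p.2 ∈ (𝔞 p.1 : Ideal (𝓞 K)) ∧
    Ideal.absNorm (Ideal.span {p.2}) = n * Ideal.absNorm (𝔞 p.1 : Ideal (𝓞 K))} with hD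
  set T := {J : Ideal (𝓞 K) // Ideal.absNorm J = n} with hT
  haveI : Finite T := (Ideal.finite_setOf_absNorm_eq (S := 𝓞 K) n).to_subtype
  letI : Fintype T := Fintype.ofFinite T
  have hquot : ∀ p : D, ∃! J : Ideal (𝓞 K), Ideal.span {p.1.2} = (𝔞 p.1.1 : Ideal (𝓞 K)) * J :=
    fun p => exists_unique_ideal_eq_mul (h𝔞0 p.1.1) p.2.1
  have hquotN : ∀ p : D, ∀ J : Ideal (𝓞 K), Ideal.span {p.1.2} = (𝔞 p.1.1 : Ideal (𝓞 K)) * J →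
      Ideal.absNorm J = n := by
    intro p J hJ
    have h := p.2.2
    rw [hJ, map_mul, mul_comm] at h
    exact mul_right_cancel₀ (h𝔞N p.1.1) h
  set f : D → T := fun p => ⟨(hquot p).choose, hquotN p _ (hquot p).choose_spec.1⟩ with hf
  have hf_spec : ∀ p : D, Ideal.span {p.1.2} = (𝔞 p.1.1 : Ideal (𝓞 K)) * (f p : Ideal (𝓞 K)) :=
    fun p => (hquot p).choose_spec.1
  have hf_eq : ∀ (p : D) (J : Ideal (𝓞 K)), Ideal.span {p.1.2} = (𝔞 p.1.1 : Ideal (𝓞 K)) * J →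
      (f p : Ideal (𝓞 K)) = J := fun p J hJ => ((hquot p).unique (hf_spec p) hJ)
  have hJ0 : ∀ J : T, (J : Ideal (𝓞 K)) ∈ (Ideal (𝓞 K))⁰ := fun J =>
    mem_nonZeroDivisors_of_ne_zero (by
      intro h0; have := J.2; rw [h0, Ideal.zero_eq_bot, Ideal.absNorm_bot] at this; exact hn this.symm)
  set cl : T → ClassGroup (𝓞 K) := fun J => (ClassGroup.mk0 ⟨(J : Ideal (𝓞 K)), hJ0 J⟩)⁻¹ with hcl
  have hclass : ∀ p : D, p.1.1 = cl (f p) := by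
    intro p
    rw [hcl]
    simp only
    rw [← h𝔞 p.1.1, ClassGroup.mk0_eq_mk0_inv_iff]
    refine ⟨p.1.2, ?_, (hf_spec p).symm⟩
    intro h0
    have := p.2.2
    rw [h0, Ideal.span_singleton_zero] at this
    simp only [Ideal.absNorm_bot] at this
    exact absurd this.symm (mul_ne_zero hn (h𝔞N p.1.1))
  have hprinc : ∀ J : T, ∃ x : 𝓞 K, x ≠ 0 ∧
      (𝔞 (cl J) : Ideal (𝓞 K)) * (J : Ideal (𝓞 K)) = Ideal.span {x} := by
    intro J
    have h := (ClassGroup.mk0_eq_mk0_inv_iff (I := 𝔞 (cl J)) (J := ⟨(J : Ideal (𝓞 K)), hJ0 J⟩)).mp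
      (by rw [h𝔞])
    obtain ⟨x, hx, h'⟩ := h
    exact ⟨x, hx, h'⟩
  have hfibre : ∀ J : T, Nat.card {p : D // f p = J} = Nat.card (𝓞 K)ˣ := by
    intro J
    obtain ⟨x₀, hx₀, hx₀J⟩ := hprinc J
    rw [← natCard_generators_eq hx₀]
    have hg : ∀ q : {p : D // f p = J}, Ideal.span {q.1.1.2} = Ideal.span {x₀} := by
      intro q
      have h1 := hf_spec q.1
      have h2 : ((f q.1 : T) : Ideal (𝓞 K)) = (J : Ideal (𝓞 K)) := congrArg Subtype.val q.2
      have h3 : q.1.1.1 = cl J := by rw [hclass q.1]; exact congrArg cl q.2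
      rw [h2, h3, hx₀J] at h1
      exact h1
    refine Nat.card_congr (Equiv.ofBijective
      (fun q : {p : D // f p = J} => (⟨q.1.1.2, hg q⟩ : {x : 𝓞 K // Ideal.span {x} = Ideal.span {x₀}}))
      ⟨?_, ?_⟩)
    · intro q q' hqq'
      have hx : q.1.1.2 = q'.1.1.2 := congrArg Subtype.val hqq'
      have hc : q.1.1.1 = q'.1.1.1 := by
        rw [hclass q.1, hclass q'.1]
        exact congrArg cl (q.2.trans q'.2.symm)
      apply Subtype.ext; apply Subtype.ext
      exact Prod.ext hc hx
    · rintro ⟨y, hy⟩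
      have hyJ : Ideal.span {y} = (𝔞 (cl J) : Ideal (𝓞 K)) * (J : Ideal (𝓞 K)) := hy.trans hx₀J.symm
      have hymem : y ∈ (𝔞 (cl J) : Ideal (𝓞 K)) :=
        (Ideal.span_singleton_le_iff_mem _).mp (by rw [hyJ]; exact Ideal.mul_le_right)
      have hyN : Ideal.absNorm (Ideal.span {y}) = n * Ideal.absNorm (𝔞 (cl J) : Ideal (𝓞 K)) := by
        rw [hyJ, map_mul, J.2, mul_comm]
      let p : D := ⟨(cl J, y), hymem, hyN⟩
      have hfp : f p = J := Subtype.ext (hf_eq p _ hyJ)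
      exact ⟨⟨p, hfp⟩, rfl⟩
  have hw0 : Nat.card (𝓞 K)ˣ ≠ 0 := Nat.card_pos.ne'
  haveI hfibfin : ∀ J : T, Finite {p : D // f p = J} := fun J =>
    Nat.finite_of_card_ne_zero (by rw [hfibre J]; exact hw0)
  haveI : Finite D := by
    rw [(Equiv.sigmaFiberEquiv f).symm.finite_iff]; infer_instance
  letI : Fintype D := Fintype.ofFinite D
  letI : ∀ J : T, Fintype {p : D // f p = J} := fun J => Fintype.ofFinite _
  haveI : ∀ c : ClassGroup (𝓞 K), Finite {x : 𝓞 K // x ∈ (𝔞 c : Ideal (𝓞 K)) ∧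
      Ideal.absNorm (Ideal.span {x}) = n * Ideal.absNorm (𝔞 c : Ideal (𝓞 K))} := fun c =>
    Finite.of_injective (fun x => (⟨(c, x.1), x.2⟩ : D)) fun x x' h => by
      apply Subtype.ext
      have := congrArg (fun p : D => p.1.2) h
      exact this
  letI : ∀ c : ClassGroup (𝓞 K), Fintype {x : 𝓞 K // x ∈ (𝔞 c : Ideal (𝓞 K)) ∧
      Ideal.absNorm (Ideal.span {x}) = n * Ideal.absNorm (𝔞 c : Ideal (𝓞 K))} := fun c => Fintype.ofFinite _
  -- the weight on `D` depends only on `f p`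
  have hweight : ∀ p : D, h p.1.1 p.1.2 = g (f p : Ideal (𝓞 K)) := fun p => hh _ _ _ p.2.1 (hf_spec p)
  -- `Σ_c Σ_{X_c} = Σ_D = Σ_T Σ_fibre = w Σ_T`
  have hLHS : ∑ c : ClassGroup (𝓞 K), ∑ᶠ x : {x : 𝓞 K // x ∈ (𝔞 c : Ideal (𝓞 K)) ∧
        Ideal.absNorm (Ideal.span {x}) = n * Ideal.absNorm (𝔞 c : Ideal (𝓞 K))}, h c x.1 =
      ∑ p : D, h p.1.1 p.1.2 := by
    simp only [finsum_eq_sum_of_fintype]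
    symm
    rw [Fintype.sum_equiv (Equiv.subtypeProdEquivSigmaSubtype
      (fun c (x : 𝓞 K) => x ∈ (𝔞 c : Ideal (𝓞 K)) ∧
        Ideal.absNorm (Ideal.span {x}) = n * Ideal.absNorm (𝔞 c : Ideal (𝓞 K))))
      (fun p : D => h p.1.1 p.1.2)
      (fun s : (Σ c : ClassGroup (𝓞 K), {x : 𝓞 K // x ∈ (𝔞 c : Ideal (𝓞 K)) ∧
        Ideal.absNorm (Ideal.span {x}) = n * Ideal.absNorm (𝔞 c : Ideal (𝓞 K))}) => h s.1 s.2.1)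
      (fun p => rfl), Fintype.sum_sigma]
  rw [hLHS, finsum_eq_sum_of_fintype, ← Fintype.sum_equiv (Equiv.sigmaFiberEquiv f) (fun q => h (Equiv.sigmaFiberEquiv f q).1.1 (Equiv.sigmaFiberEquiv f q).1.2) (fun p : D => h p.1.1 p.1.2) (fun q => rfl),
    Fintype.sum_sigma, Finset.mul_sum]
  refine Finset.sum_congr rfl fun J _ => ?_
  have : ∀ q : {p : D // f p = J}, h (Equiv.sigmaFiberEquiv f ⟨J, q⟩).1.1 (Equiv.sigmaFiberEquiv f ⟨J, q⟩).1.2 =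
      g (J : Ideal (𝓞 K)) := by
    intro q
    simp only [Equiv.sigmaFiberEquiv_apply]
    rw [hweight q.1, q.2]
  simp only [this, Finset.sum_const, Finset.card_univ, nsmul_eq_mul]
  rw [← Nat.card_eq_fintype_card, hfibre J]

end Literature.NumberTheory.EllipticCurves.ModularForms.HeckeTheta

end Part13

/-!
## Part 14 — port of `Summits/BirchSwinnertonDyer/BirchSwinnertonDyer/Theorems/ResidualThetaTransportAtTwoHeckeThetaPartnerAdicAtTwoHeckeThetaAssembly.lean` (4 declarations kept)

# Hecke's weight-two theta series `θ_ψ` as a cusp form on `Γ₀(|d_K| N𝔪)`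

Declarations of this Part (verbatim port; each keeps its own docstring and citation): `rayClassCoeff_ne_zero_of_isCoprime`, `dvd_and_isCoprime_of_mem_Gamma0`, `finsum_absNorm_zero`, `finsum_subtype_absNorm_eq`.

Reference keys (see `references.bib` and the declarations' citations): [Ribet1977Nebentypus].
-/

section Part14

open scoped _root_.NumberField ComplexConjugate _root_.Real _root_.MatrixGroups _root_.UpperHalfPlane _root_.ModularForm nonZeroDivisors
open _root_.NumberField _root_.Module _root_.Matrix _root_.Complex _root_.Filter _root_.IsDedekindDomain _root_.CongruenceSubgroup

namespace Literature.NumberTheory.EllipticCurves.ModularForms.HeckeTheta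

open Literature.Analysis.SpecialFunctions
open Literature.NumberTheory.ModularForms.BinaryTheta
open Literature.NumberTheory.Automorphic (siegelUpperHalfSpace mem_siegelUpperHalfSpace_iff)
open Literature.NumberTheory.LFunctions (idealPow rayClassCoeff exists_isCoprime_mk0_eq)
open Literature.NumberTheory.EllipticCurves.ModularForms (rayClassCoeff_mul_of_ne_bot)

variable {K : Type} [Field K] [NumberField K]

/-- `ψ̃_𝔪(𝔞) ≠ 0` for `𝔞 ≠ 0` prime to `𝔪` when `ψ(𝔭) ≠ 0` for `𝔭 ∤ 𝔪`.
[cite: Ribet1977Nebentypus, §3 (supporting lemma)] -/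
theorem rayClassCoeff_ne_zero_of_isCoprime {𝔪 𝔞 : Ideal (𝓞 K)} {ψ : HeightOneSpectrum (𝓞 K) → ℂ}
    (hψ0 : ∀ v : HeightOneSpectrum (𝓞 K), ¬ 𝔪 ≤ v.asIdeal → ψ v ≠ 0) (h𝔞 : 𝔞 ≠ ⊥)
    (hcop : IsCoprime 𝔞 𝔪) : rayClassCoeff 𝔪 ψ 𝔞 ≠ 0 := by
  classical
  rw [rayClassCoeff, if_pos ⟨h𝔞, hcop⟩, idealPow]
  refine finprod_induction (fun z : ℂ => z ≠ 0) one_ne_zero (fun _ _ => mul_ne_zero) fun v => ?_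
  by_cases hc : (Associates.mk v.asIdeal).count (Associates.mk 𝔞).factors = 0
  · rw [hc, pow_zero]; exact one_ne_zero
  · refine pow_ne_zero _ (hψ0 v fun hle => ?_)
    have hdvd : v.asIdeal ∣ 𝔞 := (Associates.count_ne_zero_iff_dvd h𝔞 v.irreducible).mp hc
    have hc' : IsCoprime v.asIdeal 𝔪 := hcop.of_isCoprime_of_dvd_left hdvd
    rw [Ideal.isCoprime_iff_sup_eq, sup_eq_left.mpr hle] at hc'
    exact v.isPrime.ne_top hc'

/-- For `γ = (a b; c d) ∈ Γ₀(N)`: `N ∣ c` and `d` is prime to `N`.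
[cite: Ribet1977Nebentypus, §3 (supporting lemma)] -/
theorem dvd_and_isCoprime_of_mem_Gamma0 {N : ℕ} {γ : SL(2, ℤ)} (hγ : γ ∈ Gamma0 N) :
    (N : ℤ) ∣ (γ 1 0 : ℤ) ∧ IsCoprime (γ 1 1 : ℤ) (N : ℤ) := by
  have hc : (N : ℤ) ∣ (γ 1 0 : ℤ) := (ZMod.intCast_zmod_eq_zero_iff_dvd _ N).mp (Gamma0_mem.mp hγ)
  refine ⟨hc, ?_⟩
  obtain ⟨c', hc'⟩ := hc
  have hdet := Matrix.SpecialLinearGroup.det_coe γ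
  rw [Matrix.det_fin_two, hc'] at hdet
  exact ⟨(γ 0 0 : ℤ), -((γ 0 1 : ℤ) * c'), by linear_combination hdet⟩

/-- Only the zero ideal has norm `0`: `Σ_{N𝔞 = 0} g(𝔞) = g(0)`. [cite: Ribet1977Nebentypus, §3 (supporting lemma)] -/
theorem finsum_absNorm_zero (g : Ideal (𝓞 K) → ℂ) :
    ∑ᶠ I ∈ {I : Ideal (𝓞 K) | Ideal.absNorm I = 0}, g I = g ⊥ := by
  have hset : {I : Ideal (𝓞 K) | Ideal.absNorm I = 0} = {⊥} := by
    ext I; simp [Ideal.absNorm_eq_zero_iff]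
  rw [hset, finsum_mem_singleton]

/-- The sum over the subtype of ideals of norm `n` as a sum over the set.
[cite: Ribet1977Nebentypus, §3 (supporting lemma)] -/
theorem finsum_subtype_absNorm_eq (g : Ideal (𝓞 K) → ℂ) (n : ℕ) :
    ∑ᶠ J : {J : Ideal (𝓞 K) // Ideal.absNorm J = n}, g J.1 =
      ∑ᶠ I ∈ {I : Ideal (𝓞 K) | Ideal.absNorm I = n}, g I :=
  finsum_set_coe_eq_finsum_mem {I : Ideal (𝓞 K) | Ideal.absNorm I = n}

end Literature.NumberTheory.EllipticCurves.ModularForms.HeckeTheta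

end Part14

/-!
## Part 15 — port of `Summits/BirchSwinnertonDyer/BirchSwinnertonDyer/Theorems/ResidualThetaTransportAtTwoHeckeThetaHigherWeightCosetIdeal.lean` (4 declarations kept)

# Coset theta series of an ideal class at weight `n + 1`: `q`-series and the law on `Γ₀(|d_K|·N𝔪)`

Declarations of this Part (verbatim port; each keeps its own docstring and citation): `dotProduct_adjugate_embedding_eq_zero`, `hasSum_iteratedDeriv_thetaCoset`, `iteratedDeriv_thetaCoset_eq_zero_of_mem`, `iteratedDeriv_thetaCoset_apply_moeb`.

Reference keys (see `references.bib` and the declarations' citations): [Ribet1977Nebentypus].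
-/

section Part15

open scoped _root_.NumberField ComplexConjugate _root_.Real _root_.MatrixGroups _root_.UpperHalfPlane
open _root_.NumberField _root_.Module _root_.Matrix _root_.Complex _root_.Filter

namespace Literature.NumberTheory.EllipticCurves.ModularForms.HeckeTheta

open Literature.Analysis.SpecialFunctions
open Literature.NumberTheory.ModularForms.BinaryTheta
open Literature.NumberTheory.Automorphic (siegelUpperHalfSpace mem_siegelUpperHalfSpace_iff)

variable {K : Type} [Field K] [NumberField K]

/-! ### Isotropy of `u = (σ bᵢ)ᵢ` for `adj B` -/

/-- **`ᵗu (adj B) u = 0`** for `u = (σ bᵢ)ᵢ` and the Gram matrix `B` with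
`B_{ij} N𝔟 = σbᵢ σ̄bⱼ + σ̄bᵢ σbⱼ`. [cite: Ribet1977Nebentypus, §3 (supporting lemma)] -/
theorem dotProduct_adjugate_embedding_eq_zero (σ : K →+* ℂ) {𝔟 : Ideal (𝓞 K)} (b : Basis (Fin 2) ℤ 𝔟)
    {B : Matrix (Fin 2) (Fin 2) ℤ}
    (hB : ∀ i j, ((B i j : ℤ) : ℂ) * ((Ideal.absNorm 𝔟 : ℕ) : ℂ) =
      σ ((b i : 𝓞 K) : K) * conj (σ ((b j : 𝓞 K) : K)) + conj (σ ((b i : 𝓞 K) : K)) * σ ((b j : 𝓞 K) : K))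
    (hN : Ideal.absNorm 𝔟 ≠ 0) :
    (fun i => σ ((b i : 𝓞 K) : K)) ⬝ᵥ ((B.map ((↑) : ℤ → ℂ)).adjugate *ᵥ fun i => σ ((b i : 𝓞 K) : K)) = 0 := by
  have hN' : ((Ideal.absNorm 𝔟 : ℕ) : ℂ) ≠ 0 := by exact_mod_cast hN
  have key : ((fun i => σ ((b i : 𝓞 K) : K)) ⬝ᵥ
      ((B.map ((↑) : ℤ → ℂ)).adjugate *ᵥ fun i => σ ((b i : 𝓞 K) : K))) * ((Ideal.absNorm 𝔟 : ℕ) : ℂ) = 0 := by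
    rw [Matrix.adjugate_fin_two]
    simp only [dotProduct, Matrix.mulVec, Fin.sum_univ_two, Matrix.of_apply, Matrix.map_apply,
      Matrix.cons_val', Matrix.cons_val_zero, Matrix.cons_val_one, Matrix.empty_val',
      Matrix.cons_val_fin_one]
    have e00 := hB 0 0
    have e01 := hB 0 1
    have e10 := hB 1 0
    have e11 := hB 1 1
    linear_combination (σ ((b 0 : 𝓞 K) : K) * σ ((b 0 : 𝓞 K) : K)) * e11
      - (σ ((b 0 : 𝓞 K) : K) * σ ((b 1 : 𝓞 K) : K)) * e01
      - (σ ((b 1 : 𝓞 K) : K) * σ ((b 0 : 𝓞 K) : K)) * e10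
      + (σ ((b 1 : 𝓞 K) : K) * σ ((b 1 : 𝓞 K) : K)) * e00
  exact (mul_eq_zero.mp key).resolve_right hN'

/-! ### The order-`n` coset theta as a `q`-series -/

/-- **`Θₙ(τ; x₀ + 𝔟) = Σ_{m ∈ ℤ²} (2πi σ(x₀ + x_m))ⁿ q^{N((x₀ + x_m))/N𝔞}`**, `u = (σ bᵢ)ᵢ`, `Im τ > 0`.
[cite: Ribet1977Nebentypus, §3 (supporting lemma)] -/
theorem hasSum_iteratedDeriv_thetaCoset (hK : finrank ℚ K = 2) [IsTotallyComplex K] (σ : K →+* ℂ)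
    {𝔞 𝔪 𝔟 : Ideal (𝓞 K)} (h𝔟 : 𝔟 = 𝔞 * 𝔪) (h𝔞 : 𝔞 ≠ ⊥) (h𝔪 : 𝔪 ≠ ⊥) (b : Basis (Fin 2) ℤ 𝔟)
    {B : Matrix (Fin 2) (Fin 2) ℤ}
    (hB : ∀ i j, ((B i j : ℤ) : ℂ) * ((Ideal.absNorm 𝔟 : ℕ) : ℂ) =
      σ ((b i : 𝓞 K) : K) * conj (σ ((b j : 𝓞 K) : K)) + conj (σ ((b i : 𝓞 K) : K)) * σ ((b j : 𝓞 K) : K))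
    (hsymm : B.IsSymm) (hpos : (B.map (Int.cast : ℤ → ℝ)).PosDef)
    {x₀ : 𝓞 K} (hx₀ : x₀ ∈ 𝔞) {k : Fin 2 → ℤ}
    (hk : ((b.equivFun.symm k : 𝔟) : 𝓞 K) = (Ideal.absNorm 𝔪 : 𝓞 K) * x₀) (n : ℕ) {τ : ℂ} (hτ : 0 < τ.im) :
    HasSum (fun m : Fin 2 → ℤ =>
        (2 * π * I * σ ((x₀ : K) + (((b.equivFun.symm m : 𝔟) : 𝓞 K) : K))) ^ n *
          cexp (2 * π * I * τ) ^
            (Ideal.absNorm (Ideal.span {x₀ + ((b.equivFun.symm m : 𝔟) : 𝓞 K)}) / Ideal.absNorm 𝔞))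
      (iteratedDeriv n (fun s : ℂ => riemannThetaChar (fun i => (k i : ℂ) / (Ideal.absNorm 𝔪 : ℕ)) 0
          ((((Ideal.absNorm 𝔪 : ℕ) : ℂ) * τ) • B.map ((↑) : ℤ → ℂ)) (s • fun i => σ ((b i : 𝓞 K) : K))) 0) := by
  have hM : Ideal.absNorm 𝔪 ≠ 0 := by rw [Ne, Ideal.absNorm_eq_zero_iff]; exact h𝔪
  have hτ' : 0 < ((((Ideal.absNorm 𝔪 : ℕ) : ℂ) * τ)).im := by
    rw [Complex.mul_im, Complex.natCast_re, Complex.natCast_im, zero_mul, add_zero]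
    exact mul_pos (by exact_mod_cast Nat.pos_of_ne_zero hM) hτ
  have hZ := smul_mem_siegelUpperHalfSpace hsymm hpos hτ'
  obtain ⟨c, hc, hY⟩ := exists_pos_mul_sum_sq_le_of_posDef_im _ hZ.2
  have hZs : ∀ i j, (((((Ideal.absNorm 𝔪 : ℕ) : ℂ) * τ)) • B.map ((↑) : ℤ → ℂ)) i j =
      (((((Ideal.absNorm 𝔪 : ℕ) : ℂ) * τ)) • B.map ((↑) : ℤ → ℂ)) j i :=
    fun i j => (hZ.1.apply i j).symm
  have h := hasSum_iteratedDeriv_riemannThetaChar_line _ hZs hc hY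
    (fun i => (k i : ℂ) / (Ideal.absNorm 𝔪 : ℕ)) 0 (fun i => σ ((b i : 𝓞 K) : K)) n
  refine h.congr_fun fun m => ?_
  have hlin : (∑ i, ((m i : ℂ) + (k i : ℂ) / (Ideal.absNorm 𝔪 : ℕ)) * σ ((b i : 𝓞 K) : K)) =
      (((fun i => (m i : ℂ)) + fun i => (k i : ℂ) / (Ideal.absNorm 𝔪 : ℕ)) ⬝ᵥ fun i => σ ((b i : 𝓞 K) : K)) := by
    simp only [dotProduct, Pi.add_apply]
  rw [hlin, riemannThetaCharTerm_coset_eq_pow hK σ h𝔟 h𝔞 h𝔪 b hB hx₀ hk τ m,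
    dotProduct_coset_eq_embedding σ b hM hk m]

/-! ### Vanishing on the trivial coset (odd `n`) -/

omit [NumberField K] in
/-- **`Θₙ(τ; 𝔟) = 0` for odd `n`**: if `x₀ ∈ 𝔟` its characteristic `k/M` is integral,
`ϑ[k/M; 0] = ϑ[0; 0]` is even, and the odd line derivatives of an even function vanish at `0`.
[cite: Ribet1977Nebentypus, §3 (supporting lemma)] -/
theorem iteratedDeriv_thetaCoset_eq_zero_of_mem {𝔟 : Ideal (𝓞 K)} (b : Basis (Fin 2) ℤ 𝔟)
    (B : Matrix (Fin 2) (Fin 2) ℤ) {M : ℕ} (hM : M ≠ 0) {x₀ : 𝓞 K} (hx₀ : x₀ ∈ 𝔟) {k : Fin 2 → ℤ}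
    (hk : ((b.equivFun.symm k : 𝔟) : 𝓞 K) = (M : 𝓞 K) * x₀) (τ : ℂ) (u : Fin 2 → ℂ) {n : ℕ}
    (hn : Odd n) :
    iteratedDeriv n (fun s : ℂ => riemannThetaChar (fun i => (k i : ℂ) / M) 0 (τ • B.map ((↑) : ℤ → ℂ))
      (s • u)) 0 = 0 := by
  have hk0 : ((b.equivFun.symm 0 : 𝔟) : 𝓞 K) = (M : 𝓞 K) * 0 := by simp
  have hy : x₀ - 0 ∈ 𝔟 := by rw [sub_zero]; exact hx₀
  have hfun : (fun s : ℂ => riemannThetaChar (fun i => (k i : ℂ) / M) 0 (τ • B.map ((↑) : ℤ → ℂ)) (s • u)) =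
      fun s : ℂ => riemannThetaChar 0 0 (τ • B.map ((↑) : ℤ → ℂ)) (s • u) := by
    funext s
    rw [riemannThetaChar_coset_eq_of_sub_mem b hM hk0 hk hy]
    congr 1
    funext i; simp
  rw [hfun]
  exact iteratedDeriv_riemannThetaChar_zero_zero_line_eq_zero _ u hn

/-! ### The law on `Γ₀(|d_K|·M)` -/

/-- **The weight-`(n+1)` law of the order-`n` coset theta of an ideal class.**  `K` imaginary quadratic
with Kronecker character `κ` (primitive, odd, `κ² = 1`, `ζ_K = ζ·L(κ)`), `𝔟 = 𝔞𝔪` with Gram data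
`(b, B)` (`det B = |d_K|`), `M = N𝔪`, `x₀ ∈ 𝔞` with coordinates `k` of `M x₀`, `u = (σ bᵢ)ᵢ`.  For
`γ = (a b; c d) ∈ SL₂(ℤ)` with `|d_K|·M ∣ c`:
`∂ⁿ_s ϑ[d·k/M; 0](s u, (M·γτ)·B)|₀ = κ(d) (cτ+d)^{n+1} ∂ⁿ_s ϑ[k/M; 0](s u, (Mτ)·B)|₀`.
[cite: Ribet1977Nebentypus, §3 (supporting lemma)] -/
theorem iteratedDeriv_thetaCoset_apply_moeb (hK : finrank ℚ K = 2) [IsTotallyComplex K] (σ : K →+* ℂ)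
    {κ : DirichletCharacter ℂ (discr K).natAbs} (hprim : κ.IsPrimitive) (hodd : κ.Odd)
    (hquad : κ ^ 2 = 1)
    (hζ : ∀ s : ℂ, 1 < s.re → NumberField.dedekindZeta K s = riemannZeta s * LSeries (fun n => κ n) s)
    {𝔞 𝔪 𝔟 : Ideal (𝓞 K)} (h𝔟 : 𝔟 = 𝔞 * 𝔪) (h𝔞 : 𝔞 ≠ ⊥) (h𝔪 : 𝔪 ≠ ⊥) (b : Basis (Fin 2) ℤ 𝔟)
    {B : Matrix (Fin 2) (Fin 2) ℤ}
    (hB : ∀ i j, ((B i j : ℤ) : ℂ) * ((Ideal.absNorm 𝔟 : ℕ) : ℂ) =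
      σ ((b i : 𝓞 K) : K) * conj (σ ((b j : 𝓞 K) : K)) + conj (σ ((b i : 𝓞 K) : K)) * σ ((b j : 𝓞 K) : K))
    (hsymm : B.IsSymm) (h00 : Even (B 0 0)) (h11 : Even (B 1 1))
    (hdet : B.det = ((discr K).natAbs : ℤ)) (hpos : (B.map (Int.cast : ℤ → ℝ)).PosDef)
    {x₀ : 𝓞 K} (hx₀ : x₀ ∈ 𝔞) {k : Fin 2 → ℤ}
    (hk : ((b.equivFun.symm k : 𝔟) : 𝓞 K) = (Ideal.absNorm 𝔪 : 𝓞 K) * x₀)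
    {γ : SL(2, ℤ)} (hγ : (((discr K).natAbs * Ideal.absNorm 𝔪 : ℕ) : ℤ) ∣ (γ 1 0 : ℤ)) (n : ℕ) (τ : ℍ) :
    iteratedDeriv n (fun s : ℂ => riemannThetaChar
        (fun i => ((γ 1 1 : ℤ) : ℂ) * ((k i : ℂ) / (Ideal.absNorm 𝔪 : ℕ))) 0
        ((((Ideal.absNorm 𝔪 : ℕ) : ℂ) * ((γ • τ : ℍ) : ℂ)) • B.map ((↑) : ℤ → ℂ))
        (s • fun i => σ ((b i : 𝓞 K) : K))) 0 =
      κ ((γ 1 1 : ℤ) : ZMod (discr K).natAbs) *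
        (((γ 1 0 : ℤ) : ℂ) * (τ : ℂ) + ((γ 1 1 : ℤ) : ℂ)) ^ (n + 1) *
        iteratedDeriv n (fun s : ℂ => riemannThetaChar (fun i => (k i : ℂ) / (Ideal.absNorm 𝔪 : ℕ)) 0
          ((((Ideal.absNorm 𝔪 : ℕ) : ℂ) * (τ : ℂ)) • B.map ((↑) : ℤ → ℂ))
          (s • fun i => σ ((b i : 𝓞 K) : K))) 0 := by
  set M : ℕ := Ideal.absNorm 𝔪 with hMdef
  have hM : M ≠ 0 := by rw [hMdef, Ne, Ideal.absNorm_eq_zero_iff]; exact h𝔪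
  have hMpos : 0 < M := Nat.pos_of_ne_zero hM
  have h𝔟0 : 𝔟 ≠ ⊥ := by rw [h𝔟]; exact mul_ne_zero h𝔞 h𝔪
  have hN𝔟 : Ideal.absNorm 𝔟 ≠ 0 := by rw [Ne, Ideal.absNorm_eq_zero_iff]; exact h𝔟0
  haveI : NeZero (discr K).natAbs := ⟨Int.natAbs_ne_zero.mpr (NumberField.discr_ne_zero K)⟩
  -- the lift `γ'`
  have hMc : (M : ℤ) ∣ (γ 1 0 : ℤ) :=
    dvd_trans ⟨((discr K).natAbs : ℤ), by push_cast; ring⟩ hγ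
  obtain ⟨γ', h00', h01', h10', h11'⟩ := exists_levelLift M γ hMc
  have hγ'D : ((discr K).natAbs : ℤ) ∣ (γ' 1 0 : ℤ) := by
    have h : ((discr K).natAbs : ℤ) * (M : ℤ) ∣ (γ' 1 0 : ℤ) * (M : ℤ) := by
      rw [h10']; exact_mod_cast hγ
    exact Int.dvd_of_mul_dvd_mul_right (by exact_mod_cast hM) h
  have hγ'B : B.det ∣ (γ' 1 0 : ℤ) := by rw [hdet]; exact hγ'D
  -- the unit of the genus-two law, pinned by the Kronecker character
  obtain ⟨Λ, _, hfull, hnull⟩ :=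
    exists_unit_riemannThetaChar_zero_transform hsymm h00 h11 hpos hγ'B
  have hΛκ : Λ = κ ((γ' 1 1 : ℤ) : ZMod (discr K).natAbs) :=
    binaryTheta_unit_eq_kronecker hK σ (D := (discr K).natAbs) (dvd_refl _) hprim hodd hquad hζ
      h𝔟0 b hB hsymm hpos (γ := γ') hγ'D
      (fun τ => by rw [coe_sl_smul]; exact riemannThetaChar_zero_smul_transform hnull τ.im_pos)
  -- the matrix-level law along the isotropic line `u`
  have hu := dotProduct_adjugate_embedding_eq_zero σ b hB hN𝔟
  rw [iteratedDeriv_thetaCoset_smul hsymm h00 h11 hpos hMpos h00' h01' h10' h11' hγ'B hfull k hu n τ,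
    hΛκ, h11']
  -- the phase is trivial
  have hph : cexp (π * I * (((γ 0 1 : ℤ) : ℂ) * ((γ 1 1 : ℤ) : ℂ) * ((k ⬝ᵥ (B *ᵥ k) : ℤ) : ℂ) / M)) = 1 := by
    obtain ⟨n', hn'⟩ : ∃ n' : ℕ, n' = Ideal.absNorm (Ideal.span {x₀}) / Ideal.absNorm 𝔞 := ⟨_, rfl⟩
    rw [dotProduct_mulVec_coords hK σ h𝔟 h𝔞 h𝔪 b hB hx₀ hk, ← hn']
    have hM' : (M : ℂ) ≠ 0 := by exact_mod_cast hM
    have hcast : (((2 * (Ideal.absNorm 𝔪 : ℤ) * (n' : ℤ) : ℤ)) : ℂ) = 2 * (M : ℂ) * (n' : ℂ) := by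
      rw [hMdef]; push_cast; ring
    rw [hcast, show π * I * (((γ 0 1 : ℤ) : ℂ) * ((γ 1 1 : ℤ) : ℂ) * (2 * (M : ℂ) * (n' : ℂ)) / M) =
        (((γ 0 1 : ℤ) * (γ 1 1 : ℤ) * (n' : ℤ) : ℤ) : ℂ) * (2 * π * I) by push_cast; field_simp]
    exact Complex.exp_int_mul_two_pi_mul_I _
  rw [hph, mul_one]

end Literature.NumberTheory.EllipticCurves.ModularForms.HeckeTheta

end Part15

/-!
## Part 16 — port of `Summits/BirchSwinnertonDyer/BirchSwinnertonDyer/Theorems/ResidualThetaTransportAtTwoHeckeThetaHigherWeightClass.lean` (3 declarations kept)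

# The order-`n` Hecke theta series of one ideal class: the law with character `κ(d)χₙ(d)`

Declarations of this Part (verbatim port; each keeps its own docstring and citation): `chiPow_periodic`, `chiPow_mul`, `classThetaPow_moeb`.

Reference keys (see `references.bib` and the declarations' citations): [Ribet1977Nebentypus].
-/

section Part16

open scoped _root_.NumberField ComplexConjugate _root_.Real _root_.MatrixGroups _root_.UpperHalfPlane
open _root_.NumberField _root_.Module _root_.Matrix _root_.Complex _root_.Filter _root_.IsDedekindDomain

namespace Literature.NumberTheory.EllipticCurves.ModularForms.HeckeTheta

open Literature.Analysis.SpecialFunctions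
open Literature.NumberTheory.ModularForms.BinaryTheta
open Literature.NumberTheory.Automorphic (siegelUpperHalfSpace mem_siegelUpperHalfSpace_iff)
open Literature.NumberTheory.LFunctions (idealPow rayClassCoeff)
open Literature.NumberTheory.EllipticCurves.ModularForms (rayClassCoeff_mul_of_ne_bot)

variable {K : Type} [Field K] [NumberField K]

/-! ### The character `χₙ(x) = ψ̃_𝔪((x))/σ(x)ⁿ` -/

/-- **`𝔪`-periodicity of `χₙ`**: for nonzero `x, x'` with `x - x' ∈ 𝔪`,
`ψ̃_𝔪((x))/σ(x)ⁿ = ψ̃_𝔪((x'))/σ(x')ⁿ` (the weight-`(n+1)` Größencharakter relation when `(x') + 𝔪 = 1`;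
both sides vanish otherwise). [cite: Ribet1977Nebentypus, §3 (supporting lemma)] -/
theorem chiPow_periodic (σ : K →+* ℂ) {𝔪 : Ideal (𝓞 K)} {ψ : HeightOneSpectrum (𝓞 K) → ℂ} {n : ℕ}
    (hψ : ∀ b c : 𝓞 K, b ≠ 0 → c ≠ 0 → IsCoprime (Ideal.span {c}) 𝔪 → b - c ∈ 𝔪 →
      idealPow K ψ (Ideal.span {b}) = idealPow K ψ (Ideal.span {c}) * σ ((b : K) / c) ^ n)
    {x x' : 𝓞 K} (hx : x ≠ 0) (hx' : x' ≠ 0) (hxx' : x - x' ∈ 𝔪) :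
    rayClassCoeff 𝔪 ψ (Ideal.span {x}) / σ (x : K) ^ n =
      rayClassCoeff 𝔪 ψ (Ideal.span {x'}) / σ (x' : K) ^ n := by
  classical
  have hσx : σ (x : K) ≠ 0 := by
    rw [map_ne_zero]; exact_mod_cast hx
  have hσx' : σ (x' : K) ≠ 0 := by
    rw [map_ne_zero]; exact_mod_cast hx'
  have hsx : Ideal.span {x} ≠ ⊥ := by rw [Ne, Ideal.span_singleton_eq_bot]; exact hx
  have hsx' : Ideal.span {x'} ≠ ⊥ := by rw [Ne, Ideal.span_singleton_eq_bot]; exact hx'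
  -- coprimality is the same for `x` and `x'`
  have hiff : ∀ {y y' : 𝓞 K}, y - y' ∈ 𝔪 → IsCoprime (Ideal.span {y'}) 𝔪 → IsCoprime (Ideal.span {y}) 𝔪 := by
    intro y y' h hc
    rw [Ideal.isCoprime_iff_sup_eq] at hc ⊢
    rw [eq_top_iff, ← hc, sup_le_iff]
    refine ⟨?_, le_sup_right⟩
    rw [Ideal.span_singleton_le_iff_mem]
    have : y' = y - (y - y') := by ring
    rw [this]
    exact Ideal.sub_mem _ (Ideal.mem_sup_left (Ideal.mem_span_singleton_self y))
      (Ideal.mem_sup_right h)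
  by_cases hc : IsCoprime (Ideal.span {x'}) 𝔪
  · have hc2 : IsCoprime (Ideal.span {x}) 𝔪 := hiff hxx' hc
    rw [rayClassCoeff, if_pos ⟨hsx, hc2⟩, rayClassCoeff, if_pos ⟨hsx', hc⟩, hψ x x' hx hx' hc hxx',
      map_div₀, div_pow]
    field_simp
  · have hc2 : ¬ IsCoprime (Ideal.span {x}) 𝔪 := fun h => hc (hiff (by
      have : x' - x = -(x - x') := by ring
      rw [this]; exact 𝔪.neg_mem hxx') h)
    rw [rayClassCoeff, if_neg (not_and.mpr fun _ => hc2), rayClassCoeff,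
      if_neg (not_and.mpr fun _ => hc), zero_div, zero_div]

/-- **Multiplicativity of `χₙ`** on nonzero elements: `χₙ(x y) = χₙ(x) χₙ(y)`.
[cite: Ribet1977Nebentypus, §3 (supporting lemma)] -/
theorem chiPow_mul (σ : K →+* ℂ) (𝔪 : Ideal (𝓞 K)) (ψ : HeightOneSpectrum (𝓞 K) → ℂ) (n : ℕ)
    {x y : 𝓞 K} (hx : x ≠ 0) (hy : y ≠ 0) :
    rayClassCoeff 𝔪 ψ (Ideal.span {x * y}) / σ ((x * y : 𝓞 K) : K) ^ n =
      (rayClassCoeff 𝔪 ψ (Ideal.span {x}) / σ (x : K) ^ n) *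
        (rayClassCoeff 𝔪 ψ (Ideal.span {y}) / σ (y : K) ^ n) := by
  have hsx : Ideal.span {x} ≠ ⊥ := by rw [Ne, Ideal.span_singleton_eq_bot]; exact hx
  have hsy : Ideal.span {y} ≠ ⊥ := by rw [Ne, Ideal.span_singleton_eq_bot]; exact hy
  rw [← Ideal.span_singleton_mul_span_singleton, rayClassCoeff_mul_of_ne_bot 𝔪 ψ hsx hsy]
  push_cast
  rw [map_mul, mul_pow, mul_div_mul_comm]

/-! ### The class theta series and its law -/

/-- **The law of the order-`n` class theta series `F_𝔞(τ) = Σ_{x₀ ∈ 𝔞/𝔟} χₙ(x₀) Θₙ(τ; x₀ + 𝔟)` on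
`Γ₀(|d_K|·M)`** (`n` odd): `F_𝔞(γτ) = κ(d) χₙ(d) (cτ+d)^{n+1} F_𝔞(τ)` for `γ = (a b; c d)` with
`|d_K|·M ∣ c`.  Here `Θₙ` is any function agreeing on `𝔞` with the order-`n` coset theta of
`…HigherWeightCosetIdeal` and vanishing off `𝔞`, `ρ` any choice of representatives of `𝓞 K/𝔟`, and
`χₙ(x) = ψ̃_𝔪((x))/σ(x)ⁿ`.  Same proof as the weight-two `classTheta_moeb`.
[cite: Ribet1977Nebentypus, §3 (supporting lemma)] -/
theorem classThetaPow_moeb (hK : finrank ℚ K = 2) [IsTotallyComplex K] (σ : K →+* ℂ)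
    {κ : DirichletCharacter ℂ (discr K).natAbs} (hprim : κ.IsPrimitive) (hodd : κ.Odd)
    (hquad : κ ^ 2 = 1)
    (hζ : ∀ s : ℂ, 1 < s.re → NumberField.dedekindZeta K s = riemannZeta s * LSeries (fun n => κ n) s)
    {𝔪 : Ideal (𝓞 K)} (h𝔪 : 𝔪 ≠ ⊥) {ψ : HeightOneSpectrum (𝓞 K) → ℂ} {n : ℕ} (hn : Odd n)
    (hψ : ∀ b c : 𝓞 K, b ≠ 0 → c ≠ 0 → IsCoprime (Ideal.span {c}) 𝔪 → b - c ∈ 𝔪 →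
      idealPow K ψ (Ideal.span {b}) = idealPow K ψ (Ideal.span {c}) * σ ((b : K) / c) ^ n)
    {𝔞 𝔟 : Ideal (𝓞 K)} (h𝔟 : 𝔟 = 𝔞 * 𝔪) (h𝔞 : 𝔞 ≠ ⊥) (b : Basis (Fin 2) ℤ 𝔟)
    {B : Matrix (Fin 2) (Fin 2) ℤ}
    (hB : ∀ i j, ((B i j : ℤ) : ℂ) * ((Ideal.absNorm 𝔟 : ℕ) : ℂ) =
      σ ((b i : 𝓞 K) : K) * conj (σ ((b j : 𝓞 K) : K)) + conj (σ ((b i : 𝓞 K) : K)) * σ ((b j : 𝓞 K) : K))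
    (hsymm : B.IsSymm) (h00 : Even (B 0 0)) (h11 : Even (B 1 1))
    (hdet : B.det = ((discr K).natAbs : ℤ)) (hpos : (B.map (Int.cast : ℤ → ℝ)).PosDef)
    (Θ : 𝓞 K → ℍ → ℂ)
    (hΘ : ∀ x₀ ∈ 𝔞, ∀ k : Fin 2 → ℤ, ((b.equivFun.symm k : 𝔟) : 𝓞 K) = (Ideal.absNorm 𝔪 : 𝓞 K) * x₀ →
      ∀ τ : ℍ, Θ x₀ τ = iteratedDeriv n (fun s : ℂ => riemannThetaChar
        (fun i => (k i : ℂ) / (Ideal.absNorm 𝔪 : ℕ)) 0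
        ((((Ideal.absNorm 𝔪 : ℕ) : ℂ) * (τ : ℂ)) • B.map ((↑) : ℤ → ℂ))
        (s • fun i => σ ((b i : 𝓞 K) : K))) 0)
    (hΘ0 : ∀ x₀, x₀ ∉ 𝔞 → ∀ τ : ℍ, Θ x₀ τ = 0)
    (ρ : 𝓞 K ⧸ 𝔟 → 𝓞 K) (hρ : ∀ q, Ideal.Quotient.mk 𝔟 (ρ q) = q) [Fintype (𝓞 K ⧸ 𝔟)]
    (F : ℍ → ℂ)
    (hF : ∀ τ, F τ = ∑ q : 𝓞 K ⧸ 𝔟,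
      rayClassCoeff 𝔪 ψ (Ideal.span {ρ q}) / σ (ρ q : K) ^ n * Θ (ρ q) τ)
    {γ : SL(2, ℤ)} (hγ : (((discr K).natAbs * Ideal.absNorm 𝔪 : ℕ) : ℤ) ∣ (γ 1 0 : ℤ)) (τ : ℍ) :
    F (γ • τ) = κ ((γ 1 1 : ℤ) : ZMod (discr K).natAbs) *
      (rayClassCoeff 𝔪 ψ (Ideal.span {((γ 1 1 : ℤ) : 𝓞 K)}) / σ (((γ 1 1 : ℤ) : 𝓞 K) : K) ^ n) *
      (((γ 1 0 : ℤ) : ℂ) * (τ : ℂ) + ((γ 1 1 : ℤ) : ℂ)) ^ (n + 1) * F τ := by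
  classical
  set M : ℕ := Ideal.absNorm 𝔪 with hMdef
  have hM : M ≠ 0 := by rw [hMdef, Ne, Ideal.absNorm_eq_zero_iff]; exact h𝔪
  have hMpos : 0 < M := Nat.pos_of_ne_zero hM
  have h𝔟𝔞 : 𝔟 ≤ 𝔞 := by rw [h𝔟]; exact Ideal.mul_le_right
  have h𝔟𝔪 : 𝔟 ≤ 𝔪 := by rw [h𝔟]; exact Ideal.mul_le_left
  -- entries of `γ`
  have hdetγ := Matrix.SpecialLinearGroup.det_coe γ
  rw [Matrix.det_fin_two] at hdetγ
  have hMc : (M : ℤ) ∣ (γ 1 0 : ℤ) := dvd_trans ⟨((discr K).natAbs : ℤ), by push_cast; ring⟩ hγ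
  obtain ⟨c', hc'⟩ := hMc
  -- `c x₀ ∈ 𝔟` for `x₀ ∈ 𝔞`
  have hcx : ∀ x₀ ∈ 𝔞, ((γ 1 0 : ℤ) : 𝓞 K) * x₀ ∈ 𝔟 := by
    intro x₀ hx₀
    rw [hc', Int.cast_mul, Int.cast_natCast, mul_comm (M : 𝓞 K), mul_assoc, h𝔟, mul_comm 𝔞]
    exact Ideal.mul_mem_left _ _ (Ideal.mul_mem_mul (Ideal.absNorm_mem 𝔪) hx₀)
  -- membership in `𝔞̄ = 𝔞/𝔟`
  set S : Finset (𝓞 K ⧸ 𝔟) := Finset.univ.filter fun q => q ∈ 𝔞.map (Ideal.Quotient.mk 𝔟) with hS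
  have hmemS : ∀ q, q ∈ S ↔ ρ q ∈ 𝔞 := by
    intro q
    rw [hS, Finset.mem_filter, ← Ideal.mem_quotient_iff_mem h𝔟𝔞, hρ]
    simp
  -- the reindexing maps
  set ia : 𝓞 K ⧸ 𝔟 → 𝓞 K ⧸ 𝔟 := fun q => Ideal.Quotient.mk 𝔟 ((γ 0 0 : ℤ) : 𝓞 K) * q with hia
  set jd : 𝓞 K ⧸ 𝔟 → 𝓞 K ⧸ 𝔟 := fun q => Ideal.Quotient.mk 𝔟 ((γ 1 1 : ℤ) : 𝓞 K) * q with hjd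
  have hbc : ∀ q ∈ S, Ideal.Quotient.mk 𝔟 (((γ 0 1 : ℤ) : 𝓞 K) * ((γ 1 0 : ℤ) : 𝓞 K)) * q = 0 := by
    intro q hq
    rw [← hρ q, ← map_mul, Ideal.Quotient.eq_zero_iff_mem, mul_assoc]
    exact Ideal.mul_mem_left _ _ (hcx _ ((hmemS q).mp hq))
  have had : Ideal.Quotient.mk 𝔟 ((γ 1 1 : ℤ) : 𝓞 K) * Ideal.Quotient.mk 𝔟 ((γ 0 0 : ℤ) : 𝓞 K) =
      1 + Ideal.Quotient.mk 𝔟 (((γ 0 1 : ℤ) : 𝓞 K) * ((γ 1 0 : ℤ) : 𝓞 K)) := by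
    rw [← map_mul, ← (Ideal.Quotient.mk 𝔟).map_one, ← map_add]
    congr 1
    have h := congrArg (fun z : ℤ => (z : 𝓞 K)) hdetγ
    push_cast at h
    linear_combination h
  have hS_ia : ∀ q ∈ S, ia q ∈ S := by
    intro q hq
    rw [hS, Finset.mem_filter] at hq ⊢
    exact ⟨Finset.mem_univ _, Ideal.mul_mem_left _ _ hq.2⟩
  have hS_jd : ∀ q ∈ S, jd q ∈ S := by
    intro q hq
    rw [hS, Finset.mem_filter] at hq ⊢
    exact ⟨Finset.mem_univ _, Ideal.mul_mem_left _ _ hq.2⟩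
  have hji : ∀ q ∈ S, jd (ia q) = q := by
    intro q hq
    simp only [hia, hjd]
    rw [← mul_assoc, had, add_mul, one_mul, hbc q hq, add_zero]
  have hij : ∀ q ∈ S, ia (jd q) = q := by
    intro q hq
    simp only [hia, hjd]
    rw [← mul_assoc, mul_comm (Ideal.Quotient.mk 𝔟 ((γ 0 0 : ℤ) : 𝓞 K)), had, add_mul, one_mul,
      hbc q hq, add_zero]
  -- the summand and its vanishing off `S`
  set g : 𝓞 K ⧸ 𝔟 → ℍ → ℂ := fun q τ' =>
    rayClassCoeff 𝔪 ψ (Ideal.span {ρ q}) / σ (ρ q : K) ^ n * Θ (ρ q) τ' with hg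
  have hg0 : ∀ τ' : ℍ, ∀ q, q ∉ S → g q τ' = 0 := by
    intro τ' q hq
    rw [hmemS] at hq
    simp only [hg, hΘ0 _ hq τ', mul_zero]
  have hsumS : ∀ τ' : ℍ, F τ' = ∑ q ∈ S, g q τ' := by
    intro τ'
    rw [hF τ', ← Finset.sum_filter_of_ne (p := fun q => q ∈ 𝔞.map (Ideal.Quotient.mk 𝔟))]
    intro q _ hne
    by_contra hq
    exact hne (hg0 τ' q (by rw [hS, Finset.mem_filter]; exact fun h => hq h.2))
  -- the constant
  set K₀ : ℂ := κ ((γ 1 1 : ℤ) : ZMod (discr K).natAbs) *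
      (rayClassCoeff 𝔪 ψ (Ideal.span {((γ 1 1 : ℤ) : 𝓞 K)}) / σ (((γ 1 1 : ℤ) : 𝓞 K) : K) ^ n) *
      (((γ 1 0 : ℤ) : ℂ) * (τ : ℂ) + ((γ 1 1 : ℤ) : ℂ)) ^ (n + 1) with hK₀
  -- termwise identity
  have hterm : ∀ q ∈ S, g q (γ • τ) = K₀ * g (ia q) τ := by
    intro q hq
    have hx₀ : ρ q ∈ 𝔞 := (hmemS q).mp hq
    have hx₁ : ρ (ia q) ∈ 𝔞 := (hmemS _).mp (hS_ia q hq)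
    -- `d x₁ ≡ x₀ mod 𝔟`
    have hsub : ((γ 1 1 : ℤ) : 𝓞 K) * ρ (ia q) - ρ q ∈ 𝔟 := by
      rw [← Ideal.Quotient.eq, map_mul, hρ, hρ]
      exact hji q hq
    obtain ⟨k₀, hk₀⟩ := exists_coords h𝔟 b hx₀
    obtain ⟨k₁, hk₁⟩ := exists_coords h𝔟 b hx₁
    have hk₁' := coe_equivFun_symm_intCast_mul b hk₁ (γ 1 1 : ℤ)
    by_cases hq0 : q = 0
    · -- both representatives lie in `𝔟`: both theta values vanish
      have hx₀𝔟 : ρ q ∈ 𝔟 := by rw [← Ideal.Quotient.eq_zero_iff_mem, hρ]; exact hq0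
      have hia0 : ia q = 0 := by simp only [hia, hq0, mul_zero]
      have hx₁𝔟 : ρ (ia q) ∈ 𝔟 := by rw [← Ideal.Quotient.eq_zero_iff_mem, hρ]; exact hia0
      have h1 : Θ (ρ q) (γ • τ) = 0 := by
        rw [hΘ _ hx₀ k₀ hk₀]
        exact iteratedDeriv_thetaCoset_eq_zero_of_mem b B hM hx₀𝔟 hk₀ _ _ hn
      have h2 : Θ (ρ (ia q)) τ = 0 := by
        rw [hΘ _ hx₁ k₁ hk₁]
        exact iteratedDeriv_thetaCoset_eq_zero_of_mem b B hM hx₁𝔟 hk₁ _ _ hn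
      simp only [hg, h1, h2, mul_zero]
    · -- nonzero representatives
      have hx₀0 : ρ q ≠ 0 := by
        intro h; apply hq0; rw [← hρ q, h, map_zero]
      have hdx₁0 : ((γ 1 1 : ℤ) : 𝓞 K) * ρ (ia q) ≠ 0 := by
        intro h; apply hq0
        rw [← hji q hq]
        simp only [hjd]
        rw [← hρ (ia q), ← map_mul, h, map_zero]
      have hd0 : ((γ 1 1 : ℤ) : 𝓞 K) ≠ 0 := left_ne_zero_of_mul hdx₁0
      have hx₁0 : ρ (ia q) ≠ 0 := right_ne_zero_of_mul hdx₁0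
      -- theta side
      have hT : Θ (ρ q) (γ • τ) = κ ((γ 1 1 : ℤ) : ZMod (discr K).natAbs) *
          (((γ 1 0 : ℤ) : ℂ) * (τ : ℂ) + ((γ 1 1 : ℤ) : ℂ)) ^ (n + 1) * Θ (ρ (ia q)) τ := by
        rw [hΘ _ hx₀ k₀ hk₀, hΘ _ hx₁ k₁ hk₁,
          ← iteratedDeriv_thetaCoset_apply_moeb hK σ hprim hodd hquad hζ h𝔟 h𝔞 h𝔪 b hB hsymm h00 h11
            hdet hpos hx₁ hk₁ hγ n τ]
        have hchar : (fun i => ((γ 1 1 : ℤ) : ℂ) * ((k₁ i : ℂ) / (Ideal.absNorm 𝔪 : ℕ))) =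
            fun i => (((fun i => (γ 1 1 : ℤ) * k₁ i) i : ℤ) : ℂ) / M := by
          funext i; push_cast; ring
        rw [hchar]
        congr 2
        funext s
        exact (riemannThetaChar_coset_eq_of_sub_mem b hM hk₀ hk₁' hsub _ _).symm
      -- character side
      have hC : rayClassCoeff 𝔪 ψ (Ideal.span {ρ q}) / σ (ρ q : K) ^ n =
          (rayClassCoeff 𝔪 ψ (Ideal.span {((γ 1 1 : ℤ) : 𝓞 K)}) / σ (((γ 1 1 : ℤ) : 𝓞 K) : K) ^ n) *
            (rayClassCoeff 𝔪 ψ (Ideal.span {ρ (ia q)}) / σ (ρ (ia q) : K) ^ n) := by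
        rw [← chiPow_mul σ 𝔪 ψ n hd0 hx₁0]
        refine chiPow_periodic σ hψ hx₀0 hdx₁0 (h𝔟𝔪 ?_)
        have : ρ q - ((γ 1 1 : ℤ) : 𝓞 K) * ρ (ia q) = -(((γ 1 1 : ℤ) : 𝓞 K) * ρ (ia q) - ρ q) := by ring
        rw [this]; exact 𝔟.neg_mem hsub
      simp only [hg]
      rw [hT, hC, hK₀]
      ring
  -- summation
  rw [hsumS (γ • τ), hsumS τ, Finset.sum_congr rfl hterm, ← Finset.mul_sum, hK₀]
  congr 1
  exact Finset.sum_nbij' ia jd hS_ia hS_jd hji hij (fun q _ => rfl)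

end Literature.NumberTheory.EllipticCurves.ModularForms.HeckeTheta

end Part16

/-!
## Part 17 — port of `Summits/BirchSwinnertonDyer/BirchSwinnertonDyer/Theorems/ResidualThetaTransportAtTwoHeckeThetaHigherWeightNebentypus.lean` (2 declarations kept)

# The order-`n` Hecke theta series has trivial Nebentypus: `κ(d) χₙ(d) = 1` (`n` odd)

Declarations of this Part (verbatim port; each keeps its own docstring and citation): `kappa_mul_chiPow_eq_one_of_odd`, `kappa_mul_chiPow_eq_one`.

Reference keys (see `references.bib` and the declarations' citations): [Ribet1977Nebentypus].
-/

section Part17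

open scoped _root_.NumberField ComplexConjugate _root_.Real
open _root_.NumberField _root_.Module _root_.Complex _root_.IsDedekindDomain

namespace Literature.NumberTheory.EllipticCurves.ModularForms.HeckeTheta

open Literature.NumberTheory.LFunctions (idealPow rayClassCoeff)

variable {K : Type} [Field K] [NumberField K]

/-- **Odd positive `n` prime to `|d_K| M`: `κ(n) χₑ(n) = 1`**, `χₑ(n) = ψ̃_𝔪((n))/nᵉ = (d_K/n)`.
[cite: Ribet1977Nebentypus, §3 (supporting lemma)] -/
theorem kappa_mul_chiPow_eq_one_of_odd (σ : K →+* ℂ)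
    {κ : DirichletCharacter ℂ (discr K).natAbs} (hκJ : ∀ n : ℕ, Odd n → κ n = (jacobiSym (discr K) n : ℂ))
    {𝔪 : Ideal (𝓞 K)} {ψ : HeightOneSpectrum (𝓞 K) → ℂ} {e : ℕ}
    (hneb : ∀ n : ℕ, Odd n → n.Coprime ((discr K).natAbs * Ideal.absNorm 𝔪) →
      idealPow K ψ (Ideal.span {(n : 𝓞 K)}) = (jacobiSym (discr K) n : ℂ) * (n : ℂ) ^ e)
    {n : ℕ} (hodd : Odd n) (hcop : n.Coprime ((discr K).natAbs * Ideal.absNorm 𝔪)) :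
    κ n * (rayClassCoeff 𝔪 ψ (Ideal.span {((n : ℤ) : 𝓞 K)}) / σ ((((n : ℤ) : 𝓞 K)) : K) ^ e) = 1 := by
  classical
  have hn0 : n ≠ 0 := by rintro rfl; exact (Nat.not_odd_zero hodd).elim
  have hspan : Ideal.span {((n : ℤ) : 𝓞 K)} = Ideal.span {(n : 𝓞 K)} := by push_cast; rfl
  have hne : Ideal.span {(n : 𝓞 K)} ≠ ⊥ := by
    rw [Ne, Ideal.span_singleton_eq_bot]; exact_mod_cast hn0
  have hcopM : IsCoprime (Ideal.span {(n : 𝓞 K)}) 𝔪 :=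
    isCoprime_span_natCast (Nat.Coprime.coprime_mul_left_right hcop)
  rw [hspan, rayClassCoeff, if_pos ⟨hne, hcopM⟩, hneb n hodd hcop, hκJ n hodd]
  have hσ : σ ((((n : ℤ) : 𝓞 K)) : K) = (n : ℂ) := by simp
  rw [hσ, mul_div_assoc, div_self (pow_ne_zero _ (by exact_mod_cast hn0 : (n : ℂ) ≠ 0)), mul_one]
  have hgcd : (discr K).gcd (n : ℤ) = 1 := by
    have h1 : n.Coprime (discr K).natAbs := Nat.Coprime.coprime_mul_right_right hcop
    rw [Int.gcd_eq_natAbs, Int.natAbs_natCast]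
    exact Nat.Coprime.symm h1
  rcases jacobiSym.eq_one_or_neg_one hgcd with h | h <;> rw [h] <;> norm_num

/-- **Trivial Nebentypus at weight `e + 1`, `e` odd: `κ(d) χₑ(d) = 1` for every integer `d` prime to
`|d_K| M`** (`χₑ(d) = ψ̃_𝔪((d))/dᵉ`; for `d < 0` both `κ` and `χₑ` change sign, `e` being odd).
[cite: Ribet1977Nebentypus, §3 (supporting lemma)] -/
theorem kappa_mul_chiPow_eq_one (hK : finrank ℚ K = 2) (σ : K →+* ℂ)
    {κ : DirichletCharacter ℂ (discr K).natAbs} (hκodd : κ.Odd)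
    (hκJ : ∀ n : ℕ, Odd n → κ n = (jacobiSym (discr K) n : ℂ))
    {𝔪 : Ideal (𝓞 K)} (h𝔪 : 𝔪 ≠ ⊥) {ψ : HeightOneSpectrum (𝓞 K) → ℂ} {e : ℕ} (he : Odd e)
    (hψ : ∀ b c : 𝓞 K, b ≠ 0 → c ≠ 0 → IsCoprime (Ideal.span {c}) 𝔪 → b - c ∈ 𝔪 →
      idealPow K ψ (Ideal.span {b}) = idealPow K ψ (Ideal.span {c}) * σ ((b : K) / c) ^ e)
    (hneb : ∀ n : ℕ, Odd n → n.Coprime ((discr K).natAbs * Ideal.absNorm 𝔪) →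
      idealPow K ψ (Ideal.span {(n : 𝓞 K)}) = (jacobiSym (discr K) n : ℂ) * (n : ℂ) ^ e)
    {d : ℤ} (hd : IsCoprime d (((discr K).natAbs * Ideal.absNorm 𝔪 : ℕ) : ℤ)) :
    κ (d : ZMod (discr K).natAbs) *
      (rayClassCoeff 𝔪 ψ (Ideal.span {(d : 𝓞 K)}) / σ ((d : 𝓞 K) : K) ^ e) = 1 := by
  classical
  set M : ℕ := Ideal.absNorm 𝔪 with hMdef
  have hM : M ≠ 0 := by rw [hMdef, Ne, Ideal.absNorm_eq_zero_iff]; exact h𝔪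
  have hD3 : 2 < (discr K).natAbs := by
    have h := NumberField.abs_discr_gt_two (K := K) (by rw [hK]; norm_num)
    have : (2 : ℤ) < ((discr K).natAbs : ℤ) := by rw [Int.natCast_natAbs]; exact h
    exact_mod_cast this
  have hN1 : (discr K).natAbs * M ≠ 1 := by
    intro h
    have := Nat.eq_one_of_mul_eq_one_right h
    omega
  -- `|d_K| M ∈ 𝔪`
  have hNmem : (((((discr K).natAbs * M : ℕ) : ℤ)) : 𝓞 K) ∈ 𝔪 := by
    rw [Int.cast_natCast, Nat.cast_mul]
    exact Ideal.mul_mem_left _ _ (Ideal.absNorm_mem 𝔪)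
  -- positive integers
  have hnat : ∀ m : ℕ, m.Coprime ((discr K).natAbs * M) →
      κ ((m : ℤ) : ZMod (discr K).natAbs) *
        (rayClassCoeff 𝔪 ψ (Ideal.span {((m : ℤ) : 𝓞 K)}) / σ ((((m : ℤ) : 𝓞 K)) : K) ^ e) = 1 := by
    intro m hm
    have hm0 : m ≠ 0 := by
      rintro rfl
      exact hN1 ((Nat.coprime_zero_left _).mp hm)
    rcases Nat.even_or_odd m with heven | hodd
    · -- `m` even: `|d_K| M` is odd, use `m' = m + |d_K| M`
      have hNodd : Odd ((discr K).natAbs * M) := by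
        rw [← Nat.not_even_iff_odd]
        intro hNe
        have h2 : 2 ∣ Nat.gcd m ((discr K).natAbs * M) :=
          Nat.dvd_gcd (even_iff_two_dvd.mp heven) (even_iff_two_dvd.mp hNe)
        rw [hm] at h2
        omega
      have hm'odd : Odd (m + (discr K).natAbs * M) := heven.add_odd hNodd
      have hm'cop : (m + (discr K).natAbs * M).Coprime ((discr K).natAbs * M) := by
        have := (Nat.coprime_add_mul_right_left m ((discr K).natAbs * M) 1).mpr hm
        simpa using this
      have h1 := kappa_mul_chiPow_eq_one_of_odd σ hκJ hneb hm'odd hm'cop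
      have hκ : κ (((m + (discr K).natAbs * M : ℕ) : ℤ) : ZMod (discr K).natAbs) =
          κ ((m : ℤ) : ZMod (discr K).natAbs) := by
        congr 1
        simp only [Nat.cast_add, Nat.cast_mul, Int.cast_add, Int.cast_mul, Int.cast_natCast,
          ZMod.natCast_self, zero_mul, add_zero]
      have hχ : rayClassCoeff 𝔪 ψ (Ideal.span {(((m + (discr K).natAbs * M : ℕ) : ℤ) : 𝓞 K)}) /
            σ (((((m + (discr K).natAbs * M : ℕ) : ℤ) : 𝓞 K)) : K) ^ e =
          rayClassCoeff 𝔪 ψ (Ideal.span {((m : ℤ) : 𝓞 K)}) / σ ((((m : ℤ) : 𝓞 K)) : K) ^ e := by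
        refine chiPow_periodic σ hψ ?_ ?_ ?_
        · exact_mod_cast hm'odd.pos.ne'
        · exact_mod_cast hm0
        · have : (((m + (discr K).natAbs * M : ℕ) : ℤ) : 𝓞 K) - ((m : ℤ) : 𝓞 K) =
              ((((discr K).natAbs * M : ℕ) : ℤ) : 𝓞 K) := by
            push_cast; ring
          rw [this]; exact hNmem
      rw [← hκ, ← hχ]
      exact_mod_cast h1
    · exact_mod_cast kappa_mul_chiPow_eq_one_of_odd σ hκJ hneb hodd hm
  -- integers
  have hgcd : Nat.Coprime d.natAbs ((discr K).natAbs * M) := by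
    have h := Int.isCoprime_iff_gcd_eq_one.mp hd
    rw [Int.gcd_eq_natAbs, Int.natAbs_natCast] at h
    exact h
  rcases Int.natAbs_eq d with h | h
  · rw [h]; exact hnat _ hgcd
  · have h1 := hnat _ hgcd
    rw [h]
    have hκneg : κ (((-(d.natAbs : ℤ) : ℤ)) : ZMod (discr K).natAbs) =
        -κ (((d.natAbs : ℤ)) : ZMod (discr K).natAbs) := by
      rw [Int.cast_neg, neg_eq_neg_one_mul (((d.natAbs : ℤ) : ZMod (discr K).natAbs)), map_mul]
      rw [show κ (-1) = -1 from hκodd]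
      ring
    have hχneg : rayClassCoeff 𝔪 ψ (Ideal.span {((-(d.natAbs : ℤ) : ℤ) : 𝓞 K)}) /
          σ ((((-(d.natAbs : ℤ) : ℤ) : 𝓞 K)) : K) ^ e =
        -(rayClassCoeff 𝔪 ψ (Ideal.span {((d.natAbs : ℤ) : 𝓞 K)}) / σ ((((d.natAbs : ℤ) : 𝓞 K)) : K) ^ e) := by
      rw [Int.cast_neg, Ideal.span_singleton_neg]
      push_cast
      rw [map_neg, he.neg_pow, div_neg]
    rw [hκneg, hχneg]
    linear_combination h1

end Literature.NumberTheory.EllipticCurves.ModularForms.HeckeTheta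

end Part17

/-!
## Part 18 — port of `Summits/BirchSwinnertonDyer/BirchSwinnertonDyer/Theorems/ResidualThetaTransportAtTwoHeckeThetaHigherWeightClassSeries.lean` (4 declarations kept)

# The order-`e` class theta series: membership in the theta span `Vₑ` and its `q`-series

Declarations of this Part (verbatim port; each keeps its own docstring and citation): `classThetaPow_mem_span`, `chiPow_mul_embedding_pow_eq`, `hasSum_classThetaPow`, `hasSum_classThetaPow_nat`.

Reference keys (see `references.bib` and the declarations' citations): [Ribet1977Nebentypus].
-/

section Part18

open scoped _root_.NumberField ComplexConjugate _root_.Real _root_.MatrixGroups _root_.UpperHalfPlane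
open _root_.NumberField _root_.Module _root_.Matrix _root_.Complex _root_.Filter _root_.IsDedekindDomain

namespace Literature.NumberTheory.EllipticCurves.ModularForms.HeckeTheta

open Literature.Analysis.SpecialFunctions
open Literature.NumberTheory.ModularForms.BinaryTheta
open Literature.NumberTheory.Automorphic (siegelUpperHalfSpace mem_siegelUpperHalfSpace_iff)
open Literature.NumberTheory.LFunctions (idealPow rayClassCoeff)

variable {K : Type} [Field K] [NumberField K]

/-! ### The class theta series lies in the theta span -/

/-- **`F_𝔞 ∈ Vₑ`**, the span of the order-`e` theta line derivatives on rational isotropic lines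
(`Literature…BinaryThetaHigherWeightSpan`). [cite: Ribet1977Nebentypus, §3 (supporting lemma)] -/
theorem classThetaPow_mem_span (σ : K →+* ℂ) {𝔪 : Ideal (𝓞 K)} (h𝔪 : 𝔪 ≠ ⊥)
    (ψ : HeightOneSpectrum (𝓞 K) → ℂ) (e : ℕ)
    {𝔞 𝔟 : Ideal (𝓞 K)} (h𝔟 : 𝔟 = 𝔞 * 𝔪) (b : Basis (Fin 2) ℤ 𝔟)
    {B : Matrix (Fin 2) (Fin 2) ℤ} (hsymm : B.IsSymm) (hpos : (B.map (Int.cast : ℤ → ℝ)).PosDef)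
    (hu : (fun i => σ ((b i : 𝓞 K) : K)) ⬝ᵥ ((B.map ((↑) : ℤ → ℂ)).adjugate *ᵥ
      fun i => σ ((b i : 𝓞 K) : K)) = 0)
    (Θ : 𝓞 K → ℍ → ℂ)
    (hΘ : ∀ x₀ ∈ 𝔞, ∀ k : Fin 2 → ℤ, ((b.equivFun.symm k : 𝔟) : 𝓞 K) = (Ideal.absNorm 𝔪 : 𝓞 K) * x₀ →
      ∀ τ : ℍ, Θ x₀ τ = iteratedDeriv e (fun s : ℂ => riemannThetaChar
        (fun i => (k i : ℂ) / (Ideal.absNorm 𝔪 : ℕ)) 0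
        ((((Ideal.absNorm 𝔪 : ℕ) : ℂ) * (τ : ℂ)) • B.map ((↑) : ℤ → ℂ))
        (s • fun i => σ ((b i : 𝓞 K) : K))) 0)
    (hΘ0 : ∀ x₀, x₀ ∉ 𝔞 → ∀ τ : ℍ, Θ x₀ τ = 0)
    (ρ : 𝓞 K ⧸ 𝔟 → 𝓞 K) [Fintype (𝓞 K ⧸ 𝔟)] (F : ℍ → ℂ)
    (hF : ∀ τ, F τ = ∑ q : 𝓞 K ⧸ 𝔟,
      rayClassCoeff 𝔪 ψ (Ideal.span {ρ q}) / σ (ρ q : K) ^ e * Θ (ρ q) τ) :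
    F ∈ Submodule.span ℂ {F : ℍ → ℂ | ∃ (P : Matrix (Fin 2) (Fin 2) ℚ), P.IsSymm ∧
        (P.map (Rat.cast : ℚ → ℝ)).PosDef ∧ ∃ (a b : Fin 2 → ℚ) (u : Fin 2 → ℂ),
          u ⬝ᵥ ((P.map (Rat.cast : ℚ → ℂ)).adjugate *ᵥ u) = 0 ∧ F = fun τ : ℍ =>
            iteratedDeriv e (fun s : ℂ => riemannThetaChar (fun i => (a i : ℂ)) (fun i => (b i : ℂ))
              ((τ : ℂ) • P.map (Rat.cast : ℚ → ℂ)) (s • u)) 0} := by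
  set M : ℕ := Ideal.absNorm 𝔪 with hMdef
  have hM : M ≠ 0 := by rw [hMdef, Ne, Ideal.absNorm_eq_zero_iff]; exact h𝔪
  -- the rational line matrix `M B`
  set P : Matrix (Fin 2) (Fin 2) ℚ := (M : ℚ) • B.map (Int.cast : ℤ → ℚ) with hP
  have hPs : P.IsSymm := (hsymm.map _).smul _
  have hPpos : (P.map (Rat.cast : ℚ → ℝ)).PosDef := by
    have : P.map (Rat.cast : ℚ → ℝ) = (M : ℝ) • B.map (Int.cast : ℤ → ℝ) := by
      ext i j; simp [hP]
    rw [this]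
    exact hpos.smul (by exact_mod_cast Nat.pos_of_ne_zero hM)
  have hPc : ∀ τ : ℂ, (((M : ℕ) : ℂ) * τ) • B.map ((↑) : ℤ → ℂ) = τ • P.map (Rat.cast : ℚ → ℂ) := by
    intro τ; ext i j; simp [hP]; ring
  have hFeq : F = ∑ q : 𝓞 K ⧸ 𝔟,
      (rayClassCoeff 𝔪 ψ (Ideal.span {ρ q}) / σ (ρ q : K) ^ e) • fun τ => Θ (ρ q) τ := by
    funext τ; rw [hF τ]; simp [Finset.sum_apply]
  rw [hFeq]
  refine Submodule.sum_mem _ fun q _ => Submodule.smul_mem _ _ ?_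
  by_cases hq : ρ q ∈ 𝔞
  · obtain ⟨k, hk⟩ := exists_coords h𝔟 b hq
    have hPmap : P.map (Rat.cast : ℚ → ℂ) = ((M : ℕ) : ℂ) • B.map ((↑) : ℤ → ℂ) := by
      ext i j; simp [hP]
    have hu' : (fun i => σ ((b i : 𝓞 K) : K)) ⬝ᵥ ((P.map (Rat.cast : ℚ → ℂ)).adjugate *ᵥ
        fun i => σ ((b i : 𝓞 K) : K)) = 0 := by
      rw [hPmap, Matrix.adjugate_smul, Fintype.card_fin, Matrix.smul_mulVec, dotProduct_smul, hu,
        smul_zero]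
    have hfun : (fun τ : ℍ => Θ (ρ q) τ) = fun τ : ℍ => iteratedDeriv e (fun s : ℂ => riemannThetaChar
        (fun i => (((k i : ℚ) / M : ℚ) : ℂ)) (fun i => ((0 : ℚ) : ℂ))
        ((τ : ℂ) • P.map (Rat.cast : ℚ → ℂ)) (s • fun i => σ ((b i : 𝓞 K) : K))) 0 := by
      funext τ
      rw [hΘ _ hq k hk τ, hPc]
      have h1 : (fun i => (((k i : ℚ) / M : ℚ) : ℂ)) = fun i => (k i : ℂ) / (M : ℕ) := by
        funext i; push_cast; rfl
      have h2 : (fun _ : Fin 2 => ((0 : ℚ) : ℂ)) = (0 : Fin 2 → ℂ) := by funext i; simp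
      rw [h1, h2]
    rw [hfun]
    exact Submodule.subset_span ⟨P, hPs, hPpos, fun i => (k i : ℚ) / M, fun _ => 0, _, hu', rfl⟩
  · have hfun : (fun τ : ℍ => Θ (ρ q) τ) = 0 := by funext τ; exact hΘ0 _ hq τ
    rw [hfun]; exact Submodule.zero_mem _

/-! ### The `q`-series of the class theta series -/

/-- On a coset `x₀ + 𝔟 ⊆ 𝔞` (`𝔪 ≠ 1`, `e ≥ 1`): `χₑ(x₀) σ(x)ᵉ = ψ̃_𝔪((x))`.
[cite: Ribet1977Nebentypus, §3 (supporting lemma)] -/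
theorem chiPow_mul_embedding_pow_eq (σ : K →+* ℂ) {𝔪 : Ideal (𝓞 K)} (h𝔪1 : 𝔪 ≠ ⊤)
    {ψ : HeightOneSpectrum (𝓞 K) → ℂ} {e : ℕ} (he0 : e ≠ 0)
    (hψ : ∀ b c : 𝓞 K, b ≠ 0 → c ≠ 0 → IsCoprime (Ideal.span {c}) 𝔪 → b - c ∈ 𝔪 →
      idealPow K ψ (Ideal.span {b}) = idealPow K ψ (Ideal.span {c}) * σ ((b : K) / c) ^ e)
    {𝔟 : Ideal (𝓞 K)} (h𝔟𝔪 : 𝔟 ≤ 𝔪) {x₀ x : 𝓞 K} (hx : x - x₀ ∈ 𝔟) :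
    rayClassCoeff 𝔪 ψ (Ideal.span {x₀}) / σ (x₀ : K) ^ e * σ (x : K) ^ e =
      rayClassCoeff 𝔪 ψ (Ideal.span {x}) := by
  classical
  by_cases hx0 : x = 0
  · rw [hx0]; simp [Literature.NumberTheory.LFunctions.rayClassCoeff_bot, zero_pow he0]
  by_cases hx₀0 : x₀ = 0
  · -- `x ∈ 𝔟 ⊆ 𝔪`, so `(x)` is not prime to `𝔪`
    rw [hx₀0]
    simp only [Ideal.span_singleton_zero, Literature.NumberTheory.LFunctions.rayClassCoeff_bot, map_zero,
      zero_pow he0, div_zero, zero_mul]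
    have hxm : x ∈ 𝔪 := h𝔟𝔪 (by simpa [hx₀0] using hx)
    have hnc : ¬ IsCoprime (Ideal.span {x}) 𝔪 := by
      intro hc
      rw [Ideal.isCoprime_iff_sup_eq, sup_eq_right.mpr ((Ideal.span_singleton_le_iff_mem _).mpr hxm)] at hc
      exact h𝔪1 hc
    rw [rayClassCoeff, if_neg (not_and.mpr fun _ => hnc)]
  · have hσx : σ (x : K) ^ e ≠ 0 := pow_ne_zero _ (by rw [map_ne_zero]; exact_mod_cast hx0)
    rw [← chiPow_periodic σ hψ hx0 hx₀0 (h𝔟𝔪 hx), div_mul_cancel₀ _ hσx]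

/-- **`F_𝔞(τ) = (2πi)ᵉ Σ_{x ∈ 𝔞} ψ̃_𝔪((x)) q^{N((x))/N𝔞}`** as an absolutely convergent sum over `𝔞`.
[cite: Ribet1977Nebentypus, §3 (supporting lemma)] -/
theorem hasSum_classThetaPow (hK : finrank ℚ K = 2) [IsTotallyComplex K] (σ : K →+* ℂ)
    {𝔪 : Ideal (𝓞 K)} (h𝔪 : 𝔪 ≠ ⊥) (h𝔪1 : 𝔪 ≠ ⊤) {ψ : HeightOneSpectrum (𝓞 K) → ℂ} {e : ℕ} (he0 : e ≠ 0)
    (hψ : ∀ b c : 𝓞 K, b ≠ 0 → c ≠ 0 → IsCoprime (Ideal.span {c}) 𝔪 → b - c ∈ 𝔪 →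
      idealPow K ψ (Ideal.span {b}) = idealPow K ψ (Ideal.span {c}) * σ ((b : K) / c) ^ e)
    {𝔞 𝔟 : Ideal (𝓞 K)} (h𝔟 : 𝔟 = 𝔞 * 𝔪) (h𝔞 : 𝔞 ≠ ⊥) (b : Basis (Fin 2) ℤ 𝔟)
    {B : Matrix (Fin 2) (Fin 2) ℤ}
    (hB : ∀ i j, ((B i j : ℤ) : ℂ) * ((Ideal.absNorm 𝔟 : ℕ) : ℂ) =
      σ ((b i : 𝓞 K) : K) * conj (σ ((b j : 𝓞 K) : K)) + conj (σ ((b i : 𝓞 K) : K)) * σ ((b j : 𝓞 K) : K))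
    (hsymm : B.IsSymm) (hpos : (B.map (Int.cast : ℤ → ℝ)).PosDef)
    (Θ : 𝓞 K → ℍ → ℂ)
    (hΘ : ∀ x₀ ∈ 𝔞, ∀ k : Fin 2 → ℤ, ((b.equivFun.symm k : 𝔟) : 𝓞 K) = (Ideal.absNorm 𝔪 : 𝓞 K) * x₀ →
      ∀ τ : ℍ, Θ x₀ τ = iteratedDeriv e (fun s : ℂ => riemannThetaChar
        (fun i => (k i : ℂ) / (Ideal.absNorm 𝔪 : ℕ)) 0
        ((((Ideal.absNorm 𝔪 : ℕ) : ℂ) * (τ : ℂ)) • B.map ((↑) : ℤ → ℂ))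
        (s • fun i => σ ((b i : 𝓞 K) : K))) 0)
    (hΘ0 : ∀ x₀, x₀ ∉ 𝔞 → ∀ τ : ℍ, Θ x₀ τ = 0)
    (ρ : 𝓞 K ⧸ 𝔟 → 𝓞 K) (hρ : ∀ q, Ideal.Quotient.mk 𝔟 (ρ q) = q) [Fintype (𝓞 K ⧸ 𝔟)]
    (F : ℍ → ℂ)
    (hF : ∀ τ, F τ = ∑ q : 𝓞 K ⧸ 𝔟,
      rayClassCoeff 𝔪 ψ (Ideal.span {ρ q}) / σ (ρ q : K) ^ e * Θ (ρ q) τ) (τ : ℍ) :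
    HasSum (fun x : 𝔞 => (2 * π * I) ^ e * rayClassCoeff 𝔪 ψ (Ideal.span {(x : 𝓞 K)}) *
        cexp (2 * π * I * (τ : ℂ)) ^ (Ideal.absNorm (Ideal.span {(x : 𝓞 K)}) / Ideal.absNorm 𝔞)) (F τ) := by
  classical
  set M : ℕ := Ideal.absNorm 𝔪 with hMdef
  have hM : M ≠ 0 := by rw [hMdef, Ne, Ideal.absNorm_eq_zero_iff]; exact h𝔪
  have h𝔟𝔞 : 𝔟 ≤ 𝔞 := by rw [h𝔟]; exact Ideal.mul_le_right
  have h𝔟𝔪 : 𝔟 ≤ 𝔪 := by rw [h𝔟]; exact Ideal.mul_le_left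
  obtain ⟨π₀, hπ₀⟩ : ∃ π₀ : 𝔞 → 𝓞 K ⧸ 𝔟, π₀ = fun x : 𝔞 => Ideal.Quotient.mk 𝔟 (x : 𝓞 K) := ⟨_, rfl⟩
  obtain ⟨G, hG⟩ : ∃ G : 𝔞 → ℂ, G = fun x : 𝔞 => (2 * π * I) ^ e * rayClassCoeff 𝔪 ψ (Ideal.span {(x : 𝓞 K)}) *
    cexp (2 * π * I * (τ : ℂ)) ^ (Ideal.absNorm (Ideal.span {(x : 𝓞 K)}) / Ideal.absNorm 𝔞) := ⟨_, rfl⟩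
  -- the fibre sums
  have hfib : ∀ q : 𝓞 K ⧸ 𝔟, HasSum (fun x : {x : 𝔞 // π₀ x = q} => G x.1)
      (rayClassCoeff 𝔪 ψ (Ideal.span {ρ q}) / σ (ρ q : K) ^ e * Θ (ρ q) τ) := by
    intro q
    by_cases hq : ρ q ∈ 𝔞
    · obtain ⟨k, hk⟩ := exists_coords h𝔟 b hq
      have hS := (hasSum_iteratedDeriv_thetaCoset hK σ h𝔟 h𝔞 h𝔪 b hB hsymm hpos hq hk e τ.im_pos).mul_left
        (rayClassCoeff 𝔪 ψ (Ideal.span {ρ q}) / σ (ρ q : K) ^ e)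
      rw [← hΘ _ hq k hk τ] at hS
      -- the bijection `m ↦ ρ q + x_m` onto the fibre
      have hmem : ∀ m : Fin 2 → ℤ, ρ q + ((b.equivFun.symm m : 𝔟) : 𝓞 K) ∈ 𝔞 :=
        fun m => 𝔞.add_mem hq (h𝔟𝔞 (b.equivFun.symm m).2)
      have hcls : ∀ m : Fin 2 → ℤ, π₀ ⟨_, hmem m⟩ = q := by
        intro m
        have h1 : Ideal.Quotient.mk 𝔟 (ρ q + ((b.equivFun.symm m : 𝔟) : 𝓞 K)) =
            Ideal.Quotient.mk 𝔟 (ρ q) := by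
          rw [Ideal.Quotient.mk_eq_mk_iff_sub_mem, add_sub_cancel_left]
          exact (b.equivFun.symm m).2
        simp only [hπ₀]
        rw [h1, hρ]
      have hsub : ∀ x : {x : 𝔞 // π₀ x = q}, ((x.1 : 𝓞 K) - ρ q) ∈ 𝔟 := by
        intro x
        have hx2 := x.2
        rw [show π₀ x.1 = Ideal.Quotient.mk 𝔟 (x.1 : 𝓞 K) from congrFun hπ₀ x.1] at hx2
        rw [← Ideal.Quotient.mk_eq_mk_iff_sub_mem, hρ]
        exact hx2
      set eb : (Fin 2 → ℤ) → {x : 𝔞 // π₀ x = q} := fun m => ⟨⟨_, hmem m⟩, hcls m⟩ with heb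
      have he_bij : Function.Bijective eb := by
        constructor
        · intro m m' h
          have h' : ρ q + ((b.equivFun.symm m : 𝔟) : 𝓞 K) = ρ q + ((b.equivFun.symm m' : 𝔟) : 𝓞 K) :=
            congrArg (fun z : {x : 𝔞 // π₀ x = q} => ((z.1 : 𝔞) : 𝓞 K)) h
          exact b.equivFun.symm.injective (Subtype.ext (add_left_cancel h'))
        · intro x
          refine ⟨b.equivFun ⟨(x.1 : 𝓞 K) - ρ q, hsub x⟩, ?_⟩
          apply Subtype.ext; apply Subtype.ext
          simp only [heb, LinearEquiv.symm_apply_apply]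
          ring
      have hS' : HasSum ((fun x : {x : 𝔞 // π₀ x = q} => G x.1) ∘ (Equiv.ofBijective eb he_bij))
          (rayClassCoeff 𝔪 ψ (Ideal.span {ρ q}) / σ (ρ q : K) ^ e * Θ (ρ q) τ) := by
        refine hS.congr_fun fun m => ?_
        simp only [Function.comp_apply, Equiv.ofBijective_apply, heb, hG, Submodule.coe_mk]
        rw [← chiPow_mul_embedding_pow_eq σ h𝔪1 he0 hψ h𝔟𝔪 (x₀ := ρ q)
          (x := ρ q + ((b.equivFun.symm m : 𝔟) : 𝓞 K)) (by rw [add_sub_cancel_left]; exact (b.equivFun.symm m).2)]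
        push_cast
        ring
      exact (Equiv.hasSum_iff (Equiv.ofBijective eb he_bij)).mp hS'
    · -- empty fibre
      haveI : IsEmpty {x : 𝔞 // π₀ x = q} := by
        refine ⟨fun x => hq ?_⟩
        have h1 : ((x.1 : 𝓞 K) - ρ q) ∈ 𝔟 := by
          have hx2 := x.2
          rw [show π₀ x.1 = Ideal.Quotient.mk 𝔟 (x.1 : 𝓞 K) from congrFun hπ₀ x.1] at hx2
          rw [← Ideal.Quotient.mk_eq_mk_iff_sub_mem, hρ]; exact hx2
        have : ρ q = (x.1 : 𝓞 K) - ((x.1 : 𝓞 K) - ρ q) := by ring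
        rw [this]
        exact 𝔞.sub_mem x.1.2 (h𝔟𝔞 h1)
      rw [hΘ0 _ hq τ, mul_zero]
      letI : Fintype {x : 𝔞 // π₀ x = q} := Fintype.ofIsEmpty
      have h := hasSum_fintype (fun x : {x : 𝔞 // π₀ x = q} => G x.1)
      rwa [Fintype.sum_empty] at h
  have h := hasSum_sigma_of_fintype
    (f := fun p : (Σ q : 𝓞 K ⧸ 𝔟, {x : 𝔞 // π₀ x = q}) => G p.2.1) hfib
  rw [← hF τ] at h
  have h' : HasSum G (F τ) := (Equiv.hasSum_iff (Equiv.sigmaFiberEquiv π₀)).mp h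
  rw [hG] at h'
  exact h'

/-- **The `q`-series of `F_𝔞`**: `F_𝔞(τ) = Σ_n ((2πi)ᵉ Σ_{x ∈ 𝔞, N((x)) = n N𝔞} ψ̃_𝔪((x))) qⁿ`.
[cite: Ribet1977Nebentypus, §3 (supporting lemma)] -/
theorem hasSum_classThetaPow_nat (hK : finrank ℚ K = 2) [IsTotallyComplex K] (σ : K →+* ℂ)
    {𝔪 : Ideal (𝓞 K)} (h𝔪 : 𝔪 ≠ ⊥) (h𝔪1 : 𝔪 ≠ ⊤) {ψ : HeightOneSpectrum (𝓞 K) → ℂ} {e : ℕ} (he0 : e ≠ 0)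
    (hψ : ∀ b c : 𝓞 K, b ≠ 0 → c ≠ 0 → IsCoprime (Ideal.span {c}) 𝔪 → b - c ∈ 𝔪 →
      idealPow K ψ (Ideal.span {b}) = idealPow K ψ (Ideal.span {c}) * σ ((b : K) / c) ^ e)
    {𝔞 𝔟 : Ideal (𝓞 K)} (h𝔟 : 𝔟 = 𝔞 * 𝔪) (h𝔞 : 𝔞 ≠ ⊥) (b : Basis (Fin 2) ℤ 𝔟)
    {B : Matrix (Fin 2) (Fin 2) ℤ}
    (hB : ∀ i j, ((B i j : ℤ) : ℂ) * ((Ideal.absNorm 𝔟 : ℕ) : ℂ) =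
      σ ((b i : 𝓞 K) : K) * conj (σ ((b j : 𝓞 K) : K)) + conj (σ ((b i : 𝓞 K) : K)) * σ ((b j : 𝓞 K) : K))
    (hsymm : B.IsSymm) (hpos : (B.map (Int.cast : ℤ → ℝ)).PosDef)
    (Θ : 𝓞 K → ℍ → ℂ)
    (hΘ : ∀ x₀ ∈ 𝔞, ∀ k : Fin 2 → ℤ, ((b.equivFun.symm k : 𝔟) : 𝓞 K) = (Ideal.absNorm 𝔪 : 𝓞 K) * x₀ →
      ∀ τ : ℍ, Θ x₀ τ = iteratedDeriv e (fun s : ℂ => riemannThetaChar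
        (fun i => (k i : ℂ) / (Ideal.absNorm 𝔪 : ℕ)) 0
        ((((Ideal.absNorm 𝔪 : ℕ) : ℂ) * (τ : ℂ)) • B.map ((↑) : ℤ → ℂ))
        (s • fun i => σ ((b i : 𝓞 K) : K))) 0)
    (hΘ0 : ∀ x₀, x₀ ∉ 𝔞 → ∀ τ : ℍ, Θ x₀ τ = 0)
    (ρ : 𝓞 K ⧸ 𝔟 → 𝓞 K) (hρ : ∀ q, Ideal.Quotient.mk 𝔟 (ρ q) = q) [Fintype (𝓞 K ⧸ 𝔟)]
    (F : ℍ → ℂ)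
    (hF : ∀ τ, F τ = ∑ q : 𝓞 K ⧸ 𝔟,
      rayClassCoeff 𝔪 ψ (Ideal.span {ρ q}) / σ (ρ q : K) ^ e * Θ (ρ q) τ) (τ : ℍ) :
    HasSum (fun n : ℕ => ((2 * π * I) ^ e * ∑ᶠ x : {x : 𝓞 K // x ∈ 𝔞 ∧
        Ideal.absNorm (Ideal.span {x}) = n * Ideal.absNorm 𝔞}, rayClassCoeff 𝔪 ψ (Ideal.span {x.1})) *
        cexp (2 * π * I * (τ : ℂ)) ^ n) (F τ) := by
  classical
  have hsum := hasSum_classThetaPow hK σ h𝔪 h𝔪1 he0 hψ h𝔟 h𝔞 b hB hsymm hpos Θ hΘ hΘ0 ρ hρ F hF τ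
  have hN0 : Ideal.absNorm 𝔞 ≠ 0 := by rw [Ne, Ideal.absNorm_eq_zero_iff]; exact h𝔞
  set kf : 𝔞 → ℕ := fun x => Ideal.absNorm (Ideal.span {(x : 𝓞 K)}) / Ideal.absNorm 𝔞 with hkf
  have hkf_iff : ∀ (x : 𝔞) (n : ℕ), kf x = n ↔
      Ideal.absNorm (Ideal.span {(x : 𝓞 K)}) = n * Ideal.absNorm 𝔞 := by
    intro x n
    obtain ⟨c, hc⟩ := Ideal.absNorm_dvd_absNorm_of_le ((Ideal.span_singleton_le_iff_mem _).mpr x.2)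
    rw [hkf]; simp only
    rw [hc, Nat.mul_div_cancel_left _ (Nat.pos_of_ne_zero hN0), mul_comm]
    exact ⟨fun h => by rw [h], fun h => mul_right_cancel₀ hN0 h⟩
  -- fibres of `kf` ≃ `{x ∈ 𝔞 : N((x)) = n N𝔞}`
  set g : ∀ n, {x : 𝔞 // kf x = n} →
      {x : 𝓞 K // x ∈ 𝔞 ∧ Ideal.absNorm (Ideal.span {x}) = n * Ideal.absNorm 𝔞} :=
    fun n x => ⟨(x.1 : 𝓞 K), x.1.2, (hkf_iff x.1 n).mp x.2⟩ with hg
  have hg_bij : ∀ n, Function.Bijective (g n) := by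
    intro n
    constructor
    · intro x x' h
      apply Subtype.ext; apply Subtype.ext
      exact congrArg (fun z => (z.1 : 𝓞 K)) h
    · rintro ⟨x, hx, hxn⟩
      exact ⟨⟨⟨x, hx⟩, (hkf_iff ⟨x, hx⟩ n).mpr hxn⟩, rfl⟩
  haveI hfin : ∀ n, Finite {x : 𝔞 // kf x = n} := fun n =>
    haveI := finite_norm_eq hK 𝔞 n
    Finite.of_injective (g n) (hg_bij n).1
  have h1 := (Equiv.hasSum_iff (Equiv.sigmaFiberEquiv kf)).mpr hsum
  refine h1.sigma fun n => ?_
  letI : Fintype {x : 𝔞 // kf x = n} := Fintype.ofFinite _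
  haveI : Finite {x : 𝓞 K // x ∈ 𝔞 ∧ Ideal.absNorm (Ideal.span {x}) = n * Ideal.absNorm 𝔞} :=
    finite_norm_eq hK 𝔞 n
  letI : Fintype {x : 𝓞 K // x ∈ 𝔞 ∧ Ideal.absNorm (Ideal.span {x}) = n * Ideal.absNorm 𝔞} :=
    Fintype.ofFinite _
  have h2 := hasSum_fintype (fun c : {x : 𝔞 // kf x = n} =>
    ((fun x : 𝔞 => (2 * π * I) ^ e * rayClassCoeff 𝔪 ψ (Ideal.span {(x : 𝓞 K)}) *
        cexp (2 * π * I * (τ : ℂ)) ^ (Ideal.absNorm (Ideal.span {(x : 𝓞 K)}) / Ideal.absNorm 𝔞)) ∘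
      (Equiv.sigmaFiberEquiv kf)) ⟨n, c⟩)
  have hterm : ∀ c : {x : 𝔞 // kf x = n},
      ((fun x : 𝔞 => (2 * π * I) ^ e * rayClassCoeff 𝔪 ψ (Ideal.span {(x : 𝓞 K)}) *
        cexp (2 * π * I * (τ : ℂ)) ^ (Ideal.absNorm (Ideal.span {(x : 𝓞 K)}) / Ideal.absNorm 𝔞)) ∘
        (Equiv.sigmaFiberEquiv kf)) ⟨n, c⟩ =
        (2 * π * I) ^ e * rayClassCoeff 𝔪 ψ (Ideal.span {((g n c).1 : 𝓞 K)}) * cexp (2 * π * I * (τ : ℂ)) ^ n := by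
    intro c
    simp only [Function.comp_apply, Equiv.sigmaFiberEquiv_apply, hg]
    have : Ideal.absNorm (Ideal.span {((c.1 : 𝔞) : 𝓞 K)}) / Ideal.absNorm 𝔞 = n := c.2
    rw [this]
  have hval : ∑ c : {x : 𝔞 // kf x = n},
      ((fun x : 𝔞 => (2 * π * I) ^ e * rayClassCoeff 𝔪 ψ (Ideal.span {(x : 𝓞 K)}) *
        cexp (2 * π * I * (τ : ℂ)) ^ (Ideal.absNorm (Ideal.span {(x : 𝓞 K)}) / Ideal.absNorm 𝔞)) ∘
        (Equiv.sigmaFiberEquiv kf)) ⟨n, c⟩ =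
      ((2 * π * I) ^ e * ∑ᶠ x : {x : 𝓞 K // x ∈ 𝔞 ∧
        Ideal.absNorm (Ideal.span {x}) = n * Ideal.absNorm 𝔞}, rayClassCoeff 𝔪 ψ (Ideal.span {x.1})) *
        cexp (2 * π * I * (τ : ℂ)) ^ n := by
    simp only [hterm]
    rw [← Finset.sum_mul, ← Finset.mul_sum, finsum_eq_sum_of_fintype,
      Fintype.sum_bijective (g n) (hg_bij n) (fun c => rayClassCoeff 𝔪 ψ (Ideal.span {((g n c).1 : 𝓞 K)}))
        (fun x => rayClassCoeff 𝔪 ψ (Ideal.span {x.1})) (fun c => rfl)]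
  rw [hval] at h2
  exact h2

end Literature.NumberTheory.EllipticCurves.ModularForms.HeckeTheta

end Part18

/-!
## Part 19 — port of `Summits/BirchSwinnertonDyer/BirchSwinnertonDyer/Theorems/ResidualThetaTransportAtTwoHeckeThetaHigherWeightAssembly.lean` (1 declarations kept)

# Hecke's theta series of a weight-`(e+1)` Größencharakter is a cusp form on `Γ₀(|d_K|·N𝔪)` (`e` odd)

Declarations of this Part (verbatim port; each keeps its own docstring and citation): `exists_heckeTheta_cuspForm_pow`.

Reference keys (see `references.bib` and the declarations' citations): [Ribet1977Nebentypus].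
-/

section Part19

open scoped _root_.NumberField ComplexConjugate _root_.Real _root_.MatrixGroups _root_.UpperHalfPlane _root_.ModularForm nonZeroDivisors
open _root_.NumberField _root_.Module _root_.Matrix _root_.Complex _root_.Filter _root_.IsDedekindDomain _root_.CongruenceSubgroup

namespace Literature.NumberTheory.EllipticCurves.ModularForms.HeckeTheta

open Literature.Analysis.SpecialFunctions
open Literature.NumberTheory.ModularForms.BinaryTheta
open Literature.NumberTheory.Automorphic (siegelUpperHalfSpace mem_siegelUpperHalfSpace_iff)
open Literature.NumberTheory.LFunctions (idealPow rayClassCoeff exists_isCoprime_mk0_eq)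
open Literature.NumberTheory.EllipticCurves.ModularForms (rayClassCoeff_mul_of_ne_bot)

variable {K : Type} [Field K] [NumberField K]

/-! ### The cusp form -/

/-- **Hecke's weight-`(e+1)` theta series `θ_ψ ∈ S_{e+1}(Γ₀(|d_K|·N𝔪))` (`e` odd) with
`θ_ψ(τ) = Σ_n (Σ_{N𝔞 = n} ψ̃_𝔪(𝔞)) qⁿ`** (order-`e` analogue of `exists_heckeTheta_cuspForm`).
[cite: Ribet1977Nebentypus, §3 (supporting lemma)] -/
theorem exists_heckeTheta_cuspForm_pow (hK : finrank ℚ K = 2) [IsTotallyComplex K] (σ : K →+* ℂ)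
    {κ : DirichletCharacter ℂ (discr K).natAbs} (hprim : κ.IsPrimitive) (hodd : κ.Odd)
    (hquad : κ ^ 2 = 1) (hκJ : ∀ n : ℕ, Odd n → κ n = (jacobiSym (discr K) n : ℂ))
    (hζ : ∀ s : ℂ, 1 < s.re → NumberField.dedekindZeta K s = riemannZeta s * LSeries (fun n => κ n) s)
    {𝔪 : Ideal (𝓞 K)} (h𝔪 : 𝔪 ≠ ⊥) (h𝔪1 : 𝔪 ≠ ⊤) {ψ : HeightOneSpectrum (𝓞 K) → ℂ} {e : ℕ} (he : Odd e)
    (hψ0 : ∀ v : HeightOneSpectrum (𝓞 K), ¬ 𝔪 ≤ v.asIdeal → ψ v ≠ 0)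
    (hψ : ∀ b c : 𝓞 K, b ≠ 0 → c ≠ 0 → IsCoprime (Ideal.span {c}) 𝔪 → b - c ∈ 𝔪 →
      idealPow K ψ (Ideal.span {b}) = idealPow K ψ (Ideal.span {c}) * σ ((b : K) / c) ^ e)
    (hneb : ∀ n : ℕ, Odd n → n.Coprime ((discr K).natAbs * Ideal.absNorm 𝔪) →
      idealPow K ψ (Ideal.span {(n : 𝓞 K)}) = (jacobiSym (discr K) n : ℂ) * (n : ℂ) ^ e)
    [NeZero ((discr K).natAbs * Ideal.absNorm 𝔪)] :
    ∃ g : CuspForm (Gamma0 ((discr K).natAbs * Ideal.absNorm 𝔪)) ((e + 1 : ℕ) : ℤ), ∀ τ : ℍ,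
      HasSum (fun n : ℕ => (∑ᶠ J ∈ {J : Ideal (𝓞 K) | Ideal.absNorm J = n}, rayClassCoeff 𝔪 ψ J) *
        cexp (2 * π * I * (τ : ℂ)) ^ n) (g τ) := by
  classical
  have hM : Ideal.absNorm 𝔪 ≠ 0 := by rw [Ne, Ideal.absNorm_eq_zero_iff]; exact h𝔪
  haveI hfu : Finite (𝓞 K)ˣ := finite_units hK
  have hw : ((Nat.card (𝓞 K)ˣ : ℕ) : ℂ) ≠ 0 := by exact_mod_cast Nat.card_pos.ne'
  have h2πI : (2 * π * I : ℂ) ≠ 0 := by simp [Real.pi_ne_zero]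
  have h2πIe : (2 * π * I : ℂ) ^ e ≠ 0 := pow_ne_zero _ h2πI
  -- class representatives prime to `𝔪`
  choose 𝔞r h𝔞r0 h𝔞r using fun c : ClassGroup (𝓞 K) => exists_isCoprime_mk0_eq (K := K) h𝔪 c
  have hrcc0 : ∀ c, rayClassCoeff 𝔪 ψ (𝔞r c) ≠ 0 := fun c =>
    rayClassCoeff_ne_zero_of_isCoprime hψ0 (h𝔞r0 c) (h𝔞r c).1
  have h𝔟0 : ∀ c, 𝔞r c * 𝔪 ≠ ⊥ := fun c => mul_ne_zero (h𝔞r0 c) h𝔪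
  -- Gram data of `𝔟_c = 𝔞_c 𝔪`
  choose bc Bc hBc hsymmc h00c h11c hdetc hposc using fun c => exists_gram hK σ (h𝔟0 c)
  have huc : ∀ c, (fun i => σ ((bc c i : 𝓞 K) : K)) ⬝ᵥ (((Bc c).map ((↑) : ℤ → ℂ)).adjugate *ᵥ
      fun i => σ ((bc c i : 𝓞 K) : K)) = 0 := fun c =>
    dotProduct_adjugate_embedding_eq_zero σ (bc c) (hBc c)
      (by rw [Ne, Ideal.absNorm_eq_zero_iff]; exact h𝔟0 c)
  haveI hfin : ∀ c, Fintype (𝓞 K ⧸ 𝔞r c * 𝔪) := fun c =>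
    @Fintype.ofFinite _ (Ideal.finiteQuotientOfFreeOfNeBot _ (h𝔟0 c))
  have hmem : ∀ c (x₀ : 𝓞 K), x₀ ∈ 𝔞r c → (Ideal.absNorm 𝔪 : 𝓞 K) * x₀ ∈ 𝔞r c * 𝔪 :=
    fun c x₀ h => by simpa only [mul_comm x₀] using Ideal.mul_mem_mul h (Ideal.absNorm_mem 𝔪)
  -- the coset theta functions
  obtain ⟨Θ, hΘdef⟩ : ∃ Θ : ClassGroup (𝓞 K) → 𝓞 K → ℍ → ℂ, Θ = fun c x₀ (τ : ℍ) =>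
      if h : x₀ ∈ 𝔞r c then iteratedDeriv e (fun s : ℂ => riemannThetaChar
        (fun i => (((bc c).equivFun ⟨(Ideal.absNorm 𝔪 : 𝓞 K) * x₀, hmem c x₀ h⟩ i : ℤ) : ℂ) /
          (Ideal.absNorm 𝔪 : ℕ)) 0
        ((((Ideal.absNorm 𝔪 : ℕ) : ℂ) * (τ : ℂ)) • (Bc c).map ((↑) : ℤ → ℂ))
        (s • fun i => σ (((bc c) i : 𝓞 K) : K))) 0
      else 0 := ⟨_, rfl⟩
  have hΘ : ∀ c, ∀ x₀ ∈ 𝔞r c, ∀ k : Fin 2 → ℤ,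
      (((bc c).equivFun.symm k : ↥(𝔞r c * 𝔪)) : 𝓞 K) = (Ideal.absNorm 𝔪 : 𝓞 K) * x₀ →
      ∀ τ : ℍ, Θ c x₀ τ = iteratedDeriv e (fun s : ℂ => riemannThetaChar
        (fun i => (k i : ℂ) / (Ideal.absNorm 𝔪 : ℕ)) 0
        ((((Ideal.absNorm 𝔪 : ℕ) : ℂ) * (τ : ℂ)) • (Bc c).map ((↑) : ℤ → ℂ))
        (s • fun i => σ (((bc c) i : 𝓞 K) : K))) 0 := by
    intro c x₀ hx₀ k hk τ
    have hk' : (bc c).equivFun ⟨(Ideal.absNorm 𝔪 : 𝓞 K) * x₀, hmem c x₀ hx₀⟩ = k := by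
      have : (bc c).equivFun.symm k = ⟨_, hmem c x₀ hx₀⟩ := Subtype.ext hk
      rw [← this, LinearEquiv.apply_symm_apply]
    rw [hΘdef]
    simp only [dif_pos hx₀, hk']
  have hΘ0 : ∀ c x₀, x₀ ∉ 𝔞r c → ∀ τ : ℍ, Θ c x₀ τ = 0 := fun c x₀ h τ => by
    rw [hΘdef]; simp only [dif_neg h]
  have hρ : ∀ c (q : 𝓞 K ⧸ 𝔞r c * 𝔪), Ideal.Quotient.mk (𝔞r c * 𝔪) (Quotient.out q) = q :=
    fun c q => Ideal.Quotient.mk_out q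
  -- the class series and the normalised sum over classes
  obtain ⟨F, hFdef⟩ : ∃ F : ClassGroup (𝓞 K) → ℍ → ℂ, F = fun c (τ : ℍ) => ∑ q : 𝓞 K ⧸ 𝔞r c * 𝔪,
      rayClassCoeff 𝔪 ψ (Ideal.span {Quotient.out q}) / σ ((Quotient.out q : 𝓞 K) : K) ^ e *
        Θ c (Quotient.out q) τ := ⟨_, rfl⟩
  have hF : ∀ c τ, F c τ = ∑ q : 𝓞 K ⧸ 𝔞r c * 𝔪,
      rayClassCoeff 𝔪 ψ (Ideal.span {Quotient.out q}) / σ ((Quotient.out q : 𝓞 K) : K) ^ e *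
        Θ c (Quotient.out q) τ := fun c τ => by rw [hFdef]
  obtain ⟨coef, hcoef⟩ : ∃ coef : ClassGroup (𝓞 K) → ℂ, coef = fun c =>
      ((2 * π * I) ^ e * ((Nat.card (𝓞 K)ˣ : ℕ) : ℂ) * rayClassCoeff 𝔪 ψ (𝔞r c))⁻¹ := ⟨_, rfl⟩
  obtain ⟨f, hfdef⟩ : ∃ f : ℍ → ℂ, f = fun τ : ℍ => ∑ c, coef c * F c τ := ⟨_, rfl⟩
  -- (1) `f` lies in the theta span
  have hfspan : f ∈ Submodule.span ℂ {F : ℍ → ℂ | ∃ (P : Matrix (Fin 2) (Fin 2) ℚ), P.IsSymm ∧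
      (P.map (Rat.cast : ℚ → ℝ)).PosDef ∧ ∃ (a b : Fin 2 → ℚ) (u : Fin 2 → ℂ),
        u ⬝ᵥ ((P.map (Rat.cast : ℚ → ℂ)).adjugate *ᵥ u) = 0 ∧ F = fun τ : ℍ =>
          iteratedDeriv e (fun s : ℂ => riemannThetaChar (fun i => (a i : ℂ)) (fun i => (b i : ℂ))
            ((τ : ℂ) • P.map (Rat.cast : ℚ → ℂ)) (s • u)) 0} := by
    have hfeq : f = ∑ c, coef c • F c := by
      funext τ; rw [hfdef]; simp [Finset.sum_apply]
    rw [hfeq]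
    refine Submodule.sum_mem _ fun c _ => Submodule.smul_mem _ _ ?_
    exact classThetaPow_mem_span σ h𝔪 ψ e (𝔞 := 𝔞r c) rfl (bc c) (hsymmc c) (hposc c) (huc c) (Θ c)
      (hΘ c) (hΘ0 c) (fun q => Quotient.out q) (F c) (hF c)
  -- (2) the law on `Γ₀(|d_K| M)`
  have hinv : ∀ γ : SL(2, ℤ), γ ∈ Gamma0 ((discr K).natAbs * Ideal.absNorm 𝔪) →
      f ∣[((e + 1 : ℕ) : ℤ)] γ = f := by
    intro γ hγ
    obtain ⟨hc, hd⟩ := dvd_and_isCoprime_of_mem_Gamma0 hγ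
    have hone := kappa_mul_chiPow_eq_one hK σ hodd hκJ h𝔪 he hψ hneb hd
    funext τ
    rw [ModularForm.SL_slash_apply, ModularGroup.denom_apply]
    have hX : (((γ 1 0 : ℤ) : ℂ) * (τ : ℂ) + ((γ 1 1 : ℤ) : ℂ)) ≠ 0 := by
      have := UpperHalfPlane.denom_ne_zero γ τ
      rwa [ModularGroup.denom_apply] at this
    have hFc : ∀ c, F c (γ • τ) = (((γ 1 0 : ℤ) : ℂ) * (τ : ℂ) + ((γ 1 1 : ℤ) : ℂ)) ^ (e + 1) * F c τ := by
      intro c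
      rw [classThetaPow_moeb hK σ hprim hodd hquad hζ h𝔪 he hψ (𝔞 := 𝔞r c) rfl (h𝔞r0 c) (bc c) (hBc c)
        (hsymmc c) (h00c c) (h11c c) (hdetc c) (hposc c) (Θ c) (hΘ c) (hΘ0 c) (fun q => Quotient.out q)
        (hρ c) (F c) (hF c) hc τ, hone, one_mul]
    have hfτ : f (γ • τ) = (((γ 1 0 : ℤ) : ℂ) * (τ : ℂ) + ((γ 1 1 : ℤ) : ℂ)) ^ (e + 1) * f τ := by
      rw [hfdef]
      simp only [hFc]
      rw [Finset.mul_sum]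
      exact Finset.sum_congr rfl fun c _ => by ring
    rw [hfτ, _root_.zpow_neg, zpow_natCast]
    field_simp
  -- (3) the cusp form
  obtain ⟨g, hg⟩ := exists_cuspForm_of_mem_lineSpan ((discr K).natAbs * Ideal.absNorm 𝔪) he.pos hfspan hinv
  refine ⟨g, fun τ => ?_⟩
  rw [hg, hfdef]
  -- (4) the `q`-expansion
  have hFs : ∀ c, HasSum (fun n : ℕ => ((2 * π * I) ^ e * ∑ᶠ x : {x : 𝓞 K // x ∈ 𝔞r c ∧
      Ideal.absNorm (Ideal.span {x}) = n * Ideal.absNorm (𝔞r c)}, rayClassCoeff 𝔪 ψ (Ideal.span {x.1})) *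
        cexp (2 * π * I * (τ : ℂ)) ^ n) (F c τ) := fun c =>
    hasSum_classThetaPow_nat hK σ h𝔪 h𝔪1 he.pos.ne' hψ (𝔞 := 𝔞r c) rfl (h𝔞r0 c) (bc c) (hBc c) (hsymmc c)
      (hposc c) (Θ c) (hΘ c) (hΘ0 c) (fun q => Quotient.out q) (hρ c) (F c) (hF c) τ
  have hsum := hasSum_sum (s := Finset.univ) fun c _ => (hFs c).mul_left (coef c)
  refine hsum.congr_fun fun n => ?_
  rw [show ∑ c, coef c * (((2 * π * I) ^ e * ∑ᶠ x : {x : 𝓞 K // x ∈ 𝔞r c ∧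
      Ideal.absNorm (Ideal.span {x}) = n * Ideal.absNorm (𝔞r c)}, rayClassCoeff 𝔪 ψ (Ideal.span {x.1})) *
        cexp (2 * π * I * (τ : ℂ)) ^ n) =
      (∑ c, coef c * ((2 * π * I) ^ e * ∑ᶠ x : {x : 𝓞 K // x ∈ 𝔞r c ∧
        Ideal.absNorm (Ideal.span {x}) = n * Ideal.absNorm (𝔞r c)}, rayClassCoeff 𝔪 ψ (Ideal.span {x.1}))) *
        cexp (2 * π * I * (τ : ℂ)) ^ n by
    rw [Finset.sum_mul]; exact Finset.sum_congr rfl fun c _ => by ring]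
  congr 1
  symm
  -- the coefficient identity
  by_cases hn : n = 0
  · subst hn
    rw [finsum_absNorm_zero, Literature.NumberTheory.LFunctions.rayClassCoeff_bot]
    refine Finset.sum_eq_zero fun c _ => ?_
    rw [finsum_eq_zero_of_forall_eq_zero, mul_zero, mul_zero]
    intro x
    have h0 : Ideal.absNorm (Ideal.span {(x.1 : 𝓞 K)}) = 0 := by simpa using x.2.2
    rw [Ideal.absNorm_eq_zero_iff.mp h0, Literature.NumberTheory.LFunctions.rayClassCoeff_bot]
  · -- weighted class count
    have hW := sum_weighted_norm_eq hK (fun c => ⟨𝔞r c, mem_nonZeroDivisors_iff_ne_zero.mpr (h𝔞r0 c)⟩)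
      (fun c => (h𝔞r c).2) hn (rayClassCoeff 𝔪 ψ)
      (fun c x => rayClassCoeff 𝔪 ψ (Ideal.span {x}) / rayClassCoeff 𝔪 ψ (𝔞r c)) ?_
    · dsimp only at hW
      calc ∑ c, coef c * ((2 * π * I) ^ e * ∑ᶠ x : {x : 𝓞 K // x ∈ 𝔞r c ∧
              Ideal.absNorm (Ideal.span {x}) = n * Ideal.absNorm (𝔞r c)}, rayClassCoeff 𝔪 ψ (Ideal.span {x.1}))
          = (((Nat.card (𝓞 K)ˣ : ℕ) : ℂ))⁻¹ * ∑ c, ∑ᶠ x : {x : 𝓞 K // x ∈ 𝔞r c ∧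
              Ideal.absNorm (Ideal.span {x}) = n * Ideal.absNorm (𝔞r c)},
              rayClassCoeff 𝔪 ψ (Ideal.span {x.1}) / rayClassCoeff 𝔪 ψ (𝔞r c) := by
            rw [Finset.mul_sum]
            refine Finset.sum_congr rfl fun c _ => ?_
            haveI : Finite {x : 𝓞 K // x ∈ 𝔞r c ∧ Ideal.absNorm (Ideal.span {x}) = n * Ideal.absNorm (𝔞r c)} :=
              finite_norm_eq hK (𝔞r c) n
            letI : Fintype {x : 𝓞 K // x ∈ 𝔞r c ∧ Ideal.absNorm (Ideal.span {x}) = n * Ideal.absNorm (𝔞r c)} :=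
              Fintype.ofFinite _
            rw [finsum_eq_sum_of_fintype, finsum_eq_sum_of_fintype, Finset.mul_sum, Finset.mul_sum,
              Finset.mul_sum]
            refine Finset.sum_congr rfl fun x _ => ?_
            rw [hcoef]
            field_simp
        _ = _ := by
            rw [hW, ← mul_assoc, inv_mul_cancel₀ hw, one_mul, finsum_subtype_absNorm_eq]
    · intro c x J hx hJ
      dsimp only at hx hJ ⊢
      by_cases hJ0 : J = ⊥
      · subst hJ0
        rw [Ideal.mul_bot] at hJ
        rw [hJ, Literature.NumberTheory.LFunctions.rayClassCoeff_bot, zero_div]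
      · have hx0 : Ideal.span {x} ≠ ⊥ := by rw [hJ]; exact mul_ne_zero (h𝔞r0 c) hJ0
        rw [hJ, rayClassCoeff_mul_of_ne_bot 𝔪 ψ (h𝔞r0 c) hJ0, mul_div_cancel_left₀ _ (hrcc0 c)]

end Literature.NumberTheory.EllipticCurves.ModularForms.HeckeTheta

end Part19

/-!
## Part 20 — port of `Summits/BirchSwinnertonDyer/BirchSwinnertonDyer/Theorems/ResidualThetaTransportAtTwoRibetCMNewformGammaZeroSupplyProof.lean` (2 declarations kept)

# `Ribet1977_cmNewform_gamma0_of_isGrossencharakter` proved: Hecke's weight-`k` theta series ⇒ the `Γ₀(N)`-CM-newform of a Größencharakter with trivial Nebentypus (item )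

Declarations of this Part (verbatim port; each keeps its own docstring and citation): `heckeThetaCuspForm_of_isGrossencharakter`, `ribet1977_cmNewform_gamma0_of_isGrossencharakter_proof`.

Reference keys (see `references.bib` and the declarations' citations): [Ribet1977Nebentypus].
-/

section Part20

open scoped _root_.NumberField ComplexConjugate _root_.Real _root_.MatrixGroups _root_.UpperHalfPlane _root_.ModularForm nonZeroDivisors
open _root_.NumberField _root_.Module _root_.Matrix _root_.Complex _root_.Filter _root_.IsDedekindDomain _root_.CongruenceSubgroup

namespace Literature.NumberTheory.EllipticCurves.ModularForms.HeckeTheta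

open Literature.Analysis.SpecialFunctions
open Literature.NumberTheory.ModularForms.BinaryTheta
open Literature.NumberTheory.LFunctions (idealPow rayClassCoeff idealPow_top)
open Literature.NumberTheory.GaloisRepresentations (IsGrossencharakter embType embTypeConj)
open Literature.NumberTheory.EllipticCurves.ModularForms (exists_kroneckerChar_odd_jacobiSym_dedekindZeta
  idealPow_span_eq_of_isGrossencharakter_weight Ribet1977_cmNewform_gamma0_of_isGrossencharakter
  Ribet1977_cmNewform_gamma0_of_isGrossencharakter_of_heckeTheta)

/-- **X_k (every even `k ≥ 2`): Hecke's theta series of a Größencharakter of type `(k-1, 0)` with trivial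
Nebentypus is a cusp form of weight `k` on `Γ₀(|d_K|·N𝔪)` with `q`-expansion `Σ_{(𝔞,𝔪)=1} ψ̃(𝔞) q^{N𝔞}`.**
[cite: Ribet1977Nebentypus, §3 (supporting lemma)] -/
theorem heckeThetaCuspForm_of_isGrossencharakter :
    ∀ (K : Type) [Field K] [NumberField K], finrank ℚ K = 2 → IsTotallyComplex K →
      ∀ (σ : K →+* ℂ) (k : ℕ), 2 ≤ k → Even k →
      ∀ (𝔪 : Ideal (𝓞 K)), 𝔪 ≠ ⊥ →
      ∀ (ψ : HeightOneSpectrum (𝓞 K) → ℂ),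
        IsGrossencharakter 𝔪 (fun w => ((k : ℤ) - 1) * embType σ w)
          (fun w => ((k : ℤ) - 1) * embTypeConj σ w) ψ →
        (∀ n : ℕ, Odd n → n.Coprime ((discr K).natAbs * Ideal.absNorm 𝔪) →
          idealPow K ψ (Ideal.span {(n : 𝓞 K)}) = (jacobiSym (discr K) n : ℂ) * (n : ℂ) ^ (k - 1)) →
        ∃ g : CuspForm (Gamma0 ((discr K).natAbs * Ideal.absNorm 𝔪)) (k : ℤ), ∀ τ : ℍ,
          HasSum (fun n : ℕ => (∑ᶠ J ∈ {J : Ideal (𝓞 K) | Ideal.absNorm J = n}, rayClassCoeff 𝔪 ψ J) *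
            cexp (2 * π * I * (τ : ℂ)) ^ n) (g τ) := by
  intro K _ _ hK htc σ k hk hkev 𝔪 h𝔪 ψ hψG hneb
  classical
  haveI := htc
  obtain ⟨e, rfl⟩ : ∃ e, k = e + 1 := ⟨k - 1, by omega⟩
  have he : Odd e := by
    rcases Nat.even_or_odd e with h | h
    · exfalso
      obtain ⟨r, hr⟩ := hkev
      obtain ⟨s, hs⟩ := h
      omega
    · exact h
  haveI : NeZero (discr K).natAbs := ⟨Int.natAbs_ne_zero.mpr (NumberField.discr_ne_zero K)⟩
  have hM : Ideal.absNorm 𝔪 ≠ 0 := by rw [Ne, Ideal.absNorm_eq_zero_iff]; exact h𝔪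
  haveI hN₀ : NeZero ((discr K).natAbs * Ideal.absNorm 𝔪) := ⟨mul_ne_zero (NeZero.ne _) hM⟩
  -- the Kronecker character
  obtain ⟨κ, hprim, hodd, hquad, hκJ, hζ⟩ := exists_kroneckerChar_odd_jacobiSym_dedekindZeta (K := K) hK
  -- the weight-`k` Größencharakter relation on the ray
  have hψ : ∀ b c : 𝓞 K, b ≠ 0 → c ≠ 0 → IsCoprime (Ideal.span {c}) 𝔪 → b - c ∈ 𝔪 →
      idealPow K ψ (Ideal.span {b}) = idealPow K ψ (Ideal.span {c}) * σ ((b : K) / c) ^ e := by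
    intro b c hb hc hcop hbc
    have h := idealPow_span_eq_of_isGrossencharakter_weight σ (e + 1) hψG b c hb hc hcop hbc
    rw [h]
    congr 1
    rw [show ((((e + 1 : ℕ) : ℤ)) - 1) = ((e : ℕ) : ℤ) by push_cast; ring, zpow_natCast]
  have hψ0 : ∀ v : HeightOneSpectrum (𝓞 K), ¬ 𝔪 ≤ v.asIdeal → ψ v ≠ 0 := hψG.ne_zero
  -- the modulus is not `1`: `ψ̃((-1)) = ψ̃((1)) σ(-1)ᵉ = -1` is impossible
  have h𝔪1 : 𝔪 ≠ ⊤ := by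
    intro h𝔪T
    have h := hψ (-1) 1 (by simp) one_ne_zero
      (by rw [Ideal.span_singleton_one, ← Ideal.one_eq_top]; exact isCoprime_one_left) (by rw [h𝔪T]; trivial)
    rw [Ideal.span_singleton_neg, Ideal.span_singleton_one, idealPow_top] at h
    have hσ : σ (((-1 : 𝓞 K) : K) / ((1 : 𝓞 K) : K)) = -1 := by simp
    rw [hσ, he.neg_one_pow] at h
    norm_num at h
  -- the clause at weight `e + 1`
  have hneb' : ∀ n : ℕ, Odd n → n.Coprime ((discr K).natAbs * Ideal.absNorm 𝔪) →
      idealPow K ψ (Ideal.span {(n : 𝓞 K)}) = (jacobiSym (discr K) n : ℂ) * (n : ℂ) ^ e := by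
    intro n hn hc
    rw [hneb n hn hc, Nat.add_sub_cancel]
  exact exists_heckeTheta_cuspForm_pow hK σ hprim hodd hquad hκJ hζ h𝔪 h𝔪1 he hψ0 hψ hneb'

/-- **The named fact `Ribet1977_cmNewform_gamma0_of_isGrossencharakter` HOLDS — EXACT name `Ribet1977_cmNewform_gamma0_of_isGrossencharakter_holds`** (Hecke's theta
series at every even weight; odd weights are vacuous by the trivial-Nebentypus clause).
[cite: Ribet1977Nebentypus, §3 (supporting lemma)] -/
theorem _root_.Literature.NumberTheory.EllipticCurves.ModularForms.Ribet1977_cmNewform_gamma0_of_isGrossencharakter_holds :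
    Ribet1977_cmNewform_gamma0_of_isGrossencharakter :=
  Ribet1977_cmNewform_gamma0_of_isGrossencharakter_of_heckeTheta heckeThetaCuspForm_of_isGrossencharakter

end Literature.NumberTheory.EllipticCurves.ModularForms.HeckeTheta

end Part20

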